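import Mathlib
import Literature.Probability.LatticeModels.ZdBoxesLines
import Literature.MathematicalPhysics.QuantumFieldTheory.Balaban1983to89.B6LevelGapMetric
import Literature.MathematicalPhysics.QuantumFieldTheory.Balaban1983to89.B6Lemma21TwoScale

/-!
# `Balaban1983to89.B6BoxCharts` — [Balaban1984PropagatorsII] Sect. A p. 231 (the class of admissible contours) with
(2.1)/(2.4) p. 224 and (2.66) p. 234: BOX CHARTS of the lattices Λ_j inside the graph of admissible bonds.  The two
located inputs of the pv08 chain that concern the EXISTENCE and the LENGTH of admissible contours — (α) *"admissible
contours exist"* (`C.bond.Connected`, cell GAPS.md G-pv08g2-1) and the in-box comparison *"d(y,y″) ≤ O(1)·(L^jη)^{−1}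
|y − y″|"* behind (2.66) (GAPS.md G-pv08-1) — KERNEL-REDUCED to block data: a cover of the lattice points by boxes of
Λ_j-points all of whose Λ_j-bonds are admissible, with connected overlap (linkage) pattern.
v1.1 [append-only]: §7 — distances ACROSS charts (linked boxes, nerve chains, the exponential shift of (2.66), the
one-scale block partition of ℤ^d), item 6 below; and two docstring corrections after the cross-read (cell GAPS.md
C-pv23g7-12): (2.66) is now quoted in full, and the (2.4) quotation in the docstring of `Atlas.Covers` is corrected.
No v1 declaration, statement or proof is changed.
v1.2 [append-only]: §8 — a TWO-SCALE instance of §§3, 7 (item 7 below): blocks of the η-lattice on one side of a hyperplane Σ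
and blocks of the Lη-lattice on the other, glued through the Lη-lattice points lying on Σ; the blocks of §7 partition ℤ^d
(`blockAtlas_disjoint`, cross-read cell GAPS.md C-pv08g5-3 / pv22-g16 INFO I-2).  No v1 / v1.1 declaration, statement or
proof is changed.
v1.3 [append-only]: §8e — the LINEAR, M-UNIFORM comparison in the two-scale model of §8 (item 8 below): for all points
u, v of `twoScalePts`, `dist u v ≤ ‖u − v‖₁ + (L − 1)` (ℓ¹ distance in η-units; constant 1 and no additive term from the fine
side of Σ or within one scale), and the (2.66)-shaped exponential transfer.  No v1 / v1.1 / v1.2 declaration, statement or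
proof is changed.
v1.4 [append-only]: §9 — THE WINDOW SUM OF (2.66) in the two-scale model of §8 (item 9 below): ℤ^d exponential sums (by
name from the tree's counting lemma behind Lemma 2.1 — new import `…B6Lemma21TwoScale`, NOT modified), the depth below Σ
with exact vertical distances, and the last «≤» of (2.66) DECIDED BOTH WAYS in the model: M-uniform at the printed rate
½δ₀ under the per-cube decay (2.43)/(2.44) on the scale of the cube; NOT M-uniform for the display's single exponent read
literally (ratio ≥ M + 1), M-uniform again only after the rate loss ½δ₀ ↦ δ′ < δ₀/L (sharp).  No v1 / v1.1 / v1.2 / v1.3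
declaration, statement or proof is changed.

CITATION HEADER (lean-in-tree rule 2026-08-18).  Source: T. Bałaban, *Propagators and renormalization transformations for
lattice gauge theories. II*, Commun. Math. Phys. **96**, 223–250 (1984), doi:10.1007/bf01240221 (cell paper B6; held:
`paper:balaban1984-cmp96-propagators-rt-ii`; journal page = PDF page + 222; the quotations below were read from the page
renders pp. 223, 224, 231, 234 [PDF 1, 2, 9, 12], `b2b-balaban-ref1/pages/1984-cmp96-propagators-rt-II/…-p001, p002,
p009, p012-x2.png`; [v1.4] also pp. 229, 230, 247 [PDF 7, 8, 25], `…-p007, p008, p025-x2.png`, quoted in §9).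
Third geometric companion of `…Balaban1983to89.B6Geometry` (pv08 gen 2: the contour system `ContourSystem g`, the
distance (2.46) `dist246`, `Realizes`, `ineq260_of_levelGap`) and `…Balaban1983to89.B6LevelGapMetric` (gen 4: (len)
`BondScale`, (sep) `ZoneSep`/`Cond22`, `ineq260_of_cond22`), both IMPORTED and NOT modified; the lattice ℤ^d, its
nearest-neighbour graph `zdGraph d`, coordinate boxes `cbox`, the ℓ¹ and sup distances `latL1Dist`, `supDist` and the
monotone step `exists_step_towards` are the tree's (`Literature.Probability.LatticeModels.LatticeGraph`, `.StarLattice`,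
`.ZdBoxesLines`), used BY NAME.  [v1.4] `…Balaban1983to89.B6Lemma21TwoScale` (the counting lemma `sum_exp_le_c0_pow` behind
(2.58)/(2.61), with the constant `B6.c0` of Lemma 2.1) is IMPORTED for §9 and NOT modified.

THE PRINTED INPUTS (verbatim).  p. 231 [9]: *"For an arbitrary contour Γ on the lattice T_η we put |Γ| = nη, where n is
a number of bonds the contour Γ consists of. We will define a new distance between two points of 𝔅. We consider a special
class of contours Γ. They have the property that a part of Γ contained in B^j(Λ_j) consists of bonds of the lattice Λ_j.
Now we define d(y, y′) = inf_{Γ_{y,y′}} Σ_{j=0}^k (L^jη)^{−1}|Γ_{y,y′} ∩ B^j(Λ_j)|, y, y′ ∈ 𝔅, (2.46) where the infimum is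
taken over all admissible contours described above, with end-points, y, y′."*; *"The domain Ω_j is a sum of cubes of the
size ML^jη."*; *"Of course the infimum is attained at some contour Γ_{y,y′}."* (existence of an admissible contour joining
y to y′ is presupposed — input (α)).  p. 223 [1]: *"The only notation we would like to mention here is that a distance
between two points x, y ∈ ηZ^d, η > 0, is given by the l¹-norm of the vector x − y and is denoted by |x − y|, i.e.
|x − y| = Σ_{μ=1}^d |x_μ − y_μ|. This distance depends of course on the scale of the lattice."*  p. 224 [2]: (2.2) *"Ω_j =
B^j(Ω_j^{(j)}), Ω_j^{(j)} ⊂ T^{(j)}_{L^jη} and it is a sum of big blocks,"*; (2.3) *"Λ_j = Ω_j^{(j)}∖Ω_{j+1}^{(j)}, j = 1, …,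
k − 1, Λ_k = Ω_k^{(k)}, Λ_0 = Ω_1^c"* (so Λ_j, j ≥ 1, is a set of points of the lattice T^{(j)}_{L^jη} of spacing L^jη);
(2.4) *"Ω_1 = ⋃_{j=1}^k B^j(Λ_j), T = ⋃_{j=0}^k B^j(Λ_j), where B⁰(Λ_0) = Λ_0."*  p. 234 [12], (2.66) (quoted in full
[v1.1]): *"and this implies finally for x ∈ B^j(y), supp λ ⊂ B^{j′}(y′), |(G′λ)(x)| ≤ Σ_{n=0}^∞ |(G′₀Rⁿλ)(x)| ≤ O(1)(L^jη)² ·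
Σ_{y″:(L^jη)^{−1}|y−y″| ≤ 2dM} e^{−δ₀(L^jη)^{−1}|y−y″|} · Σ_{n=0}^∞ (O(M^{−1})c₁)^n e^{−½δ₀d(y″,y′)}|λ|
≤ O(1)(L^jη)² e^{−½δ₀d(y,y′)}|λ|. (2.66)"* — its last «≤» needs d(y, y′) ≤ d(y, y″) + d(y″, y′) ((2.54), kernel-checked in the gen-2
sibling) AND d(y, y″) ≤ O(1)·(L^jη)^{−1}|y − y″| for the y″ in range, which is printed nowhere (GAPS.md G-pv08-1).

THE DICTIONARY (ours, continuing the siblings').  `G : SimpleGraph V` = the graph of admissible bonds on the lattice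
points `V` (= `C.bond` on `C.Pt` for a `ContourSystem`); a BOX CHART (§2) is a map `φ : ℤ^d → V` together with a
coordinate-box-closed set `B ⊂ ℤ^d` (`CboxClosed B`; every order box `Set.Icc lo hi` is one) such that φ carries every
nearest-neighbour bond of ℤ^d with both end-points in B to an admissible bond — this is the sentence *"a part of Γ
contained in B^j(Λ_j) consists of bonds of the lattice Λ_j"* read as: the Λ_j-points of a cube of Λ_j-points inside
B^j(Λ_j) (a block, a big block *"of the size ML^jη"*, a cube □, or any box-shaped union of blocks), with ALL their
Λ_j-bonds, are available to admissible contours.  An ATLAS (§3) is a family of box charts; its NERVE joins two charts that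
are LINKED — having a lattice point in common (closed adjacent blocks share the Λ_j-points of a common face; a block of
Λ_j-points meeting Σ_{j+1} shares its points on Σ_{j+1} ∩ Λ_{j+1} with a block of Λ_{j+1}-points) or joined by an
admissible bond (half-open adjacent blocks: the Λ_j-bonds crossing the common face).  POSITIONS (§4): `pos : V → X`
into any pseudo-metric space (T_η, ℝ^d); a chart is drawn AT SPACING ≤ s (`SpacingLe`: |pos φx − pos φy| ≤ s·‖x − y‖₁,
s = L^jη by (2.2)–(2.3) and p. 223) resp. ≥ s UP TO K (`SpacingGe`: s·‖x − y‖₁ ≤ K·|pos φx − pos φy|; K = 1 for Bałaban's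
ℓ¹ distance of p. 223, K = d for the sup distance of ℝ^d); the AFFINE instance pos (φ x) = c + s·x ∈ ℝ^d (§4b) has both.

WHAT IS PROVED (kernel, no `sorry`, axioms = the three standard ones).
1. [folklore, ℤ^d] `latL1Dist_le_length` (‖u − y‖₁ ≤ the number of bonds of any nearest-neighbour walk from u to y),
   `exists_walk_in_cbox` (a staircase walk of exactly ‖u − y‖₁ bonds inside the coordinate box of u, y),
   `zdGraph_dist_eq_latL1Dist` (graph distance of ℤ^d = ‖·‖₁), `cbox_subset_Icc` (order boxes are coordinate-box
   closed), `latL1Dist_le_mul_supDist` (‖·‖₁ ≤ d·‖·‖_∞).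
2. [p. 231 read through the dictionary] for a box chart (B, φ) of G: `exists_walk_of_chart` / `reachable_of_chart` (an
   admissible contour of ‖u − y‖₁ bonds joins φ u to φ y for u, y ∈ B) and `dist_le_latL1Dist_of_chart`
   (d_G(φ u, φ y) ≤ ‖u − y‖₁ — the distance (2.46) between two points of one admissible box is at most their Λ_j-lattice
   ℓ¹-distance, i.e. (L^jη)^{−1}‖y − y″‖₁: the in-box case of G-pv08-1 with constant 1).
3. [folklore gluing] for an atlas whose charts cover V and whose nerve is preconnected: `reachable_of_atlas`,
   `preconnected_of_atlas`, `connected_of_atlas` — input (α) `G.Connected` REDUCED to block data; over a contour system: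
   `bond_connected_of_atlas`, and the gen-2/gen-4 (2.60)-theorems with `hconn` so discharged: `ineq260_of_atlas`.
4. [p. 231 + (2.2)–(2.3) + p. 223] positions: `dist_pos_le_of_adj` (a charted Λ_j-bond drawn at spacing ≤ s has
   T_η-length ≤ s), hence `bondScale_of_charts` — (len) `BondScale G zone pos ℓ` of the gen-4 sibling DISCHARGED for
   graphs all of whose bonds are lattice bonds of charts of scale index ≤ the zones of their points drawn at spacing
   ≤ ℓ(scale index) — and the metric comparison `spacing_mul_dist_le_of_chart`: s·d_G(φ u, φ y) ≤ K·|pos(φ u) − pos(φ y)|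
   for a chart drawn at spacing ≥ s up to K; the affine instance (`spacingLe_of_affine`, `spacingGe_of_affine` with
   K = d for the sup metric, and `spacing_mul_dist_le_sum_of_chart`: s·d_G ≤ Σ_μ |pos_μ − pos′_μ| = Bałaban's |pos − pos′|,
   constant 1); over a contour system: `bondScale22_of_charts` ((len) `BondScale22 C pos`), `ineq260_of_charts` ((2.60)
   with BOTH `hconn` and (len) from block data, (2.2) `Cond22` kept), and for a realised geometry (`Realizes g C`)
   `dist246_le_of_chart` (d(y, y″) ≤ ‖x − x″‖₁ in Λ_j-units), `len_mul_dist246_le_of_chart` (L^jη·d(y, y″) ≤ K·|y − y″|)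
   and `len_mul_dist246_le_sum_of_chart` (L^jη·d(y, y″) ≤ Σ_μ |y_μ − y″_μ| = |y − y″|: the comparison used in (2.66) with
   O(1) = 1 in the paper's own ℓ¹ distance) for block points y, y″ of a common admissible Λ_j-box.
5. NON-VACUITY [folklore]: the unit-box atlas of ℤ^d itself (one zone, charts = the unit cubes Icc a (a+1) with the
   identity map, positions = the inclusion ℤ^d ⊂ ℝ^d): cover, nerve preconnectedness, (len) with ℓ ≡ 1 and the
   conclusions hold (`unitAtlas_*`, `zdGraph_connected_of_unitAtlas`, `bondScale_unitAtlas`, `dist_le_of_unitBox`).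
6. [v1.1, §7: folklore gluing + (2.54)] distances ACROSS charts: `IsBoxChart.union` (two charts with one chart map over a
   coordinate-box closed union whose cross bonds are admissible form one chart — big blocks, box-shaped unions of
   blocks); `LatWidth` (ℓ¹-width of a box: `latWidth_Icc`, `latWidth_Icc_of_side` — side ≤ M ⇒ width ≤ d·M);
   `dist_le_of_linked_at` / `dist_le_of_linked` (points of two LINKED boxes are at admissible distance
   ≤ ‖u − x‖₁ + 1 + ‖x′ − u′‖₁, ≤ 2w + 1 for widths ≤ w); `dist_le_of_nerve_walk` / `dist_le_of_nerve_reachable` /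
   `dist_le_of_nerve_dist_le` (along a nerve chain of n links: ≤ w + n(w + 1)); over a realised contour system
   `dist246_le_of_nerve_walk`, `dist246_le_of_nerve_dist_le` (d(y, y″) ≤ w + n(w + 1) for block points whose lattice
   points lie in boxes at nerve distance ≤ n), and the EXPONENTIAL SHIFT of the last «≤» of (2.66): `exp_shift_of_dist_le`
   ((2.54) + d(y, y″) ≤ D ⇒ e^{−½δ₀d(y″,y′)} ≤ e^{½δ₀D}·e^{−½δ₀d(y,y′)}, δ₀ ≥ 0), `sum_exp_shift_of_dist_le` (the y″-sum
   with nonnegative weights: Σ a(y″)e^{−½δ₀d(y″,y′)} ≤ (Σ a(y″)e^{½δ₀D(y″)})·e^{−½δ₀d(y,y′)}), `exp_shift_of_nerve_dist_le`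
   (D = w + n(w + 1) from block data, (2.54) from `Realizes` + `bond.Connected`); NON-VACUITY on the one-scale partition
   of ℤ^d into DISJOINT blocks of side M ≥ 1 linked through face-crossing bonds (`blockAtlas`: `blockAtlas_covers`,
   `blockAtlas_linked_add_single`, `blockAtlas_nerve_preconnected`, `blockAtlas_nerve_dist_le`,
   `zdGraph_connected_of_blockAtlas`, `dist_le_of_blockAtlas`: d ≤ d(M − 1) + ‖a − b‖₁(d(M − 1) + 1) for points of the
   blocks a, b) and on the unit atlas (`latWidth_unitBox`, `unitAtlas_nerve_dist_le`, `dist_le_of_unitAtlas`).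
7. [v1.2, §8: folklore model of (2.1)–(2.4) p. 224 with k = 1] the TWO-SCALE bond graph `twoScaleGraph d L M μ` on the
   η-lattice ℤ^d (lattice coordinates): η-bonds between FINE points (x_μ < M) and Lη-bonds {L·y, L·y′}, y ∼ y′, between
   COARSE points (y_μ, y′_μ ≥ 0; the Lη-lattice point y IS the η-lattice point `scalePt L y` = L·y, as T^{(1)}_{Lη} ⊂ T_η);
   the other η-lattice points are isolated (`twoScaleGraph_not_adj_of_not_mem`: the graph restricted to the point set
   `twoScalePts` = fine ∪ coarse points is the one described).  Its two-scale BLOCK ATLAS `twoScaleAtlas` (index set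
   ℤ^d ⊔ ℤ^d: fine blocks a, a_μ ≤ 0, of side M with identity charts; coarse blocks b, b_μ ≥ 0, of side M with charts
   y ↦ L·y; empty boxes elsewhere): adjacent blocks of one level are linked through the crossing bond
   (`twoScale_linked_inl/inr_add_single`), and the fine block L·b₀ and the coarse block b₀ with (b₀)_μ = 0 are linked
   through the SHARED lattice point L·(M·b₀) = M·(L·b₀) (`twoScale_linked_interface`: the first clause of `Atlas.Linked`
   at work ACROSS levels — a point of Λ₁ on Σ₁ is a point of both lattices); the index maps `Sum.inl`, `Sum.inr` are box
   charts OF THE NERVE on the half-spaces {a_μ ≤ 0}, {0 ≤ b_μ} of indices (`twoScale_indexChart_inl/inr`: the blocks of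
   one level are charted by their own index lattice, one level up), whence nerve reachability and nerve distances within
   and across the levels (`twoScale_nerve_dist_inl_le/inr_le`, `twoScale_nerve_reachable_inl_inr`,
   `twoScale_nerve_dist_inl_inr_le`: ≤ ‖a − L·b₀‖₁ + 1 + ‖b₀ − b‖₁, b₀ := b with b_μ := 0); the §7 bound d ≤ w + n(w + 1)
   instantiated within and ACROSS the levels (`twoScale_dist_le_inl_inl`, `_inr_inr`, `_inl_inr`); (α) for the model
   (`twoScale_reachable`: any two points of `twoScalePts` are joined); the M-FREE in-region comparisons
   (`isBoxChart_fineRegion`, `isBoxChart_coarseRegion`: a half-space is coordinate-box closed, so each REGION is one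
   chart; `twoScale_dist_le_of_fine` / `_of_coarse` / `_of_fine_coarse`: ≤ ‖u − v‖₁, ≤ ‖y − y′‖₁, ≤ ‖u − L·y₀‖₁ + ‖y₀ − y‖₁);
   (len) for the model (`bondScale_twoScale`: zone 1 on the coarse side {0 ≤ x_μ}, 0 elsewhere, positions η·x,
   ℓ j = L^jη — η-bonds have length η ≤ L^{0∨1}η, Lη-bonds length Lη; `affinePos_scalePt`: η·(L·y) = (Lη)·y); and the blocks
   of §7 PARTITION ℤ^d (`blockIdx`, `mem_blockBox_blockIdx`, `blockIdx_eq_of_mem`, `blockAtlas_disjoint`).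
8. [v1.3, §8e: folklore model computation] THE LINEAR COMPARISON behind (2.66) (cell GAPS.md G-pv08-1) in the two-scale
   model, UNIFORMLY IN M: `twoScale_dist_le_latL1Dist_add` — for u, v ∈ `twoScalePts d L M μ` (M, L ≥ 1),
   `(twoScaleGraph d L M μ).dist u v ≤ latL1Dist u v + (L − 1)`, the ℓ¹ distance in η-units: constant 1 relative to the
   FINER lattice, i.e. L relative to the coarser one (`latL1Dist_scalePt`: ‖L·y − L·y′‖₁ = L‖y − y′‖₁ — the
   "adjacent-scale constant"), additive constant L − 1 (attained: d = 1, M = L, the fine point L − 1 against the coarse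
   point L·1); NO additive term for two points of one scale (`twoScale_dist_le_of_fine` / `_of_coarse`) nor for a fine
   point on the fine side of Σ against a coarse point (`twoScale_dist_le_latL1Dist_across`, u_μ ≤ 0, via
   `latL1Dist_foot_le`); the overlap slab 0 ≤ u_μ < M by `twoScale_dist_le_latL1Dist_slab` (fine bonds to the coarse point
   L·z, z := y with z_μ := ⌊u_μ/L⌋, then coarse bonds; `natAbs_ediv_sub_le`: |⌊a/L⌋ − b| ≤ |a − L·b|); and the exponential
   form in which (2.66) consumes such comparisons: `exp_decay_transfer` (D ≤ C·E + C′ ⇒ e^{−δE} ≤ e^{(δ/C)·C′}·e^{−(δ/C)·D})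
   and `twoScale_exp_decay_le` (e^{−δ‖u − v‖₁} ≤ e^{δ(L − 1)}·e^{−δ·dist(u, v)} on `twoScalePts`, δ ≥ 0).
9. [v1.4, §9: folklore model computations] THE WINDOW SUM OF (2.66): `sum_exp_neg_latL1Dist_le_c0_pow` (Σ_{z∈S}
   e^{−αδ₀‖u − z‖₁} ≤ c₀(δ₀, α)^d for finite S ⊂ ℤ^d, by name from `B6Lemma21TwoScale.sum_exp_le_c0_pow`); the depth below Σ
   (`depth_le_add_twoScale_dist`; `twoScale_dist_vertical`: dist(−D·e_μ, −N·e_μ) = N − D exactly); under the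
   SCALE-CORRECT weights (decay in the finer level's η-units for every pair, as (2.44) gives for the cubes of p. 230's
   case list) `twoScale_windowSum_le` (Σ_{v∈S} e^{−δ₀‖u − v‖₁}·e^{½δ₀dist(u,v)} ≤ e^{½δ₀(L−1)}·c₀(δ₀, ½)^d for finite S ⊆ T),
   `twoScale_windowSum_coarse_le` (coarse pairs in Lη-units: ≤ c₀(δ₀, ½)^d) and `twoScale_sum266_le` (the last «≤» of
   (2.66): Σ_{y″∈S} e^{−δ₀‖y − y″‖₁}·e^{−½δ₀d(y″,y′)} ≤ e^{½δ₀(L−1)}·c₀(δ₀, ½)^d·e^{−½δ₀d(y,y′)} — constant M-FREE at the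
   printed rate ½δ₀, no window, no choice of n); under the LITERAL weights of the display (one exponent, on the scale of
   the level of y: e^{−(δ₀/L)‖y − y″‖₁} for a coarse-lattice point y on Σ against fine y″) `twoScale_literal266_lower` /
   `twoScale_literal266_not_uniform` ((M + 1)·e^{−½δ₀d(y,y′)} ≤ the window sum over the M + 1 fine points below y: NO
   M-uniform constant at rate ½δ₀, L ≥ 2), `twoScale_literal266_rateLoss_le` (M-uniform at every rate δ′ < δ₀/L:
   constant e^{δ′(L−1)}·c₀(δ₀/L − δ′, 1)^d) and `twoScale_literal266_threshold` (at no rate δ′ > δ₀/L).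

WHAT IS NOT PROVED / NOT CLAIMED.  Nothing printed is asserted.  WHICH boxes of Λ_j-points are charts of Bałaban's
admissible class (in particular whether the Λ_j-bonds lying inside a face on Σ_{j+1} are admissible — under the literal
reading of p. 231 a part of Γ inside B^{j+1}(Λ_{j+1}) must consist of Λ_{j+1}-bonds) and the two atlas hypotheses (every
lattice point of T^{(j)}_η lies in an admissible box; the nerve of the boxes is connected — the combinatorial
form of (2.4) *"T = ⋃_{j=0}^k B^j(Λ_j)"* with *"Ω_j is a sum of cubes"* and the connectedness of the torus) remain
LOCATED INPUTS, now of block shape; the ACROSS-chart case of the comparison in (2.66) (y″ in another block, or across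
Σ_j / Σ_{j+1}) is REDUCED [v1.1, §7] to block data of the same shape — box widths ≤ w and a nerve chain of n links between
the boxes of y and y″ give d(y, y″) ≤ w + n(w + 1) and the shift factor e^{½δ₀(w + n(w+1))} — but WHICH n separates two
points with (L^jη)^{−1}|y − y″| ≤ 2dM in the tiling of Ω_{j−1}, Ω_j, Ω_{j+1} by cubes, and whether the print's O(1) in
(2.66) is meant uniformly in M (the shift factor depends on d, M, L, δ₀), stay LOCATED / undecided from p. 234; so does
the torus identification of positions (the affine instance is stated in ℝ^d; `SpacingLe` tolerates any 1-Lipschitz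
quotient, `SpacingGe` with K = 1 needs |y − y″| below the injectivity radius, as in the range (L^jη)^{−1}|y − y″| ≤ 2dM
of (2.66) on a large torus — not modelled).  The two-scale instance of §8 [v1.2] has a FLAT interface (Σ a coordinate
hyperplane, Ω₁ a half-space of the infinite lattice, k = 1): the shapes of Bałaban's Ω_j (unions of big cubes with
(2.2)), the corners of Σ_j, k > 1 levels and the torus are NOT modelled — it shows that the gluing data of §§3, 7 are
realizable across two lattice scales with the shared-point linkage, and says nothing about (2.46) itself.  [v1.3] In that
flat model the comparison behind (2.66) holds LINEARLY and UNIFORMLY IN M, with the adjacent-scale constant L and the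
additive constant L − 1 (§8e, item 8) — so there neither a choice of n nor an M-dependent shift factor is needed; whether
Bałaban's cube geometry (corners of Σ_j, (2.2)-separated levels j − 1, j, j + 1, the torus) admits the same constants
stays located.  [v1.4] In the same flat model the WINDOW SUM of (2.66) is decided both ways (§9, item 9): no choice of n and
no window are needed and the constant is M-free at the printed rate ½δ₀ PROVIDED each y″ carries the decay of (2.44) on the
scale of ITS cube and every cube of 𝒟 meeting two levels is of the finer one (p. 230's case list); the display's own middle
expression (one exponent, on the scale of the level of y) does NOT yield its last «≤» uniformly in M, and neither does (2.44)
as printed for a coarser cube protruding into a finer region — there only the rates δ′ < δ₀/L survive uniformly in M.  Which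
cover 𝒟 p. 229 describes, whether G′(□) of a protruding coarser cube decays at the finer rate inside the finer region, the
corners of Σ_j, k > 1, the torus, and whether the consumers of Prop. 2.2 need its O(1) uniformly in M (p. 247 asserts
dependence on d and L only for the parallel Prop. 2.6) remain LOCATED (GAPS.md G-pv08-1).  (2.61),
Prop. 2.2 and everything analytic remain hypotheses of the siblings.  VALUE: bookkeeping — the existence/length half of the unprinted geometry behind
(2.46), (2.60), (2.66) reduced to block-cover statements; NOT progress on any disputed estimate.
-/

namespace Literature.MathematicalPhysics.QuantumFieldTheory.Balaban1983to89.B6BoxCharts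

open Literature.Probability.LatticeModels
open B6Geometry B6LevelGapMetric

/-! ## 1. Staircase walks of ℤ^d inside coordinate boxes [folklore] -/

section Lattice

variable {d : ℕ}

/-- ‖u − u‖₁ = 0. [folklore] -/
theorem latL1Dist_self (u : Site d) : latL1Dist u u = 0 := by
  simp [latL1Dist]

/-- The triangle inequality of ‖·‖₁ on ℤ^d. [folklore] -/
theorem latL1Dist_triangle (u v y : Site d) : latL1Dist u y ≤ latL1Dist u v + latL1Dist v y := by
  unfold latL1Dist
  rw [← Finset.sum_add_distrib]
  exact Finset.sum_le_sum fun i _ => by omega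

/-- ‖u − y‖₁ = ‖y − u‖₁. [folklore] -/
theorem latL1Dist_comm (u y : Site d) : latL1Dist u y = latL1Dist y u := by
  unfold latL1Dist
  exact Finset.sum_congr rfl fun i _ => by omega

/-- ‖e_μ‖₁ = 1: the point a + e_μ is at ℓ¹ distance 1 from a. [folklore] -/
theorem latL1Dist_add_single (a : Site d) (i : Fin d) : latL1Dist a (a + Pi.single i 1) = 1 := by
  unfold latL1Dist
  have h1 : ∀ j, (a j - (a + Pi.single i 1 : Site d) j).natAbs = if j = i then 1 else 0 := by
    intro j
    rw [Pi.add_apply]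
    by_cases hj : j = i
    · subst hj; rw [Pi.single_eq_same, if_pos rfl]; omega
    · rw [Pi.single_eq_of_ne hj, if_neg hj]; omega
  simp_rw [h1]
  simp

/-- A nearest-neighbour bond of ℤ^d has ‖·‖₁-length 1 (a bond of Λ_j counts (L^jη)^{−1}·L^jη = 1 in (2.46)). [folklore] -/
theorem latL1Dist_eq_one_of_adj {u v : Site d} (h : (zdGraph d).Adj u v) : latL1Dist u v = 1 := by
  obtain ⟨i, hi | hi⟩ := (zdGraph_adj_iff u v).1 h
  · rw [hi]; exact latL1Dist_add_single u i
  · rw [hi, latL1Dist_comm]; exact latL1Dist_add_single v i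

/-- *"|Γ_{y,y′}| ≥ |y − y′|"* in lattice units (cf. (2.48) p. 232): every nearest-neighbour walk from u to y has at
least ‖u − y‖₁ bonds. [folklore] -/
theorem latL1Dist_le_length : ∀ {u y : Site d} (p : (zdGraph d).Walk u y), latL1Dist u y ≤ p.length := by
  intro u y p
  induction p with
  | nil => simp [latL1Dist_self]
  | @cons a b c h p ih =>
    rw [SimpleGraph.Walk.length_cons]
    calc latL1Dist a c ≤ latL1Dist a b + latL1Dist b c := latL1Dist_triangle a b c
      _ = 1 + latL1Dist b c := by rw [latL1Dist_eq_one_of_adj h]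
      _ ≤ p.length + 1 := by omega

/-- **The staircase contour**: u and y are joined by a nearest-neighbour walk of exactly ‖u − y‖₁ bonds all of whose
points lie in the coordinate box of u, y (move one coordinate at a time towards y). [folklore] -/
theorem exists_walk_in_cbox (u y : Site d) :
    ∃ p : (zdGraph d).Walk u y, p.length = latL1Dist u y ∧ ∀ z ∈ p.support, z ∈ cbox u y := by
  suffices key : ∀ (n : ℕ) (u : Site d), latL1Dist u y ≤ n →
      ∃ p : (zdGraph d).Walk u y, p.length ≤ latL1Dist u y ∧ ∀ z ∈ p.support, z ∈ cbox u y by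
    obtain ⟨p, hp, hs⟩ := key _ u le_rfl
    exact ⟨p, le_antisymm hp (latL1Dist_le_length p), hs⟩
  intro n
  induction n with
  | zero =>
    intro u hu
    have huy : u = y := eq_of_latL1Dist_eq_zero (Nat.le_zero.1 hu)
    subst huy
    exact ⟨SimpleGraph.Walk.nil, by simp, fun z hz => by
      rw [SimpleGraph.Walk.support_nil, List.mem_singleton] at hz
      rw [hz]; exact left_mem_cbox _ _⟩
  | succ n ih =>
    intro u hu
    by_cases huy : u = y
    · subst huy
      exact ⟨SimpleGraph.Walk.nil, by simp, fun z hz => by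
        rw [SimpleGraph.Walk.support_nil, List.mem_singleton] at hz
        rw [hz]; exact left_mem_cbox _ _⟩
    · obtain ⟨u', hadj, hu'box, hlt⟩ := exists_step_towards huy
      obtain ⟨q, hq, hqs⟩ := ih u' (by omega)
      refine ⟨SimpleGraph.Walk.cons hadj q, ?_, ?_⟩
      · rw [SimpleGraph.Walk.length_cons]; omega
      · intro z hz
        rw [SimpleGraph.Walk.support_cons, List.mem_cons] at hz
        rcases hz with hz | hz
        · rw [hz]; exact left_mem_cbox _ _
        · exact cbox_subset_of_mem hu'box (hqs z hz)

/-- The graph distance of ℤ^d is the ℓ¹ distance. [folklore] -/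
theorem zdGraph_dist_eq_latL1Dist (u y : Site d) : (zdGraph d).dist u y = latL1Dist u y := by
  obtain ⟨p, hp, -⟩ := exists_walk_in_cbox u y
  refine le_antisymm (hp ▸ SimpleGraph.dist_le p) ?_
  obtain ⟨q, hq⟩ := p.reachable.exists_walk_length_eq_dist
  rw [← hq]
  exact latL1Dist_le_length q

/-- A set of lattice points is COORDINATE-BOX CLOSED if it contains the coordinate box of any two of its points (blocks,
big blocks, cubes □, box-shaped unions of blocks, the whole lattice). [folklore] -/
def CboxClosed (B : Set (Site d)) : Prop :=
  ∀ ⦃u y : Site d⦄, u ∈ B → y ∈ B → cbox u y ⊆ B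

/-- The coordinate box of two points of an order box lies in it. [folklore] -/
theorem cbox_subset_Icc {lo hi u y : Site d} (hu : u ∈ Set.Icc lo hi) (hy : y ∈ Set.Icc lo hi) :
    cbox u y ⊆ Set.Icc lo hi := by
  intro z hz
  rw [Set.mem_Icc] at hu hy ⊢
  constructor
  · intro i
    have h1 := hu.1 i; have h2 := hy.1 i; have h3 := (hz i).1
    rcases le_total (u i) (y i) with h | h
    · rw [min_eq_left h] at h3; exact h1.trans h3
    · rw [min_eq_right h] at h3; exact h2.trans h3
  · intro i
    have h1 := hu.2 i; have h2 := hy.2 i; have h3 := (hz i).2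
    rcases le_total (u i) (y i) with h | h
    · rw [max_eq_right h] at h3; exact h3.trans h2
    · rw [max_eq_left h] at h3; exact h3.trans h1

/-- Order boxes Icc lo hi ⊂ ℤ^d (the Λ_j-points of a block, of a big block, of a cube □) are coordinate-box closed. [folklore] -/
theorem cboxClosed_Icc (lo hi : Site d) : CboxClosed (Set.Icc lo hi) :=
  fun _ _ hu hy => cbox_subset_Icc hu hy

/-- The whole lattice is coordinate-box closed. [folklore] -/
theorem cboxClosed_univ : CboxClosed (Set.univ : Set (Site d)) :=
  fun _ _ _ _ _ _ => Set.mem_univ _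

/-- Intersections of coordinate-box closed sets are coordinate-box closed. [folklore] -/
theorem CboxClosed.inter {B B' : Set (Site d)} (hB : CboxClosed B) (hB' : CboxClosed B') : CboxClosed (B ∩ B') :=
  fun _ _ hu hy => Set.subset_inter (hB hu.1 hy.1) (hB' hu.2 hy.2)

/-- ‖u − y‖₁ ≤ d · ‖u − y‖_∞. [folklore] -/
theorem latL1Dist_le_mul_supDist (u y : Site d) : latL1Dist u y ≤ d * supDist u y := by
  unfold latL1Dist
  calc ∑ i, (u i - y i).natAbs ≤ ∑ _i : Fin d, supDist u y :=
        Finset.sum_le_sum fun i _ => natAbs_sub_le_supDist u y i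
    _ = d * supDist u y := by simp

end Lattice

/-! ## 2. Box charts: a box of Λ_j-points all of whose Λ_j-bonds are admissible [p. 231] -/

section Chart

variable {d : ℕ} {V : Type*} {G : SimpleGraph V} {B : Set (Site d)} {φ : Site d → V}

/-- A BOX CHART of the admissible-bond graph G: a coordinate-box closed set B of points of ℤ^d ≅ Λ_j and a map φ into
the lattice points such that every Λ_j-bond with both end-points in B is admissible — p. 231 [9] *"a part of Γ contained
in B^j(Λ_j) consists of bonds of the lattice Λ_j"*, read as the availability of all Λ_j-bonds of an admissible box.
[cite: Balaban1984PropagatorsII, p.231] -/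
def IsBoxChart (G : SimpleGraph V) (B : Set (Site d)) (φ : Site d → V) : Prop :=
  CboxClosed B ∧ ∀ ⦃x y : Site d⦄, x ∈ B → y ∈ B → (zdGraph d).Adj x y → G.Adj (φ x) (φ y)

/-- A nearest-neighbour walk inside the chart's box is carried, bond by bond, to an admissible contour with the same
number of bonds. [cite: Balaban1984PropagatorsII, p.231] -/
theorem exists_walk_map_of_chart (hφ : ∀ ⦃x y : Site d⦄, x ∈ B → y ∈ B → (zdGraph d).Adj x y → G.Adj (φ x) (φ y)) :
    ∀ {u y : Site d} (p : (zdGraph d).Walk u y), (∀ z ∈ p.support, z ∈ B) →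
      ∃ q : G.Walk (φ u) (φ y), q.length = p.length := by
  intro u y p
  induction p with
  | nil => intro _; exact ⟨SimpleGraph.Walk.nil, rfl⟩
  | @cons a b c h p ih =>
    intro hs
    have ha : a ∈ B := hs a (SimpleGraph.Walk.start_mem_support _)
    have hb : b ∈ B := hs b (by
      rw [SimpleGraph.Walk.support_cons]
      exact List.mem_cons_of_mem _ (SimpleGraph.Walk.start_mem_support p))
    obtain ⟨q, hq⟩ := ih (fun z hz => hs z (by
      rw [SimpleGraph.Walk.support_cons]; exact List.mem_cons_of_mem _ hz))
    exact ⟨SimpleGraph.Walk.cons (hφ ha hb h) q, by rw [SimpleGraph.Walk.length_cons, SimpleGraph.Walk.length_cons, hq]⟩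

/-- **An admissible contour of ‖u − y‖₁ bonds joins two points of an admissible box** (the staircase of Λ_j-bonds).
[cite: Balaban1984PropagatorsII, p.231] -/
theorem exists_walk_of_chart (hch : IsBoxChart G B φ) {u y : Site d} (hu : u ∈ B) (hy : y ∈ B) :
    ∃ q : G.Walk (φ u) (φ y), q.length = latL1Dist u y := by
  obtain ⟨p, hp, hs⟩ := exists_walk_in_cbox u y
  obtain ⟨q, hq⟩ := exists_walk_map_of_chart hch.2 p (fun z hz => hch.1 hu hy (hs z hz))
  exact ⟨q, hq.trans hp⟩

/-- Two points of an admissible box are joined by an admissible contour. [cite: Balaban1984PropagatorsII, p.231] -/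
theorem reachable_of_chart (hch : IsBoxChart G B φ) {u y : Site d} (hu : u ∈ B) (hy : y ∈ B) :
    G.Reachable (φ u) (φ y) := by
  obtain ⟨q, -⟩ := exists_walk_of_chart hch hu hy
  exact q.reachable

/-- **The in-box comparison, lattice units**: the distance (2.46) between two points of one admissible box of Λ_j-points
is at most their ℓ¹ distance in Λ_j-units, d(φ u, φ y) ≤ ‖u − y‖₁ (= (L^jη)^{−1}‖pos u − pos y‖₁) — the in-box case of the
comparison used in (2.66), with constant 1. [cite: Balaban1984PropagatorsII, (2.46) p.231 + (2.66) p.234] -/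
theorem dist_le_latL1Dist_of_chart (hch : IsBoxChart G B φ) {u y : Site d} (hu : u ∈ B) (hy : y ∈ B) :
    G.dist (φ u) (φ y) ≤ latL1Dist u y := by
  obtain ⟨q, hq⟩ := exists_walk_of_chart hch hu hy
  exact hq ▸ SimpleGraph.dist_le q

/-- … and at most d times their sup distance in Λ_j-units. [cite: Balaban1984PropagatorsII, (2.46) p.231 + (2.66) p.234] -/
theorem dist_le_mul_supDist_of_chart (hch : IsBoxChart G B φ) {u y : Site d} (hu : u ∈ B) (hy : y ∈ B) :
    G.dist (φ u) (φ y) ≤ d * supDist u y :=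
  (dist_le_latL1Dist_of_chart hch hu hy).trans (latL1Dist_le_mul_supDist u y)

/-- A chart restricts to any coordinate-box closed subset of its box (a block inside a big block, a cube □ ∩ a box).
[folklore] -/
theorem IsBoxChart.mono (hch : IsBoxChart G B φ) {B' : Set (Site d)} (hB' : CboxClosed B') (hsub : B' ⊆ B) :
    IsBoxChart G B' φ :=
  ⟨hB', fun _ _ hx hy h => hch.2 (hsub hx) (hsub hy) h⟩

/-- A chart of G is a chart of every larger graph of admissible bonds. [folklore] -/
theorem IsBoxChart.of_le (hch : IsBoxChart G B φ) {G' : SimpleGraph V} (hG : G ≤ G') : IsBoxChart G' B φ :=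
  ⟨hch.1, fun _ _ hx hy h => hG (hch.2 hx hy h)⟩

end Chart

/-! ## 3. Atlases: gluing charts along common lattice points — input (α) reduced to block data [folklore] -/

section Atlas

variable {d : ℕ} {V : Type*} {G : SimpleGraph V} {A : Type*}

/-- An ATLAS of box charts of G indexed by A (the blocks / big blocks / cubes of all the lattices Λ_j, j = 0, …, k):
boxes `box a ⊂ ℤ^d` with chart maps `φ a`. [cite: Balaban1984PropagatorsII, (2.4) p.224 + p.231] -/
structure Atlas (G : SimpleGraph V) (d : ℕ) (A : Type*) where
  /-- the Λ_j-points of the a-th box, in lattice coordinates -/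
  box : A → Set (Site d)
  /-- the chart maps -/
  φ : A → Site d → V
  /-- each (box a, φ a) is a box chart -/
  chart : ∀ a, IsBoxChart G (box a) (φ a)

/-- Two charts are LINKED if they have a lattice point in common (closed adjacent blocks share the points of a face; a
Λ_j-box meeting Σ_{j+1} shares its points of Λ_{j+1} ∩ Σ_{j+1} with a Λ_{j+1}-box) or an admissible bond joins a point of
one to a point of the other (half-open adjacent blocks: the Λ_j-bonds crossing the common face). [folklore] -/
def Atlas.Linked (𝔄 : Atlas G d A) (a a' : A) : Prop :=
  ∃ x x' : Site d, x ∈ 𝔄.box a ∧ x' ∈ 𝔄.box a' ∧ (𝔄.φ a x = 𝔄.φ a' x' ∨ G.Adj (𝔄.φ a x) (𝔄.φ a' x'))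

/-- The NERVE of an atlas: the graph on the index set joining linked charts. [folklore] -/
def Atlas.nerve (𝔄 : Atlas G d A) : SimpleGraph A :=
  SimpleGraph.fromRel 𝔄.Linked

/-- The charts COVER: every lattice point lies in some admissible box ((2.4) *"T = ⋃_{j=0}^k B^j(Λ_j)"*, read on the
lattice points of T^{(j)}_η, with *"Ω_j is a sum of cubes"*). [cite: Balaban1984PropagatorsII, (2.4) p.224 + p.231] -/
def Atlas.Covers (𝔄 : Atlas G d A) : Prop :=
  ∀ v : V, ∃ (a : A) (x : Site d), x ∈ 𝔄.box a ∧ 𝔄.φ a x = v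

variable {𝔄 : Atlas G d A}

/-- Linkage is symmetric. [folklore] -/
theorem Atlas.Linked.symm {a a' : A} (h : 𝔄.Linked a a') : 𝔄.Linked a' a := by
  obtain ⟨x, x', hx, hx', he⟩ := h
  exact ⟨x', x, hx', hx, he.imp Eq.symm SimpleGraph.Adj.symm⟩

/-- Linked points of two charts are joined by an admissible contour of at most one bond. [folklore] -/
theorem Atlas.Linked.reachable {a a' : A} {x x' : Site d}
    (he : 𝔄.φ a x = 𝔄.φ a' x' ∨ G.Adj (𝔄.φ a x) (𝔄.φ a' x')) : G.Reachable (𝔄.φ a x) (𝔄.φ a' x') := by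
  rcases he with he | he
  · rw [he]
  · exact he.reachable

/-- Adjacent charts of the nerve are linked. [folklore] -/
theorem Atlas.linked_of_nerve_adj {a a' : A} (h : 𝔄.nerve.Adj a a') : 𝔄.Linked a a' := by
  rw [Atlas.nerve, SimpleGraph.fromRel_adj] at h
  rcases h.2 with h' | h'
  · exact h'
  · exact h'.symm

/-- **Gluing**: along a chain of pairwise linked admissible boxes, any point of the first box is joined to any point of
the last by an admissible contour (concatenate the in-box staircases through the common points / linking bonds). [folklore] -/
theorem reachable_of_atlas {a a' : A} (h : 𝔄.nerve.Reachable a a') {x : Site d} (hx : x ∈ 𝔄.box a) :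
    ∀ {y : Site d}, y ∈ 𝔄.box a' → G.Reachable (𝔄.φ a x) (𝔄.φ a' y) := by
  rw [SimpleGraph.reachable_iff_reflTransGen] at h
  induction h with
  | refl => intro y hy; exact reachable_of_chart (𝔄.chart a) hx hy
  | @tail b c _ hbc ih =>
    intro y hy
    obtain ⟨z, z', hz, hz', he⟩ := Atlas.linked_of_nerve_adj hbc
    exact ((ih hz).trans (Atlas.Linked.reachable he)).trans (reachable_of_chart (𝔄.chart c) hz' hy)

/-- **Input (α) reduced to block data**: if the admissible boxes cover the lattice points and their nerve is
preconnected, any two lattice points are joined by an admissible contour. [cite: Balaban1984PropagatorsII, p.231 + (2.4) p.224] -/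
theorem preconnected_of_atlas (hcov : 𝔄.Covers) (hnerve : 𝔄.nerve.Preconnected) : G.Preconnected := by
  intro v w
  obtain ⟨a, x, hx, rfl⟩ := hcov v
  obtain ⟨a', y, hy, rfl⟩ := hcov w
  exact reachable_of_atlas (hnerve a a') hx hy

/-- … so the graph of admissible bonds is connected as soon as there is a lattice point: the hypothesis
`C.bond.Connected` / `hconn` of the gen-2 and gen-4 siblings (*"Of course the infimum is attained at some contour
Γ_{y,y′}"*, p. 231) from block data. [cite: Balaban1984PropagatorsII, p.231 + (2.4) p.224] -/
theorem connected_of_atlas [Nonempty V] (hcov : 𝔄.Covers) (hnerve : 𝔄.nerve.Preconnected) : G.Connected :=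
  (SimpleGraph.connected_iff G).2 ⟨preconnected_of_atlas hcov hnerve, ‹Nonempty V›⟩

/-- The distance (2.46) inside one box of an atlas: two points of the a-th box are at distance ≤ their ℓ¹ lattice
distance. [cite: Balaban1984PropagatorsII, (2.46) p.231] -/
theorem dist_le_of_atlas (a : A) {x y : Site d} (hx : x ∈ 𝔄.box a) (hy : y ∈ 𝔄.box a) :
    G.dist (𝔄.φ a x) (𝔄.φ a y) ≤ latL1Dist x y :=
  dist_le_latL1Dist_of_chart (𝔄.chart a) hx hy

end Atlas

/-! ## 4. Positions: (len) discharged and the metric comparison behind (2.66) [p. 223, (2.1) p. 224, p. 231, (2.66) p. 234] -/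

section Positions

variable {d : ℕ} {V : Type*} {X : Type*} [PseudoMetricSpace X]

/-- A chart is drawn AT SPACING ≤ s in the position space X (the torus T_η, or ℝ^d): the positions of two of its points
are at most s·‖x − y‖₁ apart — (2.1)/(2.3) p. 224: Λ_j ⊂ T^{(j)}_{L^jη} is a lattice of spacing s = L^jη, whose distance
|x − y| = Σ_μ |x_μ − y_μ| (p. 223) is L^jη·‖·‖₁ in lattice coordinates; any 1-Lipschitz image (torus quotient) keeps ≤.
[cite: Balaban1984PropagatorsII, p.223 + (2.1)–(2.3) p.224] -/
def SpacingLe (pos : V → X) (φ : Site d → V) (B : Set (Site d)) (s : ℝ) : Prop :=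
  ∀ ⦃x y : Site d⦄, x ∈ B → y ∈ B → dist (pos (φ x)) (pos (φ y)) ≤ s * (latL1Dist x y : ℝ)

/-- A chart is drawn AT SPACING ≥ s UP TO THE FACTOR K: s·‖x − y‖₁ ≤ K·|pos x − pos y| — K = 1 for Λ_j ⊂ ℝ^d with
Bałaban's ℓ¹ distance |x − y| = Σ_μ |x_μ − y_μ| (p. 223), K = d for the sup distance of ℝ^d. [cite: Balaban1984PropagatorsII, p.223 + (2.1)–(2.3) p.224] -/
def SpacingGe (pos : V → X) (φ : Site d → V) (B : Set (Site d)) (s K : ℝ) : Prop :=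
  ∀ ⦃x y : Site d⦄, x ∈ B → y ∈ B → s * (latL1Dist x y : ℝ) ≤ K * dist (pos (φ x)) (pos (φ y))

variable {G : SimpleGraph V} {B : Set (Site d)} {φ : Site d → V} {pos : V → X}

/-- **A charted Λ_j-bond has T_η-length ≤ its spacing** (p. 231: a bond of Λ_j has length L^jη; ‖e_μ‖₁ = 1). [cite: Balaban1984PropagatorsII, p.231 + (2.1) p.224] -/
theorem dist_pos_le_of_adj {s : ℝ} (hsp : SpacingLe pos φ B s) {x y : Site d} (hx : x ∈ B) (hy : y ∈ B)
    (h : (zdGraph d).Adj x y) : dist (pos (φ x)) (pos (φ y)) ≤ s := by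
  have h1 := hsp hx hy
  rw [latL1Dist_eq_one_of_adj h, Nat.cast_one, mul_one] at h1
  exact h1

/-- **The in-box comparison of G-pv08-1, metric form**: for a chart drawn at spacing ≥ s up to K,
s·d_G(φ u, φ y) ≤ K·|pos(φ u) − pos(φ y)| — *d(y, y″) ≤ O(1)·(L^jη)^{−1}|y − y″|* with O(1) = K for two points of one
admissible Λ_j-box (K = 1 in Bałaban's ℓ¹ distance). [cite: Balaban1984PropagatorsII, (2.46) p.231 + (2.66) p.234 + p.223] -/
theorem spacing_mul_dist_le_of_chart (hch : IsBoxChart G B φ) {s K : ℝ} (hs : 0 ≤ s) (hsp : SpacingGe pos φ B s K)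
    {u y : Site d} (hu : u ∈ B) (hy : y ∈ B) :
    s * (G.dist (φ u) (φ y) : ℝ) ≤ K * dist (pos (φ u)) (pos (φ y)) :=
  (mul_le_mul_of_nonneg_left (by exact_mod_cast dist_le_latL1Dist_of_chart hch hu hy) hs).trans (hsp hu hy)

/-- **(len) discharged to chart data.**  If every admissible bond {u, v} is a Λ_j-bond of some chart a — u = φ_a x,
v = φ_a y with x, y adjacent points of box a — drawn at spacing ≤ s_a with s_a ≤ ℓ (j a), whose scale index j a is at
most the zone of each of its points (a box of Λ_j-points lies in B^j(Λ_j) up to its face on Σ_{j+1}), and ℓ is monotone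
(L ≥ 1), then `BondScale G zone pos ℓ`: every admissible bond has T_η-length ≤ ℓ (min (zone u) (zone v)).
[cite: Balaban1984PropagatorsII, p.231 + (2.1) p.224] -/
theorem bondScale_of_charts {A : Type*} (𝔄 : Atlas G d A) {zone : V → ℕ} {ℓ : ℕ → ℝ} (hmono : Monotone ℓ)
    (j : A → ℕ) (s : A → ℝ) (hs : ∀ a, s a ≤ ℓ (j a)) (hsp : ∀ a, SpacingLe pos (𝔄.φ a) (𝔄.box a) (s a))
    (hzone : ∀ a, ∀ x ∈ 𝔄.box a, j a ≤ zone (𝔄.φ a x))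
    (hbond : ∀ ⦃u v : V⦄, G.Adj u v → ∃ (a : A) (x y : Site d), x ∈ 𝔄.box a ∧ y ∈ 𝔄.box a ∧
      (zdGraph d).Adj x y ∧ 𝔄.φ a x = u ∧ 𝔄.φ a y = v) :
    BondScale G zone pos ℓ := by
  intro u v huv
  obtain ⟨a, x, y, hx, hy, hxy, rfl, rfl⟩ := hbond huv
  calc dist (pos (𝔄.φ a x)) (pos (𝔄.φ a y)) ≤ s a := dist_pos_le_of_adj (hsp a) hx hy hxy
    _ ≤ ℓ (j a) := hs a
    _ ≤ ℓ (min (zone (𝔄.φ a x)) (zone (𝔄.φ a y))) := hmono (le_min (hzone a x hx) (hzone a y hy))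

end Positions

/-! ### 4b. The affine instance: a Λ_j-box drawn in ℝ^d at pos x = c + s·x [folklore + p. 223] -/

section Affine

variable {d : ℕ}

/-- The position in ℝ^d of the lattice point with Λ_j-coordinates x, for a lattice of spacing s (= L^jη) and origin c:
c + s·x ((2.1)–(2.3) p. 224: Λ_j ⊂ T^{(j)}_{L^jη} has spacing L^jη; torus identifications not modelled). [cite: Balaban1984PropagatorsII, (2.1)–(2.3) p.224] -/
def affinePos (c : Fin d → ℝ) (s : ℝ) (x : Site d) : Fin d → ℝ :=
  fun i => c i + s * (x i : ℝ)

/-- Coordinates of affine positions differ by s·(x_μ − y_μ). [folklore] -/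
theorem affinePos_sub_apply (c : Fin d → ℝ) (s : ℝ) (x y : Site d) (i : Fin d) :
    affinePos c s x i - affinePos c s y i = s * ((x i : ℝ) - y i) := by
  simp only [affinePos]; ring

/-- |pos_μ x − pos_μ y| = s·|x_μ − y_μ| for s ≥ 0. [folklore] -/
theorem abs_affinePos_sub_apply (c : Fin d → ℝ) {s : ℝ} (hs : 0 ≤ s) (x y : Site d) (i : Fin d) :
    |affinePos c s x i - affinePos c s y i| = s * ((x i - y i).natAbs : ℝ) := by
  rw [affinePos_sub_apply, abs_mul, abs_of_nonneg hs, Nat.cast_natAbs, Int.cast_abs, Int.cast_sub]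

/-- **Bałaban's distance of affine positions**: |pos x − pos y| = Σ_μ |pos_μ x − pos_μ y| = s·‖x − y‖₁ (p. 223: *"a distance
between two points x, y ∈ ηZ^d, η > 0, is given by the l¹-norm of the vector x − y and is denoted by |x − y|, i.e.
|x − y| = Σ_{μ=1}^d |x_μ − y_μ|. This distance depends of course on the scale of the lattice."*). [cite: Balaban1984PropagatorsII, p.223] -/
theorem sum_abs_affinePos_sub (c : Fin d → ℝ) {s : ℝ} (hs : 0 ≤ s) (x y : Site d) :
    ∑ i, |affinePos c s x i - affinePos c s y i| = s * (latL1Dist x y : ℝ) := by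
  simp_rw [abs_affinePos_sub_apply c hs]
  rw [← Finset.mul_sum, latL1Dist]
  push_cast
  rfl

/-- In the sup metric of ℝ^d (Mathlib's `dist` on `Fin d → ℝ`), affine positions of spacing s ≥ 0 are at most
s·‖x − y‖_∞ apart. [folklore] -/
theorem dist_affinePos_le (c : Fin d → ℝ) {s : ℝ} (hs : 0 ≤ s) (x y : Site d) :
    dist (affinePos c s x) (affinePos c s y) ≤ s * (supDist x y : ℝ) := by
  refine (dist_pi_le_iff (mul_nonneg hs (Nat.cast_nonneg _))).2 fun i => ?_
  rw [Real.dist_eq, abs_affinePos_sub_apply c hs]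
  exact mul_le_mul_of_nonneg_left (by exact_mod_cast natAbs_sub_le_supDist x y i) hs

/-- ‖x − y‖_∞ ≤ ‖x − y‖₁. [folklore] -/
theorem supDist_le_latL1Dist (x y : Site d) : supDist x y ≤ latL1Dist x y :=
  supDist_le_iff.2 fun i =>
    Finset.single_le_sum (f := fun i => (x i - y i).natAbs) (fun _ _ => Nat.zero_le _) (Finset.mem_univ i)

/-- Σ_μ |p_μ − q_μ| ≤ d·|p − q|_∞ (sup metric of ℝ^d). [folklore] -/
theorem sum_abs_sub_le_mul_dist (p q : Fin d → ℝ) : ∑ i, |p i - q i| ≤ d * dist p q := by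
  calc ∑ i, |p i - q i| ≤ ∑ _i : Fin d, dist p q :=
        Finset.sum_le_sum fun i _ => by rw [← Real.dist_eq]; exact dist_le_pi_dist p q i
    _ = d * dist p q := by simp

variable {V : Type*} {G : SimpleGraph V} {B : Set (Site d)} {φ : Site d → V} {pos : V → (Fin d → ℝ)}
  {c : Fin d → ℝ} {s : ℝ}

/-- An affinely drawn box is drawn at spacing ≤ s for the sup metric of ℝ^d. [folklore] -/
theorem spacingLe_of_affine (hs : 0 ≤ s) (hpos : ∀ x ∈ B, pos (φ x) = affinePos c s x) : SpacingLe pos φ B s := by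
  intro x y hx hy
  rw [hpos x hx, hpos y hy]
  exact (dist_affinePos_le c hs x y).trans
    (mul_le_mul_of_nonneg_left (by exact_mod_cast supDist_le_latL1Dist x y) hs)

/-- An affinely drawn box is drawn at spacing ≥ s up to K = d for the sup metric of ℝ^d. [folklore] -/
theorem spacingGe_of_affine (hs : 0 ≤ s) (hpos : ∀ x ∈ B, pos (φ x) = affinePos c s x) :
    SpacingGe pos φ B s d := by
  intro x y hx hy
  rw [hpos x hx, hpos y hy]
  calc s * (latL1Dist x y : ℝ) = ∑ i, |affinePos c s x i - affinePos c s y i| := (sum_abs_affinePos_sub c hs x y).symm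
    _ ≤ d * dist (affinePos c s x) (affinePos c s y) := sum_abs_sub_le_mul_dist _ _

/-- **The in-box comparison in Bałaban's ℓ¹ distance, constant 1**: s·d_G(φ u, φ y) ≤ Σ_μ |pos_μ(φ u) − pos_μ(φ y)| =
|pos(φ u) − pos(φ y)| (p. 223) for an affinely drawn admissible box — *d(y, y″) ≤ (L^jη)^{−1}|y − y″|*.
[cite: Balaban1984PropagatorsII, (2.46) p.231 + (2.66) p.234 + p.223] -/
theorem spacing_mul_dist_le_sum_of_chart (hch : IsBoxChart G B φ) (hs : 0 ≤ s)
    (hpos : ∀ x ∈ B, pos (φ x) = affinePos c s x) {u y : Site d} (hu : u ∈ B) (hy : y ∈ B) :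
    s * (G.dist (φ u) (φ y) : ℝ) ≤ ∑ i, |pos (φ u) i - pos (φ y) i| := by
  rw [hpos u hu, hpos y hy, sum_abs_affinePos_sub c hs]
  exact mul_le_mul_of_nonneg_left (by exact_mod_cast dist_le_latL1Dist_of_chart hch hu hy) hs

end Affine

/-! ## 5. Over a contour system: `hconn` and (len) from block data, and the comparison of (2.66) in-box -/

section Contour

variable {d : ℕ} {g : B6.Geometry} {C : ContourSystem g} {A : Type*} {X : Type*} [PseudoMetricSpace X]

/-- **Input (α) of the B6 chain from block data**: admissible contours exist between any two lattice points of a contour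
system covered by an atlas of admissible boxes with preconnected nerve. [cite: Balaban1984PropagatorsII, p.231 + (2.4) p.224] -/
theorem bond_connected_of_atlas [Nonempty C.Pt] (𝔄 : Atlas C.bond d A) (hcov : 𝔄.Covers)
    (hnerve : 𝔄.nerve.Preconnected) : C.bond.Connected :=
  connected_of_atlas hcov hnerve

/-- **(2.60) with `hconn` discharged to block data**: the gen-4 sibling's `ineq260_of_cond22` ((2.60) p. 234 for a
realised geometry, from (len) + (2.2) on lattice points, L ≥ 1, η ≥ 0, RM = N ∈ ℕ, αδ₀ ≥ 0) with the existence of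
admissible contours supplied by an atlas. [cite: Balaban1984PropagatorsII, (2.60) p.234 + (2.2) p.224 + p.231] -/
theorem ineq260_of_atlas [Nonempty C.Pt] (h : Realizes g C) (𝔄 : Atlas C.bond d A) (hcov : 𝔄.Covers)
    (hnerve : 𝔄.nerve.Preconnected) (pos : C.Pt → X) (hL : 1 ≤ g.L) (hη : 0 ≤ g.eta) (hlen : BondScale22 C pos)
    (h22 : Cond22 C pos) {N : ℕ} (hN : (N : ℝ) = g.R * g.M) {δ₀ α : ℝ} (hαδ : 0 ≤ α * δ₀) :
    B6RandomWalk.Ineq260 g δ₀ α :=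
  ineq260_of_cond22 h (bond_connected_of_atlas 𝔄 hcov hnerve) pos hL hη hlen h22 hN hαδ

/-- **(len) `BondScale22` of a contour system from chart data**: every admissible bond a Λ_j-bond of a chart of scale
index j ≤ the zones of its points, drawn at spacing ≤ L^jη (L ≥ 1, η ≥ 0). [cite: Balaban1984PropagatorsII, p.231 + (2.1) p.224] -/
theorem bondScale22_of_charts (𝔄 : Atlas C.bond d A) {pos : C.Pt → X} (hL : 1 ≤ g.L) (hη : 0 ≤ g.eta) (j : A → ℕ)
    (hsp : ∀ a, SpacingLe pos (𝔄.φ a) (𝔄.box a) (g.L ^ j a * g.eta))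
    (hzone : ∀ a, ∀ x ∈ 𝔄.box a, j a ≤ C.zone (𝔄.φ a x))
    (hbond : ∀ ⦃u v : C.Pt⦄, C.bond.Adj u v → ∃ (a : A) (x y : Site d), x ∈ 𝔄.box a ∧ y ∈ 𝔄.box a ∧
      (zdGraph d).Adj x y ∧ 𝔄.φ a x = u ∧ 𝔄.φ a y = v) :
    BondScale22 C pos :=
  bondScale_of_charts 𝔄 (fun _ _ hab => mul_le_mul_of_nonneg_right (pow_le_pow_right₀ hL hab) hη) j
    (fun a => g.L ^ j a * g.eta) (fun _ => le_rfl) hsp hzone hbond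

/-- **(2.60) from block data on both geometric inputs**: `ineq260_of_cond22` with the existence of admissible contours
(atlas cover + nerve) AND (len) (charted bonds at spacing ≤ L^jη) discharged; (2.2) on lattice points (`Cond22`) remains
the printed hypothesis. [cite: Balaban1984PropagatorsII, (2.60) p.234 + (2.2) p.224 + p.231] -/
theorem ineq260_of_charts [Nonempty C.Pt] (h : Realizes g C) (𝔄 : Atlas C.bond d A) (hcov : 𝔄.Covers)
    (hnerve : 𝔄.nerve.Preconnected) (pos : C.Pt → X) (hL : 1 ≤ g.L) (hη : 0 ≤ g.eta) (j : A → ℕ)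
    (hsp : ∀ a, SpacingLe pos (𝔄.φ a) (𝔄.box a) (g.L ^ j a * g.eta))
    (hzone : ∀ a, ∀ x ∈ 𝔄.box a, j a ≤ C.zone (𝔄.φ a x))
    (hbond : ∀ ⦃u v : C.Pt⦄, C.bond.Adj u v → ∃ (a : A) (x y : Site d), x ∈ 𝔄.box a ∧ y ∈ 𝔄.box a ∧
      (zdGraph d).Adj x y ∧ 𝔄.φ a x = u ∧ 𝔄.φ a y = v)
    (h22 : Cond22 C pos) {N : ℕ} (hN : (N : ℝ) = g.R * g.M) {δ₀ α : ℝ} (hαδ : 0 ≤ α * δ₀) :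
    B6RandomWalk.Ineq260 g δ₀ α :=
  ineq260_of_atlas h 𝔄 hcov hnerve pos hL hη (bondScale22_of_charts 𝔄 hL hη j hsp hzone hbond) h22 hN hαδ

/-- **The comparison of (2.66), in-box case, lattice units**: for a realised geometry and two block points y, y″ ∈ 𝔅
whose lattice points lie in one admissible box of Λ_j-points, d(y, y″) ≤ ‖x − x″‖₁ (their Λ_j-lattice ℓ¹ distance, i.e.
(L^jη)^{−1}|y − y″| in Bałaban's distance p. 223). [cite: Balaban1984PropagatorsII, (2.46) p.231 + (2.66) p.234 + p.223] -/
theorem dist246_le_of_chart (h : Realizes g C) {B : Set (Site d)} {φ : Site d → C.Pt} (hch : IsBoxChart C.bond B φ)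
    {y y'' : g.Site} {x x'' : Site d} (hx : x ∈ B) (hx'' : x'' ∈ B) (hy : C.ι y = φ x) (hy'' : C.ι y'' = φ x'') :
    g.dist y y'' ≤ (latL1Dist x x'' : ℝ) := by
  rw [h y y'', dist246, hy, hy'']
  exact_mod_cast dist_le_latL1Dist_of_chart hch hx hx''

/-- **The comparison of (2.66), in-box case, metric form**: with the box drawn in the position space at spacing ≥ L^jη up
to K (L, η ≥ 0), L^jη · d(y, y″) ≤ K · |pos y − pos y″| — *d(y, y″) ≤ O(1)(L^jη)^{−1}|y − y″|* with O(1) = K (= 1 for the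
ℓ¹ distance of p. 223 in ℝ^d, = d for the sup distance).  The ACROSS-Σ case (y″ in the adjacent zone) is NOT covered.
[cite: Balaban1984PropagatorsII, (2.46) p.231 + (2.66) p.234 + p.223] -/
theorem len_mul_dist246_le_of_chart (h : Realizes g C) {B : Set (Site d)} {φ : Site d → C.Pt}
    (hch : IsBoxChart C.bond B φ) {pos : C.Pt → X} {j : ℕ} {K : ℝ} (hL : 0 ≤ g.L) (hη : 0 ≤ g.eta)
    (hsp : SpacingGe pos φ B (g.L ^ j * g.eta) K)
    {y y'' : g.Site} {x x'' : Site d} (hx : x ∈ B) (hx'' : x'' ∈ B) (hy : C.ι y = φ x) (hy'' : C.ι y'' = φ x'') :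
    g.L ^ j * g.eta * g.dist y y'' ≤ K * dist (pos (C.ι y)) (pos (C.ι y'')) := by
  rw [h y y'', dist246, hy, hy'']
  exact spacing_mul_dist_le_of_chart hch (mul_nonneg (pow_nonneg hL _) hη) hsp hx hx''

/-- **The comparison of (2.66), in-box case, in Bałaban's ℓ¹ distance with constant 1**: for an admissible Λ_j-box drawn
affinely in ℝ^d at spacing L^jη, L^jη · d(y, y″) ≤ Σ_μ |pos_μ y − pos_μ y″| = |y − y″|, i.e. d(y, y″) ≤ (L^jη)^{−1}|y − y″|.
[cite: Balaban1984PropagatorsII, (2.46) p.231 + (2.66) p.234 + p.223] -/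
theorem len_mul_dist246_le_sum_of_chart (h : Realizes g C) {B : Set (Site d)} {φ : Site d → C.Pt}
    (hch : IsBoxChart C.bond B φ) {pos : C.Pt → (Fin d → ℝ)} {c : Fin d → ℝ} {j : ℕ} (hL : 0 ≤ g.L) (hη : 0 ≤ g.eta)
    (hpos : ∀ x ∈ B, pos (φ x) = affinePos c (g.L ^ j * g.eta) x)
    {y y'' : g.Site} {x x'' : Site d} (hx : x ∈ B) (hx'' : x'' ∈ B) (hy : C.ι y = φ x) (hy'' : C.ι y'' = φ x'') :
    g.L ^ j * g.eta * g.dist y y'' ≤ ∑ i, |pos (C.ι y) i - pos (C.ι y'') i| := by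
  rw [h y y'', dist246, hy, hy'']
  exact spacing_mul_dist_le_sum_of_chart hch (mul_nonneg (pow_nonneg hL _) hη) hpos hx hx''

end Contour

/-! ## 6. Non-vacuity: the unit-box atlas of ℤ^d (one zone) [folklore] -/

section Model

variable {d : ℕ}

/-- The unit-box atlas of ℤ^d: charts indexed by a ∈ ℤ^d, box a = the unit cube Icc a (a + 1), identity chart maps —
T_η with a single zone and blocks of side 1. [folklore] -/
def unitAtlas (d : ℕ) : Atlas (zdGraph d) d (Site d) where
  box a := Set.Icc a (a + 1)
  φ _ x := x
  chart a := ⟨cboxClosed_Icc a (a + 1), fun _ _ _ _ h => h⟩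

/-- The unit cube at a contains a. [folklore] -/
theorem self_mem_unitBox (a : Site d) : a ∈ (unitAtlas d).box a :=
  ⟨le_rfl, fun k => by simp⟩

/-- The unit cube at a contains a + e_μ. [folklore] -/
theorem add_single_mem_unitBox (a : Site d) (i : Fin d) : a + Pi.single i 1 ∈ (unitAtlas d).box a := by
  refine ⟨fun k => ?_, fun k => ?_⟩
  · by_cases hk : k = i
    · subst hk; simp
    · simp [Pi.single_eq_of_ne hk]
  · by_cases hk : k = i
    · subst hk; simp
    · simp [Pi.single_eq_of_ne hk]

/-- Every lattice point lies in its own unit cube: the charts cover. [folklore] -/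
theorem unitAtlas_covers : (unitAtlas d).Covers :=
  fun v => ⟨v, v, self_mem_unitBox v, rfl⟩

/-- Every bond of ℤ^d is a bond of a unit cube: {a, a + e_μ} ⊂ Icc a (a + 1). [folklore] -/
theorem unitAtlas_bond {u v : Site d} (h : (zdGraph d).Adj u v) :
    ∃ (a : Site d) (x y : Site d), x ∈ (unitAtlas d).box a ∧ y ∈ (unitAtlas d).box a ∧
      (zdGraph d).Adj x y ∧ (unitAtlas d).φ a x = u ∧ (unitAtlas d).φ a y = v := by
  obtain ⟨i, hv | hu⟩ := (zdGraph_adj_iff u v).1 h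
  · exact ⟨u, u, v, self_mem_unitBox u, hv ▸ add_single_mem_unitBox u i, h, rfl, rfl⟩
  · exact ⟨v, u, v, hu ▸ add_single_mem_unitBox v i, self_mem_unitBox v, h, rfl, rfl⟩

/-- Nearest neighbours index overlapping unit cubes (both cubes contain the larger end-point). [folklore] -/
theorem unitAtlas_nerve_adj_of_adj {a b : Site d} (h : (zdGraph d).Adj a b) : (unitAtlas d).nerve.Adj a b := by
  rw [Atlas.nerve, SimpleGraph.fromRel_adj]
  refine ⟨h.ne, ?_⟩
  obtain ⟨i, hb | ha⟩ := (zdGraph_adj_iff a b).1 h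
  · exact Or.inl ⟨b, b, hb ▸ add_single_mem_unitBox a i, self_mem_unitBox b, Or.inl rfl⟩
  · exact Or.inr ⟨a, a, ha ▸ add_single_mem_unitBox b i, self_mem_unitBox a, Or.inl rfl⟩

/-- The nerve of the unit-box atlas is preconnected (it contains the nearest-neighbour graph, which is
preconnected: `zdGraph_preconnected_holds`). [folklore] -/
theorem unitAtlas_nerve_preconnected : (unitAtlas d).nerve.Preconnected :=
  (zdGraph_preconnected_holds (d := d)).mono fun _ _ h => unitAtlas_nerve_adj_of_adj h

/-- The conclusion of `connected_of_atlas` in the model: ℤ^d is connected, obtained through the atlas. [folklore] -/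
theorem zdGraph_connected_of_unitAtlas : (zdGraph d).Connected :=
  connected_of_atlas (𝔄 := unitAtlas d) unitAtlas_covers unitAtlas_nerve_preconnected

/-- (len) in the model: with one zone (zone ≡ 0), positions = the inclusion ℤ^d ⊂ ℝ^d (spacing 1, origin 0) and ℓ ≡ 1,
every bond has length ≤ 1 = ℓ 0, obtained through `bondScale_of_charts`. [folklore] -/
theorem bondScale_unitAtlas :
    BondScale (zdGraph d) (fun _ => 0) (fun x : Site d => affinePos (fun _ => (0 : ℝ)) 1 x) (fun _ => (1 : ℝ)) :=
  bondScale_of_charts (unitAtlas d) (fun _ _ _ => le_rfl) (fun _ => 0) (fun _ => 1) (fun _ => le_rfl)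
    (fun _ => spacingLe_of_affine zero_le_one fun _ _ => rfl) (fun _ _ _ => le_rfl) (fun _ _ huv => unitAtlas_bond huv)

/-- The in-box comparison in the model: two points of one unit cube are at graph distance ≤ their ℓ¹ distance (≤ d).
[folklore] -/
theorem dist_le_of_unitBox (a : Site d) {x y : Site d} (hx : x ∈ (unitAtlas d).box a) (hy : y ∈ (unitAtlas d).box a) :
    (zdGraph d).dist x y ≤ latL1Dist x y :=
  dist_le_of_atlas (𝔄 := unitAtlas d) a hx hy

end Model

/-! ## 7. [v1.1, append-only] Distances ACROSS charts: unions of charts, box widths, linked boxes, nerve chains,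
the exponential shift of (2.66), and the one-scale block partition of ℤ^d [folklore + (2.54) p. 233, (2.66) p. 234]

(2.66) p. 234 sums over the points y″ with (L^jη)^{−1}|y − y″| ≤ 2dM around y ∈ Λ_j; such y″ may lie in another block of
B^j(Λ_j) or across Σ_j / Σ_{j+1} in B^{j∓1}(Λ_{j∓1}), where the in-box comparison of §§2, 5 does not apply.  What the last
«≤» of (2.66) consumes for each y″ is the triangle inequality (2.54) and a bound d(y, y″) ≤ D: then
e^{−½δ₀d(y″,y′)} ≤ e^{½δ₀D}·e^{−½δ₀d(y,y′)} (`exp_shift_of_dist_le`, `sum_exp_shift_of_dist_le`).  This section proves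
the chart-level bound D = w + n(w + 1) for points of two admissible boxes of ℓ¹-width ≤ w joined by a nerve chain of n
links (`dist_le_of_nerve_walk`), and instantiates everything on the partition of ℤ^d into disjoint blocks of side M
linked through the bonds crossing their faces (`blockAtlas`).  WHICH nerve distance separates the boxes of y and y″ in
Bałaban's geometry (the tiling of Ω_j by cubes, p. 231) stays LOCATED. -/

section Width

variable {d : ℕ}

/-- A set of lattice points has ℓ¹-WIDTH ≤ w: any two of its points are at ‖·‖₁-distance ≤ w (a block of Λ_j-points of
side M has width d(M − 1); a cube □ ⊂ T^{(j)} of size ML^jη likewise). [folklore] -/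
def LatWidth (B : Set (Site d)) (w : ℕ) : Prop :=
  ∀ ⦃x y : Site d⦄, x ∈ B → y ∈ B → latL1Dist x y ≤ w

/-- Width bounds restrict to subsets. [folklore] -/
theorem LatWidth.mono {B B' : Set (Site d)} {w : ℕ} (h : LatWidth B w) (hsub : B' ⊆ B) : LatWidth B' w :=
  fun _ _ hx hy => h (hsub hx) (hsub hy)

/-- Width bounds are monotone in the bound. [folklore] -/
theorem LatWidth.of_le {B : Set (Site d)} {w w' : ℕ} (h : LatWidth B w) (hw : w ≤ w') : LatWidth B w' :=
  fun _ _ hx hy => (h hx hy).trans hw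

/-- Two points of an order box Icc lo hi are at ℓ¹ distance ≤ Σ_μ (hi_μ − lo_μ). [folklore] -/
theorem latL1Dist_le_of_mem_Icc {lo hi x y : Site d} (hx : x ∈ Set.Icc lo hi) (hy : y ∈ Set.Icc lo hi) :
    latL1Dist x y ≤ ∑ i, (hi i - lo i).toNat := by
  rw [Set.mem_Icc] at hx hy
  unfold latL1Dist
  exact Finset.sum_le_sum fun i _ => by
    have h1 : lo i ≤ x i := hx.1 i; have h2 : x i ≤ hi i := hx.2 i
    have h3 : lo i ≤ y i := hy.1 i; have h4 : y i ≤ hi i := hy.2 i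
    omega

/-- The order box Icc lo hi has width Σ_μ (hi_μ − lo_μ). [folklore] -/
theorem latWidth_Icc (lo hi : Site d) : LatWidth (Set.Icc lo hi) (∑ i, (hi i - lo i).toNat) :=
  fun _ _ hx hy => latL1Dist_le_of_mem_Icc hx hy

/-- A box of side ≤ M in every direction (hi_μ − lo_μ ≤ M) has width ≤ d·M. [folklore] -/
theorem latWidth_Icc_of_side {lo hi : Site d} {M : ℕ} (h : ∀ i, hi i - lo i ≤ M) :
    LatWidth (Set.Icc lo hi) (d * M) := by
  refine (latWidth_Icc lo hi).of_le ?_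
  calc ∑ i, (hi i - lo i).toNat ≤ ∑ _i : Fin d, M := Finset.sum_le_sum fun i _ => by have := h i; omega
    _ = d * M := by simp

end Width

section Union

variable {d : ℕ} {V : Type*} {G : SimpleGraph V} {B₁ B₂ : Set (Site d)} {φ : Site d → V}

/-- **Union of charts with one chart map** (a big block as a union of blocks, a box-shaped union of cubes): if B₁, B₂
are charts for the same φ, B₁ ∪ B₂ is coordinate-box closed, and the Λ_j-bonds between B₁ and B₂ are admissible, then
B₁ ∪ B₂ is a chart. [folklore] -/
theorem IsBoxChart.union (h₁ : IsBoxChart G B₁ φ) (h₂ : IsBoxChart G B₂ φ) (hU : CboxClosed (B₁ ∪ B₂))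
    (hcross : ∀ ⦃x y : Site d⦄, x ∈ B₁ → y ∈ B₂ → (zdGraph d).Adj x y → G.Adj (φ x) (φ y)) :
    IsBoxChart G (B₁ ∪ B₂) φ := by
  refine ⟨hU, fun x y hx hy hxy => ?_⟩
  rcases hx with hx | hx <;> rcases hy with hy | hy
  · exact h₁.2 hx hy hxy
  · exact hcross hx hy hxy
  · exact (hcross hy hx hxy.symm).symm
  · exact h₂.2 hx hy hxy

end Union

section Across

variable {d : ℕ} {V : Type*} {G : SimpleGraph V} {A : Type*} {𝔄 : Atlas G d A}

/-- Two linked points (equal, or joined by an admissible bond) are at distance ≤ 1. [folklore] -/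
theorem dist_le_one_of_eq_or_adj {v w : V} (he : v = w ∨ G.Adj v w) : G.dist v w ≤ 1 := by
  rcases he with rfl | he
  · simp
  · rw [SimpleGraph.dist_eq_one_iff_adj.2 he]

/-- **Distance across two linked charts**: if box a and box a′ are linked at (x, x′), then for u ∈ box a, u′ ∈ box a′,
d(φ_a u, φ_{a′} u′) ≤ ‖u − x‖₁ + 1 + ‖x′ − u′‖₁ (in-box staircase to x, the link, in-box staircase from x′). [folklore] -/
theorem dist_le_of_linked_at {a a' : A} {x x' : Site d} (hx : x ∈ 𝔄.box a) (hx' : x' ∈ 𝔄.box a')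
    (he : 𝔄.φ a x = 𝔄.φ a' x' ∨ G.Adj (𝔄.φ a x) (𝔄.φ a' x')) {u u' : Site d} (hu : u ∈ 𝔄.box a)
    (hu' : u' ∈ 𝔄.box a') : G.dist (𝔄.φ a u) (𝔄.φ a' u') ≤ latL1Dist u x + 1 + latL1Dist x' u' := by
  have h1 : G.dist (𝔄.φ a u) (𝔄.φ a' u') ≤ G.dist (𝔄.φ a u) (𝔄.φ a x) + G.dist (𝔄.φ a x) (𝔄.φ a' u') :=
    (reachable_of_chart (𝔄.chart a) hu hx).dist_triangle_left _
  have h2 : G.dist (𝔄.φ a x) (𝔄.φ a' u') ≤ G.dist (𝔄.φ a x) (𝔄.φ a' x') + G.dist (𝔄.φ a' x') (𝔄.φ a' u') :=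
    (Atlas.Linked.reachable he).dist_triangle_left _
  have h3 := dist_le_of_atlas (𝔄 := 𝔄) a hu hx
  have h4 := dist_le_one_of_eq_or_adj he
  have h5 := dist_le_of_atlas (𝔄 := 𝔄) a' hx' hu'
  omega

/-- **Distance across two linked charts of width ≤ w**: ≤ 2w + 1. [folklore] -/
theorem dist_le_of_linked {w : ℕ} (hw : ∀ a, LatWidth (𝔄.box a) w) {a a' : A} (h : 𝔄.Linked a a')
    {u u' : Site d} (hu : u ∈ 𝔄.box a) (hu' : u' ∈ 𝔄.box a') : G.dist (𝔄.φ a u) (𝔄.φ a' u') ≤ 2 * w + 1 := by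
  obtain ⟨x, x', hx, hx', he⟩ := h
  have h1 := dist_le_of_linked_at hx hx' he hu hu'
  have h2 := hw a hu hx
  have h3 := hw a' hx' hu'
  omega

/-- **Distance along a chain of linked charts**: along a nerve walk a = a₀ ~ a₁ ~ … ~ a_n = a′ of boxes of width ≤ w,
d(φ_a u, φ_{a′} u′) ≤ w + n·(w + 1) for all u ∈ box a, u′ ∈ box a′ (each link costs ≤ 1 bond, each box crossed ≤ w
bonds). [folklore] -/
theorem dist_le_of_nerve_walk {w : ℕ} (hw : ∀ a, LatWidth (𝔄.box a) w) {a a' : A} (p : 𝔄.nerve.Walk a a')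
    {u u' : Site d} (hu : u ∈ 𝔄.box a) (hu' : u' ∈ 𝔄.box a') :
    G.dist (𝔄.φ a u) (𝔄.φ a' u') ≤ w + p.length * (w + 1) := by
  induction p generalizing u with
  | nil => simpa using (dist_le_of_atlas (𝔄 := 𝔄) _ hu hu').trans (hw _ hu hu')
  | @cons b c e hbc q ih =>
    obtain ⟨x, x', hx, hx', he⟩ := Atlas.linked_of_nerve_adj hbc
    have h1 : G.dist (𝔄.φ b u) (𝔄.φ e u') ≤ G.dist (𝔄.φ b u) (𝔄.φ c x') + G.dist (𝔄.φ c x') (𝔄.φ e u') :=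
      ((reachable_of_chart (𝔄.chart b) hu hx).trans (Atlas.Linked.reachable he)).dist_triangle_left _
    have h2 := dist_le_of_linked_at hx hx' he hu hx'
    rw [latL1Dist_self, add_zero] at h2
    have h3 := hw b hu hx
    have h4 := ih hx' hu'
    rw [SimpleGraph.Walk.length_cons]
    have h5 : (w + 1) + (w + q.length * (w + 1)) = w + (q.length + 1) * (w + 1) := by ring
    omega

/-- **Distance between charts at nerve distance n**: d(φ_a u, φ_{a′} u′) ≤ w + dist_nerve(a, a′)·(w + 1) whenever a′ is
reachable from a in the nerve. [folklore] -/
theorem dist_le_of_nerve_reachable {w : ℕ} (hw : ∀ a, LatWidth (𝔄.box a) w) {a a' : A}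
    (h : 𝔄.nerve.Reachable a a') {u u' : Site d} (hu : u ∈ 𝔄.box a) (hu' : u' ∈ 𝔄.box a') :
    G.dist (𝔄.φ a u) (𝔄.φ a' u') ≤ w + 𝔄.nerve.dist a a' * (w + 1) := by
  obtain ⟨p, hp⟩ := h.exists_walk_length_eq_dist
  rw [← hp]
  exact dist_le_of_nerve_walk hw p hu hu'

/-- … hence ≤ w + n·(w + 1) for charts at nerve distance ≤ n. [folklore] -/
theorem dist_le_of_nerve_dist_le {w n : ℕ} (hw : ∀ a, LatWidth (𝔄.box a) w) {a a' : A}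
    (h : 𝔄.nerve.Reachable a a') (hn : 𝔄.nerve.dist a a' ≤ n) {u u' : Site d} (hu : u ∈ 𝔄.box a)
    (hu' : u' ∈ 𝔄.box a') : G.dist (𝔄.φ a u) (𝔄.φ a' u') ≤ w + n * (w + 1) :=
  (dist_le_of_nerve_reachable hw h hu hu').trans (by gcongr)

end Across

section Shift

variable {g : B6.Geometry}

/-- **The exponential shift in (2.66)**: from the triangle inequality (2.54) and d(y, y″) ≤ D,
e^{−½δ₀ d(y″, y′)} ≤ e^{½δ₀ D} · e^{−½δ₀ d(y, y′)} (δ₀ ≥ 0). [cite: Balaban1984PropagatorsII, (2.66) p.234 + (2.54) p.233] -/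
theorem exp_shift_of_dist_le (htri : B6RandomWalk.Triangle254 g) {δ₀ D : ℝ} (hδ : 0 ≤ δ₀) {y y' y'' : g.Site}
    (hD : g.dist y y'' ≤ D) :
    Real.exp (-(δ₀ / 2) * g.dist y'' y') ≤ Real.exp (δ₀ / 2 * D) * Real.exp (-(δ₀ / 2) * g.dist y y') := by
  rw [← Real.exp_add]
  apply Real.exp_le_exp.2
  have h1 := htri y y'' y'
  have h2 : 0 ≤ δ₀ / 2 := by positivity
  nlinarith [mul_le_mul_of_nonneg_left h1 h2, mul_le_mul_of_nonneg_left hD h2]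

/-- **The last "≤" of (2.66) for the y″-sum, given per-term comparison bounds**: for a finite set S of intermediate
points y″ with nonnegative weights a(y″) and bounds d(y, y″) ≤ D(y″),
Σ_{y″∈S} a(y″) e^{−½δ₀ d(y″,y′)} ≤ (Σ_{y″∈S} a(y″) e^{½δ₀ D(y″)}) · e^{−½δ₀ d(y,y′)}.  (The n-sum of (2.66) is the
geometric series of (2.65), not touched.) [cite: Balaban1984PropagatorsII, (2.66) p.234 + (2.54) p.233] -/
theorem sum_exp_shift_of_dist_le (htri : B6RandomWalk.Triangle254 g) {δ₀ : ℝ} (hδ : 0 ≤ δ₀) {y y' : g.Site}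
    (S : Finset g.Site) (a D : g.Site → ℝ) (ha : ∀ y'' ∈ S, 0 ≤ a y'') (hD : ∀ y'' ∈ S, g.dist y y'' ≤ D y'') :
    ∑ y'' ∈ S, a y'' * Real.exp (-(δ₀ / 2) * g.dist y'' y')
      ≤ (∑ y'' ∈ S, a y'' * Real.exp (δ₀ / 2 * D y'')) * Real.exp (-(δ₀ / 2) * g.dist y y') := by
  rw [Finset.sum_mul]
  refine Finset.sum_le_sum fun y'' hy'' => ?_
  rw [mul_assoc]
  exact mul_le_mul_of_nonneg_left (exp_shift_of_dist_le htri hδ (hD y'' hy'')) (ha y'' hy'')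

end Shift

section ContourAcross

variable {d : ℕ} {g : B6.Geometry} {C : ContourSystem g} {A : Type*}

/-- **The comparison behind (2.66), across charts, lattice form**: for a realised geometry and block points y, y″ whose
lattice points lie in admissible boxes a, a′ of width ≤ w joined by a nerve chain of n links, d(y, y″) ≤ w + n(w + 1).
[cite: Balaban1984PropagatorsII, (2.46) p.231 + (2.66) p.234] -/
theorem dist246_le_of_nerve_walk (h : Realizes g C) (𝔄 : Atlas C.bond d A) {w : ℕ} (hw : ∀ a, LatWidth (𝔄.box a) w)
    {a a' : A} (p : 𝔄.nerve.Walk a a') {y y'' : g.Site} {x x'' : Site d} (hx : x ∈ 𝔄.box a) (hx'' : x'' ∈ 𝔄.box a')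
    (hy : C.ι y = 𝔄.φ a x) (hy'' : C.ι y'' = 𝔄.φ a' x'') :
    g.dist y y'' ≤ ((w + p.length * (w + 1) : ℕ) : ℝ) := by
  rw [h y y'', dist246, hy, hy'']
  exact_mod_cast dist_le_of_nerve_walk hw p hx hx''

/-- … and for boxes at nerve distance ≤ n (a′ reachable from a): d(y, y″) ≤ w + n(w + 1). [cite: Balaban1984PropagatorsII, (2.46) p.231 + (2.66) p.234] -/
theorem dist246_le_of_nerve_dist_le (h : Realizes g C) (𝔄 : Atlas C.bond d A) {w n : ℕ}
    (hw : ∀ a, LatWidth (𝔄.box a) w) {a a' : A} (hr : 𝔄.nerve.Reachable a a') (hn : 𝔄.nerve.dist a a' ≤ n)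
    {y y'' : g.Site} {x x'' : Site d} (hx : x ∈ 𝔄.box a) (hx'' : x'' ∈ 𝔄.box a') (hy : C.ι y = 𝔄.φ a x)
    (hy'' : C.ι y'' = 𝔄.φ a' x'') : g.dist y y'' ≤ ((w + n * (w + 1) : ℕ) : ℝ) := by
  rw [h y y'', dist246, hy, hy'']
  exact_mod_cast dist_le_of_nerve_dist_le hw hr hn hx hx''

/-- **The (2.66) shift across charts**: for a realised geometry with admissible contours between all points
(`C.bond.Connected`, e.g. from `bond_connected_of_atlas`), y, y″ in boxes of width ≤ w at nerve distance ≤ n, and any y′: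
e^{−½δ₀ d(y″, y′)} ≤ e^{½δ₀ (w + n(w+1))} · e^{−½δ₀ d(y, y′)} — the O(1) of this step depends on the block geometry
(w, n) only. [cite: Balaban1984PropagatorsII, (2.66) p.234 + (2.54) p.233 + (2.46) p.231] -/
theorem exp_shift_of_nerve_dist_le (h : Realizes g C) (hconn : C.bond.Connected) (𝔄 : Atlas C.bond d A) {w n : ℕ}
    (hw : ∀ a, LatWidth (𝔄.box a) w) {a a' : A} (hr : 𝔄.nerve.Reachable a a') (hn : 𝔄.nerve.dist a a' ≤ n)
    {y y' y'' : g.Site} {x x'' : Site d} (hx : x ∈ 𝔄.box a) (hx'' : x'' ∈ 𝔄.box a') (hy : C.ι y = 𝔄.φ a x)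
    (hy'' : C.ι y'' = 𝔄.φ a' x'') {δ₀ : ℝ} (hδ : 0 ≤ δ₀) :
    Real.exp (-(δ₀ / 2) * g.dist y'' y')
      ≤ Real.exp (δ₀ / 2 * ((w + n * (w + 1) : ℕ) : ℝ)) * Real.exp (-(δ₀ / 2) * g.dist y y') :=
  exp_shift_of_dist_le (triangle254_of_realizes h hconn) hδ (dist246_le_of_nerve_dist_le h 𝔄 hw hr hn hx hx'' hy hy'')

end ContourAcross

section ModelAcross

variable {d : ℕ}

/-- The unit cube Icc a (a + 1) has width d. [folklore] -/
theorem latWidth_unitBox (a : Site d) : LatWidth ((unitAtlas d).box a) d := by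
  have h := latWidth_Icc_of_side (lo := a) (hi := a + 1) (M := 1) (fun i => by simp)
  rw [mul_one] at h
  exact h

/-- Nearest-neighbour walks of ℤ^d are nerve walks of the unit atlas (as a graph homomorphism). [folklore] -/
def unitAtlasNerveHom (d : ℕ) : zdGraph d →g (unitAtlas d).nerve where
  toFun := id
  map_rel' h := unitAtlas_nerve_adj_of_adj h

/-- The nerve distance of the unit atlas is at most the ℓ¹ distance of the indices. [folklore] -/
theorem unitAtlas_nerve_dist_le (a b : Site d) : (unitAtlas d).nerve.dist a b ≤ latL1Dist a b := by
  obtain ⟨p, hp, -⟩ := exists_walk_in_cbox a b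
  have h := SimpleGraph.dist_le (p.map (unitAtlasNerveHom d))
  rw [SimpleGraph.Walk.length_map, hp] at h
  exact h

/-- **The across-chart bound in the model**: points x ∈ Icc a (a+1), y ∈ Icc b (b+1) of ℤ^d are at graph distance
≤ d + ‖a − b‖₁·(d + 1), obtained through `dist_le_of_nerve_dist_le` (every hypothesis of §7 instantiated). [folklore] -/
theorem dist_le_of_unitAtlas (a b : Site d) {x y : Site d} (hx : x ∈ (unitAtlas d).box a)
    (hy : y ∈ (unitAtlas d).box b) : (zdGraph d).dist x y ≤ d + latL1Dist a b * (d + 1) :=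
  dist_le_of_nerve_dist_le (𝔄 := unitAtlas d) latWidth_unitBox (unitAtlas_nerve_preconnected a b)
    (unitAtlas_nerve_dist_le a b) hx hy

end ModelAcross

section ModelBlocks

variable {d : ℕ}

/-- Lower corner M·a of the block of side M indexed by a ∈ ℤ^d. [folklore] -/
def blockLo (M : ℕ) (a : Site d) : Site d := fun i => (M : ℤ) * a i

/-- Upper corner M·a + (M − 1)·(1, …, 1) of the block of side M indexed by a. [folklore] -/
def blockHi (M : ℕ) (a : Site d) : Site d := fun i => (M : ℤ) * a i + ((M : ℤ) - 1)

/-- **The one-scale BLOCK atlas of ℤ^d** (the partition of T^{(0)}_η ≅ ℤ^d into blocks B(x) of M^d points, p. 224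
(2.1)–(2.4) with k = 0): charts indexed by a ∈ ℤ^d, box a = Icc (M·a) (M·a + M − 1), identity chart maps; DISJOINT
boxes, linked through the bonds crossing their common faces. [folklore] -/
def blockAtlas (d M : ℕ) : Atlas (zdGraph d) d (Site d) where
  box a := Set.Icc (blockLo M a) (blockHi M a)
  φ _ x := x
  chart _ := ⟨cboxClosed_Icc _ _, fun _ _ _ _ h => h⟩

/-- Membership in a block, coordinatewise. [folklore] -/
theorem mem_blockBox_iff {M : ℕ} {a x : Site d} :
    x ∈ (blockAtlas d M).box a ↔ ∀ i, (M : ℤ) * a i ≤ x i ∧ x i ≤ (M : ℤ) * a i + ((M : ℤ) - 1) := by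
  show x ∈ Set.Icc (blockLo M a) (blockHi M a) ↔ _
  rw [Set.mem_Icc]
  exact ⟨fun h i => ⟨h.1 i, h.2 i⟩, fun h => ⟨fun i => (h i).1, fun i => (h i).2⟩⟩

/-- **The blocks cover** (M ≥ 1): x lies in the block indexed by (⌊x_μ / M⌋)_μ. [folklore] -/
theorem blockAtlas_covers {M : ℕ} (hM : 0 < M) : (blockAtlas d M).Covers := by
  intro v
  refine ⟨fun i => v i / (M : ℤ), v, ?_, rfl⟩
  rw [mem_blockBox_iff]
  intro i
  have hM' : (0 : ℤ) < M := by exact_mod_cast hM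
  have h1 := Int.mul_ediv_add_emod (v i) (M : ℤ)
  have h2 := Int.emod_nonneg (v i) hM'.ne'
  have h3 := Int.emod_lt_of_pos (v i) hM'
  constructor <;> omega

/-- The blocks have width d(M − 1). [folklore] -/
theorem latWidth_blockBox (M : ℕ) (a : Site d) : LatWidth ((blockAtlas d M).box a) (d * (M - 1)) :=
  latWidth_Icc_of_side (lo := blockLo M a) (hi := blockHi M a) fun i => by simp only [blockLo, blockHi]; omega

/-- The top point of block a in direction μ, M·a + (M − 1)e_μ, and its neighbour M·a + M e_μ = M·(a + e_μ): the bond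
crossing the common face of the blocks a and a + e_μ. [folklore] -/
theorem blockLo_add_single (M : ℕ) (a : Site d) (i : Fin d) :
    blockLo M a + Pi.single i ((M : ℤ) - 1) + Pi.single i 1 = blockLo M (a + Pi.single i 1) := by
  funext j
  by_cases hj : j = i
  · subst hj; simp [blockLo]; ring
  · simp [blockLo, Pi.single_eq_of_ne hj]

/-- The lower corner lies in its block (M ≥ 1). [folklore] -/
theorem blockLo_mem {M : ℕ} (hM : 0 < M) (a : Site d) : blockLo M a ∈ (blockAtlas d M).box a := by
  rw [mem_blockBox_iff]
  intro i
  simp only [blockLo]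
  constructor <;> omega

/-- The top point in direction μ lies in its block (M ≥ 1). [folklore] -/
theorem blockLo_add_single_mem {M : ℕ} (hM : 0 < M) (a : Site d) (i : Fin d) :
    blockLo M a + Pi.single i ((M : ℤ) - 1) ∈ (blockAtlas d M).box a := by
  rw [mem_blockBox_iff]
  intro j
  rw [Pi.add_apply]
  by_cases hj : j = i
  · subst hj; rw [Pi.single_eq_same]; simp only [blockLo]; constructor <;> omega
  · rw [Pi.single_eq_of_ne hj]; simp only [blockLo]; constructor <;> omega

/-- **Adjacent blocks are linked** by the bond crossing their common face (M ≥ 1). [folklore] -/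
theorem blockAtlas_linked_add_single {M : ℕ} (hM : 0 < M) (a : Site d) (i : Fin d) :
    (blockAtlas d M).Linked a (a + Pi.single i 1) := by
  refine ⟨blockLo M a + Pi.single i ((M : ℤ) - 1), blockLo M (a + Pi.single i 1), blockLo_add_single_mem hM a i,
    blockLo_mem hM _, Or.inr ?_⟩
  show (zdGraph d).Adj (blockLo M a + Pi.single i ((M : ℤ) - 1)) (blockLo M (a + Pi.single i 1))
  rw [← blockLo_add_single M a i]
  exact (zdGraph_adj_iff _ _).2 ⟨i, Or.inl rfl⟩

/-- Nearest-neighbour block indices are adjacent in the nerve of the block atlas (M ≥ 1). [folklore] -/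
theorem blockAtlas_nerve_adj_of_adj {M : ℕ} (hM : 0 < M) {a b : Site d} (h : (zdGraph d).Adj a b) :
    (blockAtlas d M).nerve.Adj a b := by
  rw [Atlas.nerve, SimpleGraph.fromRel_adj]
  refine ⟨h.ne, ?_⟩
  obtain ⟨i, hb | ha⟩ := (zdGraph_adj_iff a b).1 h
  · exact Or.inl (hb ▸ blockAtlas_linked_add_single hM a i)
  · exact Or.inr (ha ▸ blockAtlas_linked_add_single hM b i)

/-- Nearest-neighbour walks of block indices are nerve walks of the block atlas (graph homomorphism; M ≥ 1). [folklore] -/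
def blockAtlasNerveHom {M : ℕ} (hM : 0 < M) : zdGraph d →g (blockAtlas d M).nerve where
  toFun := id
  map_rel' h := blockAtlas_nerve_adj_of_adj hM h

/-- The nerve of the block atlas is preconnected (M ≥ 1). [folklore] -/
theorem blockAtlas_nerve_preconnected {M : ℕ} (hM : 0 < M) : (blockAtlas d M).nerve.Preconnected :=
  (zdGraph_preconnected_holds (d := d)).mono fun _ _ h => blockAtlas_nerve_adj_of_adj hM h

/-- The nerve distance of two blocks is at most the ℓ¹ distance of their indices (M ≥ 1). [folklore] -/
theorem blockAtlas_nerve_dist_le {M : ℕ} (hM : 0 < M) (a b : Site d) :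
    (blockAtlas d M).nerve.dist a b ≤ latL1Dist a b := by
  obtain ⟨p, hp, -⟩ := exists_walk_in_cbox a b
  have h := SimpleGraph.dist_le (p.map (blockAtlasNerveHom hM))
  rw [SimpleGraph.Walk.length_map, hp] at h
  exact h

/-- ℤ^d is connected, obtained through the block atlas (cover + nerve; M ≥ 1). [folklore] -/
theorem zdGraph_connected_of_blockAtlas {M : ℕ} (hM : 0 < M) : (zdGraph d).Connected :=
  connected_of_atlas (𝔄 := blockAtlas d M) (blockAtlas_covers hM) (blockAtlas_nerve_preconnected hM)

/-- **The across-chart bound in the block model**: x in block a and y in block b of side M ≥ 1 are at graph distance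
≤ d(M − 1) + ‖a − b‖₁·(d(M − 1) + 1) — every hypothesis of §7 (`LatWidth`, nerve reachability, nerve distance)
instantiated on the one-scale block partition of ℤ^d. [folklore] -/
theorem dist_le_of_blockAtlas {M : ℕ} (hM : 0 < M) (a b : Site d) {x y : Site d} (hx : x ∈ (blockAtlas d M).box a)
    (hy : y ∈ (blockAtlas d M).box b) :
    (zdGraph d).dist x y ≤ d * (M - 1) + latL1Dist a b * (d * (M - 1) + 1) :=
  dist_le_of_nerve_dist_le (𝔄 := blockAtlas d M) (latWidth_blockBox M) (blockAtlas_nerve_preconnected hM a b)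
    (blockAtlas_nerve_dist_le hM a b) hx hy

end ModelBlocks

/-! ## 8. [v1.2, append-only] A TWO-SCALE instance: blocks of the η-lattice on one side of a hyperplane Σ, blocks of
the Lη-lattice on the other, glued through the Lη-lattice points on Σ [folklore model of (2.1)–(2.4) p. 224, k = 1]

(2.1)–(2.4) p. 224: T^{(k)}_η = ⋃_j B^j(Λ_j), Λ_j ⊂ T^{(j)}_{L^jη} the L^jη-lattice points of the zone between Σ_j and
Σ_{j+1}, a point of the coarser lattice being a point of the finer one.  The MODEL of this section takes k = 1, the
infinite lattice ℤ^d ≅ T_η in η-lattice coordinates, a coordinate direction μ and Ω₁ = the half-space {x_μ ≥ 0}: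
FINE points x with x_μ < M joined by η-bonds (B⁰(Λ₀) with the slab 0 ≤ x_μ < M of overlap), COARSE points L·y,
y ∈ ℤ^d with y_μ ≥ 0, joined by the Lη-bonds {L·y, L·(y ± e_ν)} (B¹(Λ₁)); the coarse points L·y₀ with (y₀)_μ = 0 lie
on Σ = {x_μ = 0} and are fine points as well — the SHARED points through which the two levels are glued (first clause
of `Atlas.Linked`).  Everything here is [folklore]; nothing printed is asserted; what the instance shows is that the
chart / atlas / width / nerve data of §§3, 7 are realizable by a genuinely two-level family of boxes (fine blocks
with identity charts, coarse blocks with the charts y ↦ L·y), with the explicit bounds listed in item 7 of the header. -/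

section TwoScale

variable {d : ℕ}

/-- The η-lattice coordinates L·y of the Lη-lattice point with coarse coordinates y (an Lη-lattice point is an
η-lattice point: T^{(1)}_{Lη} ⊂ T_η as point sets, (2.1) p. 224). [folklore] -/
def scalePt (L : ℕ) (y : Site d) : Site d := fun i => (L : ℤ) * y i

/-- Coordinates of L·y. [folklore] -/
theorem scalePt_apply (L : ℕ) (y : Site d) (i : Fin d) : scalePt L y i = (L : ℤ) * y i := rfl

/-- y ↦ L·y is injective for L ≥ 1. [folklore] -/
theorem scalePt_injective {L : ℕ} (hL : 0 < L) : Function.Injective (scalePt (d := d) L) := by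
  intro y y' h
  funext i
  have hi := congrFun h i
  simp only [scalePt] at hi
  have hL' : (L : ℤ) ≠ 0 := by exact_mod_cast hL.ne'
  exact mul_left_cancel₀ hL' hi

/-- L·(M·b) = M·(L·b): the η-coordinates of the lower corner of the coarse block b are the lower corner of the fine
block indexed by L·b. [folklore] -/
theorem scalePt_blockLo (L M : ℕ) (b : Site d) : scalePt L (blockLo M b) = blockLo M (scalePt L b) := by
  funext i; simp only [scalePt, blockLo]; ring

/-- The empty box is (vacuously) a chart. [folklore] -/
theorem isBoxChart_empty {V : Type*} (G : SimpleGraph V) (φ : Site d → V) :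
    IsBoxChart G (∅ : Set (Site d)) φ :=
  ⟨fun _ _ h => absurd h (Set.notMem_empty _), fun _ _ h => absurd h (Set.notMem_empty _)⟩

/-- The empty box has every width. [folklore] -/
theorem latWidth_empty (w : ℕ) : LatWidth (∅ : Set (Site d)) w :=
  fun _ _ h => absurd h (Set.notMem_empty _)

/-- Half-spaces {x_μ ≤ c} are coordinate-box closed. [folklore] -/
theorem cboxClosed_setOf_apply_le (μ : Fin d) (c : ℤ) : CboxClosed {x : Site d | x μ ≤ c} := by
  intro u y hu hy z hz
  simp only [Set.mem_setOf_eq] at hu hy ⊢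
  exact (hz μ).2.trans (max_le hu hy)

/-- Half-spaces {x_μ < c} are coordinate-box closed. [folklore] -/
theorem cboxClosed_setOf_apply_lt (μ : Fin d) (c : ℤ) : CboxClosed {x : Site d | x μ < c} := by
  intro u y hu hy z hz
  simp only [Set.mem_setOf_eq] at hu hy ⊢
  exact (hz μ).2.trans_lt (max_lt hu hy)

/-- Half-spaces {c ≤ x_μ} are coordinate-box closed. [folklore] -/
theorem cboxClosed_setOf_le_apply (μ : Fin d) (c : ℤ) : CboxClosed {x : Site d | c ≤ x μ} := by
  intro u y hu hy z hz
  simp only [Set.mem_setOf_eq] at hu hy ⊢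
  exact (le_min hu hy).trans (hz μ).1

/-- Distinct linked charts are adjacent in the nerve. [folklore] -/
theorem Atlas.nerve_adj_of_linked {V A : Type*} {G : SimpleGraph V} (𝔄 : Atlas G d A) {a a' : A} (hne : a ≠ a')
    (h : 𝔄.Linked a a') : 𝔄.nerve.Adj a a' := by
  rw [Atlas.nerve, SimpleGraph.fromRel_adj]
  exact ⟨hne, Or.inl h⟩

/-! ### 8a. The two-scale bond graph on the η-lattice -/

/-- The BONDS of the two-scale model across the hyperplane Σ = {x_μ = 0}, on the η-lattice ℤ^d in lattice coordinates:
η-bonds between FINE points (x_μ < M: the region B⁰(Λ₀) together with the overlap slab 0 ≤ x_μ < M), and Lη-bonds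
{L·y, L·y′}, y ∼ y′, between COARSE points L·y with y_μ, y′_μ ≥ 0 (the region B¹(Λ₁)) — a folklore MODEL of (2.1)–(2.4)
p. 224 with k = 1, nothing printed asserted. [folklore] -/
def twoScaleRel (d L M : ℕ) (μ : Fin d) (u v : Site d) : Prop :=
  ((zdGraph d).Adj u v ∧ u μ < M ∧ v μ < M) ∨
    ∃ y y' : Site d, (zdGraph d).Adj y y' ∧ 0 ≤ y μ ∧ 0 ≤ y' μ ∧ u = scalePt L y ∧ v = scalePt L y'

/-- The two-scale bond graph (a simple graph on the η-lattice points; the points that are neither fine nor coarse are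
isolated, `twoScaleGraph_not_adj_of_not_mem`). [folklore] -/
def twoScaleGraph (d L M : ℕ) (μ : Fin d) : SimpleGraph (Site d) := SimpleGraph.fromRel (twoScaleRel d L M μ)

/-- The point set T of the two-scale model: fine points {x_μ < M} ∪ coarse points {L·y : 0 ≤ y_μ}. [folklore] -/
def twoScalePts (d L M : ℕ) (μ : Fin d) : Set (Site d) :=
  {u | u μ < M} ∪ {u | ∃ y : Site d, 0 ≤ y μ ∧ u = scalePt L y}

variable {L M : ℕ} {μ : Fin d}

/-- Fine bonds are bonds of the two-scale graph. [folklore] -/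
theorem twoScaleGraph_adj_of_fine {u v : Site d} (h : (zdGraph d).Adj u v) (hu : u μ < M) (hv : v μ < M) :
    (twoScaleGraph d L M μ).Adj u v := by
  rw [twoScaleGraph, SimpleGraph.fromRel_adj]
  exact ⟨h.ne, Or.inl (Or.inl ⟨h, hu, hv⟩)⟩

/-- Coarse bonds are bonds of the two-scale graph (L ≥ 1). [folklore] -/
theorem twoScaleGraph_adj_of_coarse (hL : 0 < L) {y y' : Site d} (h : (zdGraph d).Adj y y') (hy : 0 ≤ y μ)
    (hy' : 0 ≤ y' μ) : (twoScaleGraph d L M μ).Adj (scalePt L y) (scalePt L y') := by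
  rw [twoScaleGraph, SimpleGraph.fromRel_adj]
  exact ⟨fun he => h.ne (scalePt_injective hL he), Or.inl (Or.inr ⟨y, y', h, hy, hy', rfl, rfl⟩)⟩

/-- Both ends of a two-scale bond are points of T. [folklore] -/
theorem mem_twoScalePts_of_rel {u v : Site d} (h : twoScaleRel d L M μ u v) :
    u ∈ twoScalePts d L M μ ∧ v ∈ twoScalePts d L M μ := by
  rcases h with ⟨-, hu, hv⟩ | ⟨y, y', -, hy, hy', rfl, rfl⟩
  · exact ⟨Or.inl hu, Or.inl hv⟩
  · exact ⟨Or.inr ⟨y, hy, rfl⟩, Or.inr ⟨y', hy', rfl⟩⟩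

/-- HONESTY of the model: the η-lattice points outside T (x_μ ≥ M and not of the form L·y with y_μ ≥ 0) are isolated —
the two-scale graph restricted to T is the bond graph described. [folklore] -/
theorem twoScaleGraph_not_adj_of_not_mem {u : Site d} (hu : u ∉ twoScalePts d L M μ) (v : Site d) :
    ¬ (twoScaleGraph d L M μ).Adj u v := by
  rw [twoScaleGraph, SimpleGraph.fromRel_adj]
  rintro ⟨-, h | h⟩
  · exact hu (mem_twoScalePts_of_rel h).1
  · exact hu (mem_twoScalePts_of_rel h).2

/-! ### 8b. The regions are charts: M-free in-region comparisons -/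

/-- The whole fine region {x_μ < M} is ONE chart of the two-scale graph (identity chart map; a half-space is
coordinate-box closed). [folklore] -/
theorem isBoxChart_fineRegion : IsBoxChart (twoScaleGraph d L M μ) {x : Site d | x μ < M} (fun x => x) :=
  ⟨cboxClosed_setOf_apply_lt μ M, fun _ _ hu hv h => twoScaleGraph_adj_of_fine h hu hv⟩

/-- The whole coarse half-lattice {0 ≤ y_μ} is ONE chart of the two-scale graph (chart map y ↦ L·y; L ≥ 1). [folklore] -/
theorem isBoxChart_coarseRegion (hL : 0 < L) :
    IsBoxChart (twoScaleGraph d L M μ) {y : Site d | 0 ≤ y μ} (scalePt L) :=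
  ⟨cboxClosed_setOf_le_apply μ 0, fun _ _ hy hy' h => twoScaleGraph_adj_of_coarse hL h hy hy'⟩

/-- Two fine points are at two-scale graph distance ≤ their ℓ¹ distance in η-units. [folklore] -/
theorem twoScale_dist_le_of_fine {u v : Site d} (hu : u μ < M) (hv : v μ < M) :
    (twoScaleGraph d L M μ).dist u v ≤ latL1Dist u v :=
  dist_le_latL1Dist_of_chart isBoxChart_fineRegion hu hv

/-- Two coarse points L·y, L·y′ are at two-scale graph distance ≤ ‖y − y′‖₁ (their ℓ¹ distance in Lη-units). [folklore] -/
theorem twoScale_dist_le_of_coarse (hL : 0 < L) {y y' : Site d} (hy : 0 ≤ y μ) (hy' : 0 ≤ y' μ) :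
    (twoScaleGraph d L M μ).dist (scalePt L y) (scalePt L y') ≤ latL1Dist y y' :=
  dist_le_latL1Dist_of_chart (isBoxChart_coarseRegion hL) hy hy'

/-- The coarse point L·y₀ with (y₀)_μ = 0 is a SHARED point: it is also a fine point (M ≥ 1). [folklore] -/
theorem scalePt_apply_lt_of_eq_zero (hM : 0 < M) {y₀ : Site d} (h : y₀ μ = 0) : scalePt L y₀ μ < M := by
  rw [scalePt_apply, h, mul_zero]; exact_mod_cast hM

/-- ACROSS the interface: a fine point u and a coarse point L·y are at two-scale graph distance
≤ ‖u − L·y₀‖₁ + ‖y₀ − y‖₁ through the shared point L·y₀, y₀ := y with its μ-coordinate set to 0 (M, L ≥ 1). [folklore] -/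
theorem twoScale_dist_le_of_fine_coarse (hM : 0 < M) (hL : 0 < L) {u y : Site d} (hu : u μ < M) (hy : 0 ≤ y μ) :
    (twoScaleGraph d L M μ).dist u (scalePt L y) ≤
      latL1Dist u (scalePt L (Function.update y μ 0)) + latL1Dist (Function.update y μ 0) y := by
  have h0 : Function.update y μ 0 μ = 0 := Function.update_self μ 0 y
  have h1 := twoScale_dist_le_of_fine (L := L) hu (scalePt_apply_lt_of_eq_zero (L := L) hM h0)
  have h2 := twoScale_dist_le_of_coarse (M := M) hL h0.symm.le hy
  have h3 := (reachable_of_chart (isBoxChart_fineRegion (L := L)) hu (scalePt_apply_lt_of_eq_zero (L := L) hM h0)).dist_triangle_left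
    (G := twoScaleGraph d L M μ) (scalePt L y)
  omega

/-! ### 8c. The two-scale BLOCK atlas: fine blocks ⊔ coarse blocks, glued through the shared points on Σ -/

/-- A point of a fine block (index a with a_μ ≤ 0) is a fine point: x_μ ≤ M a_μ + M − 1 < M. [folklore] -/
theorem apply_lt_of_mem_blockBox {a x : Site d} (ha : a μ ≤ 0) (hx : x ∈ (blockAtlas d M).box a) : x μ < M := by
  have h := ((mem_blockBox_iff).1 hx μ).2
  have hM : (0 : ℤ) ≤ M := Int.natCast_nonneg M
  have : (M : ℤ) * a μ ≤ 0 := by nlinarith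
  omega

/-- A point of a coarse block (index b with 0 ≤ b_μ) has y_μ ≥ M b_μ ≥ 0. [folklore] -/
theorem apply_nonneg_of_mem_blockBox {b y : Site d} (hb : 0 ≤ b μ) (hy : y ∈ (blockAtlas d M).box b) : 0 ≤ y μ := by
  have h := ((mem_blockBox_iff).1 hy μ).1
  have : (0 : ℤ) ≤ (M : ℤ) * b μ := by positivity
  omega

/-- **The two-scale block atlas**: charts indexed by ℤ^d ⊔ ℤ^d — FINE blocks a (a_μ ≤ 0) of side M of the η-lattice with
the identity chart map, COARSE blocks b (0 ≤ b_μ) of side M of the Lη-lattice with chart map y ↦ L·y; the remaining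
indices carry the empty box.  (p. 224 (2.1)–(2.4) with k = 1 and Ω₁ a half-space: B⁰(Λ₀) ∪ B¹(Λ₁), each a union of
blocks of M^d lattice points of its own lattice.) [folklore] -/
def twoScaleAtlas (d M : ℕ) {L : ℕ} (hL : 0 < L) (μ : Fin d) :
    Atlas (twoScaleGraph d L M μ) d (Site d ⊕ Site d) where
  box := Sum.elim (fun a => if a μ ≤ 0 then (blockAtlas d M).box a else ∅)
    (fun b => if 0 ≤ b μ then (blockAtlas d M).box b else ∅)
  φ := Sum.elim (fun _ x => x) (fun _ y => scalePt L y)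
  chart s := by
    cases s with
    | inl a =>
      show IsBoxChart _ (if a μ ≤ 0 then (blockAtlas d M).box a else ∅) (fun x => x)
      split_ifs with ha
      · exact ⟨((blockAtlas d M).chart a).1, fun x y hx hy h =>
          twoScaleGraph_adj_of_fine h (apply_lt_of_mem_blockBox ha hx) (apply_lt_of_mem_blockBox ha hy)⟩
      · exact isBoxChart_empty _ _
    | inr b =>
      show IsBoxChart _ (if 0 ≤ b μ then (blockAtlas d M).box b else ∅) (fun y => scalePt L y)
      split_ifs with hb
      · exact ⟨((blockAtlas d M).chart b).1, fun x y hx hy h =>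
          twoScaleGraph_adj_of_coarse hL h (apply_nonneg_of_mem_blockBox hb hx) (apply_nonneg_of_mem_blockBox hb hy)⟩
      · exact isBoxChart_empty _ _

/-- The box of an admissible fine index is its block. [folklore] -/
theorem twoScale_box_inl (hL : 0 < L) {a : Site d} (ha : a μ ≤ 0) :
    (twoScaleAtlas d M hL μ).box (Sum.inl a) = (blockAtlas d M).box a := if_pos ha

/-- The box of an admissible coarse index is its block. [folklore] -/
theorem twoScale_box_inr (hL : 0 < L) {b : Site d} (hb : 0 ≤ b μ) :
    (twoScaleAtlas d M hL μ).box (Sum.inr b) = (blockAtlas d M).box b := if_pos hb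

/-- The fine chart maps are the identity. [folklore] -/
theorem twoScale_φ_inl (hL : 0 < L) (a x : Site d) : (twoScaleAtlas d M hL μ).φ (Sum.inl a) x = x := rfl

/-- The coarse chart maps are y ↦ L·y. [folklore] -/
theorem twoScale_φ_inr (hL : 0 < L) (b y : Site d) : (twoScaleAtlas d M hL μ).φ (Sum.inr b) y = scalePt L y := rfl

/-- Every box of the two-scale atlas has width ≤ d(M − 1) (lattice steps of its own lattice). [folklore] -/
theorem latWidth_twoScaleBox (hL : 0 < L) (s : Site d ⊕ Site d) : LatWidth ((twoScaleAtlas d M hL μ).box s) (d * (M - 1)) := by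
  cases s with
  | inl a =>
    show LatWidth (if a μ ≤ 0 then (blockAtlas d M).box a else ∅) _
    split_ifs
    · exact latWidth_blockBox M a
    · exact latWidth_empty _
  | inr b =>
    show LatWidth (if 0 ≤ b μ then (blockAtlas d M).box b else ∅) _
    split_ifs
    · exact latWidth_blockBox M b
    · exact latWidth_empty _

/-- Adjacent fine blocks are linked through the η-bond crossing their common face (M ≥ 1). [folklore] -/
theorem twoScale_linked_inl_add_single (hL : 0 < L) (hM : 0 < M) {a : Site d} {i : Fin d} (ha : a μ ≤ 0)
    (ha' : (a + Pi.single i 1 : Site d) μ ≤ 0) :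
    (twoScaleAtlas d M hL μ).Linked (Sum.inl a) (Sum.inl (a + Pi.single i 1)) := by
  refine ⟨blockLo M a + Pi.single i ((M : ℤ) - 1), blockLo M (a + Pi.single i 1), ?_, ?_, Or.inr ?_⟩
  · rw [twoScale_box_inl hL ha]; exact blockLo_add_single_mem hM a i
  · rw [twoScale_box_inl hL ha']; exact blockLo_mem hM _
  · show (twoScaleGraph d L M μ).Adj (blockLo M a + Pi.single i ((M : ℤ) - 1)) (blockLo M (a + Pi.single i 1))
    refine twoScaleGraph_adj_of_fine ?_ (apply_lt_of_mem_blockBox ha (blockLo_add_single_mem hM a i))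
      (apply_lt_of_mem_blockBox ha' (blockLo_mem hM _))
    rw [← blockLo_add_single M a i]
    exact (zdGraph_adj_iff _ _).2 ⟨i, Or.inl rfl⟩

/-- Adjacent coarse blocks are linked through the Lη-bond crossing their common face (M, L ≥ 1). [folklore] -/
theorem twoScale_linked_inr_add_single (hL : 0 < L) (hM : 0 < M) {b : Site d} {i : Fin d} (hb : 0 ≤ b μ)
    (hb' : 0 ≤ (b + Pi.single i 1 : Site d) μ) :
    (twoScaleAtlas d M hL μ).Linked (Sum.inr b) (Sum.inr (b + Pi.single i 1)) := by
  refine ⟨blockLo M b + Pi.single i ((M : ℤ) - 1), blockLo M (b + Pi.single i 1), ?_, ?_, Or.inr ?_⟩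
  · rw [twoScale_box_inr hL hb]; exact blockLo_add_single_mem hM b i
  · rw [twoScale_box_inr hL hb']; exact blockLo_mem hM _
  · show (twoScaleGraph d L M μ).Adj (scalePt L (blockLo M b + Pi.single i ((M : ℤ) - 1)))
      (scalePt L (blockLo M (b + Pi.single i 1)))
    refine twoScaleGraph_adj_of_coarse hL ?_ (apply_nonneg_of_mem_blockBox hb (blockLo_add_single_mem hM b i))
      (apply_nonneg_of_mem_blockBox hb' (blockLo_mem hM _))
    rw [← blockLo_add_single M b i]
    exact (zdGraph_adj_iff _ _).2 ⟨i, Or.inl rfl⟩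

/-- **The INTERFACE gluing**: for a coarse index b on Σ (b_μ = 0) the fine block L·b and the coarse block b are linked
through the SHARED lattice point L·(M·b) = M·(L·b) — a point of Λ₁ ∩ Σ₁ is a point of both lattices (first clause of
`Atlas.Linked`; M ≥ 1) — model of p. 224, nothing printed asserted. [folklore] -/
theorem twoScale_linked_interface (hL : 0 < L) (hM : 0 < M) {b : Site d} (hb : b μ = 0) :
    (twoScaleAtlas d M hL μ).Linked (Sum.inl (scalePt L b)) (Sum.inr b) := by
  have ha : scalePt L b μ ≤ 0 := by rw [scalePt_apply, hb, mul_zero]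
  refine ⟨blockLo M (scalePt L b), blockLo M b, ?_, ?_, Or.inl ?_⟩
  · rw [twoScale_box_inl hL ha]; exact blockLo_mem hM _
  · rw [twoScale_box_inr hL hb.symm.le]; exact blockLo_mem hM _
  · show blockLo M (scalePt L b) = scalePt L (blockLo M b)
    exact (scalePt_blockLo L M b).symm

/-- Nearest-neighbour admissible fine indices are nerve-adjacent (M ≥ 1). [folklore] -/
theorem twoScale_nerve_adj_inl (hL : 0 < L) (hM : 0 < M) {a a' : Site d} (ha : a μ ≤ 0) (ha' : a' μ ≤ 0)
    (h : (zdGraph d).Adj a a') : (twoScaleAtlas d M hL μ).nerve.Adj (Sum.inl a) (Sum.inl a') := by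
  obtain ⟨i, h' | h'⟩ := (zdGraph_adj_iff a a').1 h
  · subst h'
    exact Atlas.nerve_adj_of_linked _ (fun he => h.ne (Sum.inl_injective he)) (twoScale_linked_inl_add_single hL hM ha ha')
  · subst h'
    exact (Atlas.nerve_adj_of_linked _ (fun he => h.ne (Sum.inl_injective he).symm)
      (twoScale_linked_inl_add_single hL hM ha' ha)).symm

/-- Nearest-neighbour admissible coarse indices are nerve-adjacent (M, L ≥ 1). [folklore] -/
theorem twoScale_nerve_adj_inr (hL : 0 < L) (hM : 0 < M) {b b' : Site d} (hb : 0 ≤ b μ) (hb' : 0 ≤ b' μ)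
    (h : (zdGraph d).Adj b b') : (twoScaleAtlas d M hL μ).nerve.Adj (Sum.inr b) (Sum.inr b') := by
  obtain ⟨i, h' | h'⟩ := (zdGraph_adj_iff b b').1 h
  · subst h'
    exact Atlas.nerve_adj_of_linked _ (fun he => h.ne (Sum.inr_injective he)) (twoScale_linked_inr_add_single hL hM hb hb')
  · subst h'
    exact (Atlas.nerve_adj_of_linked _ (fun he => h.ne (Sum.inr_injective he).symm)
      (twoScale_linked_inr_add_single hL hM hb' hb)).symm

/-- The interface pairs are nerve-adjacent (M ≥ 1). [folklore] -/
theorem twoScale_nerve_adj_interface (hL : 0 < L) (hM : 0 < M) {b : Site d} (hb : b μ = 0) :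
    (twoScaleAtlas d M hL μ).nerve.Adj (Sum.inl (scalePt L b)) (Sum.inr b) :=
  Atlas.nerve_adj_of_linked _ Sum.inl_ne_inr (twoScale_linked_interface hL hM hb)

/-- **The fine blocks are charted by their index lattice**: `Sum.inl` is a box chart OF THE NERVE on the half-space
{a_μ ≤ 0} of indices — a chart one level up (M ≥ 1). [folklore] -/
theorem twoScale_indexChart_inl (hL : 0 < L) (hM : 0 < M) :
    IsBoxChart (twoScaleAtlas d M hL μ).nerve {a : Site d | a μ ≤ 0} Sum.inl :=
  ⟨cboxClosed_setOf_apply_le μ 0, fun _ _ ha ha' h => twoScale_nerve_adj_inl hL hM ha ha' h⟩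

/-- The coarse blocks are charted by their index lattice: `Sum.inr` is a box chart of the nerve on {0 ≤ b_μ}
(M, L ≥ 1). [folklore] -/
theorem twoScale_indexChart_inr (hL : 0 < L) (hM : 0 < M) :
    IsBoxChart (twoScaleAtlas d M hL μ).nerve {b : Site d | 0 ≤ b μ} Sum.inr :=
  ⟨cboxClosed_setOf_le_apply μ 0, fun _ _ hb hb' h => twoScale_nerve_adj_inr hL hM hb hb' h⟩

/-- Nerve distance between fine blocks ≤ the ℓ¹ distance of their indices (M ≥ 1). [folklore] -/
theorem twoScale_nerve_dist_inl_le (hL : 0 < L) (hM : 0 < M) {a a' : Site d} (ha : a μ ≤ 0) (ha' : a' μ ≤ 0) :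
    (twoScaleAtlas d M hL μ).nerve.dist (Sum.inl a) (Sum.inl a') ≤ latL1Dist a a' :=
  dist_le_latL1Dist_of_chart (twoScale_indexChart_inl hL hM) ha ha'

/-- Nerve distance between coarse blocks ≤ the ℓ¹ distance of their indices (M, L ≥ 1). [folklore] -/
theorem twoScale_nerve_dist_inr_le (hL : 0 < L) (hM : 0 < M) {b b' : Site d} (hb : 0 ≤ b μ) (hb' : 0 ≤ b' μ) :
    (twoScaleAtlas d M hL μ).nerve.dist (Sum.inr b) (Sum.inr b') ≤ latL1Dist b b' :=
  dist_le_latL1Dist_of_chart (twoScale_indexChart_inr hL hM) hb hb'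

/-- L·b₀ is an admissible fine index when (b₀)_μ = 0. [folklore] -/
theorem scalePt_apply_nonpos_of_eq_zero {b₀ : Site d} (h : b₀ μ = 0) : scalePt L b₀ μ ≤ 0 := by
  rw [scalePt_apply, h, mul_zero]

/-- **The nerve of the two-scale atlas joins the two levels**: a fine block a and a coarse block b are joined by the
nerve chain a → … → L·b₀ (fine) — b₀ (interface) → … → b (coarse), b₀ := b with its μ-coordinate set to 0 (M ≥ 1). [folklore] -/
theorem twoScale_nerve_reachable_inl_inr (hL : 0 < L) (hM : 0 < M) {a b : Site d} (ha : a μ ≤ 0) (hb : 0 ≤ b μ) :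
    (twoScaleAtlas d M hL μ).nerve.Reachable (Sum.inl a) (Sum.inr b) := by
  have h0 : Function.update b μ 0 μ = 0 := Function.update_self μ 0 b
  exact ((reachable_of_chart (twoScale_indexChart_inl hL hM) ha (scalePt_apply_nonpos_of_eq_zero (L := L) h0)).trans
    (twoScale_nerve_adj_interface hL hM h0).reachable).trans
    (reachable_of_chart (twoScale_indexChart_inr hL hM) h0.symm.le hb)

/-- … at nerve distance ≤ ‖a − L·b₀‖₁ + 1 + ‖b₀ − b‖₁. [folklore] -/
theorem twoScale_nerve_dist_inl_inr_le (hL : 0 < L) (hM : 0 < M) {a b : Site d} (ha : a μ ≤ 0) (hb : 0 ≤ b μ) :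
    (twoScaleAtlas d M hL μ).nerve.dist (Sum.inl a) (Sum.inr b) ≤
      latL1Dist a (scalePt L (Function.update b μ 0)) + 1 + latL1Dist (Function.update b μ 0) b := by
  have h0 : Function.update b μ 0 μ = 0 := Function.update_self μ 0 b
  have h1 := twoScale_nerve_dist_inl_le hL hM ha (scalePt_apply_nonpos_of_eq_zero (L := L) h0)
  have h2 := SimpleGraph.dist_eq_one_iff_adj.2 (twoScale_nerve_adj_interface hL hM h0)
  have h3 := twoScale_nerve_dist_inr_le hL hM h0.symm.le hb
  have t1 := (reachable_of_chart (twoScale_indexChart_inl hL hM) ha (scalePt_apply_nonpos_of_eq_zero (L := L) h0)).dist_triangle_left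
    (G := (twoScaleAtlas d M hL μ).nerve) (Sum.inr b)
  have t2 := (twoScale_nerve_adj_interface hL hM h0).reachable.dist_triangle_left
    (G := (twoScaleAtlas d M hL μ).nerve) (Sum.inr b)
  omega

/-- **The across-chart bound of §7 in the two-scale model, within the fine level**: x in fine block a, x′ in fine block
a′ are at two-scale graph distance ≤ d(M − 1) + ‖a − a′‖₁·(d(M − 1) + 1). [folklore] -/
theorem twoScale_dist_le_inl_inl (hL : 0 < L) (hM : 0 < M) {a a' x x' : Site d} (ha : a μ ≤ 0) (ha' : a' μ ≤ 0)
    (hx : x ∈ (blockAtlas d M).box a) (hx' : x' ∈ (blockAtlas d M).box a') :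
    (twoScaleGraph d L M μ).dist x x' ≤ d * (M - 1) + latL1Dist a a' * (d * (M - 1) + 1) :=
  dist_le_of_nerve_dist_le (𝔄 := twoScaleAtlas d M hL μ) (latWidth_twoScaleBox hL)
    (reachable_of_chart (twoScale_indexChart_inl hL hM) ha ha') (twoScale_nerve_dist_inl_le hL hM ha ha')
    (a := Sum.inl a) (a' := Sum.inl a') (by rwa [twoScale_box_inl hL ha]) (by rwa [twoScale_box_inl hL ha'])

/-- … within the coarse level: L·y, L·y′ for y in coarse block b, y′ in coarse block b′ are at two-scale graph distance
≤ d(M − 1) + ‖b − b′‖₁·(d(M − 1) + 1). [folklore] -/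
theorem twoScale_dist_le_inr_inr (hL : 0 < L) (hM : 0 < M) {b b' y y' : Site d} (hb : 0 ≤ b μ) (hb' : 0 ≤ b' μ)
    (hy : y ∈ (blockAtlas d M).box b) (hy' : y' ∈ (blockAtlas d M).box b') :
    (twoScaleGraph d L M μ).dist (scalePt L y) (scalePt L y') ≤ d * (M - 1) + latL1Dist b b' * (d * (M - 1) + 1) :=
  dist_le_of_nerve_dist_le (𝔄 := twoScaleAtlas d M hL μ) (latWidth_twoScaleBox hL)
    (reachable_of_chart (twoScale_indexChart_inr hL hM) hb hb') (twoScale_nerve_dist_inr_le hL hM hb hb')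
    (a := Sum.inr b) (a' := Sum.inr b') (by rwa [twoScale_box_inr hL hb]) (by rwa [twoScale_box_inr hL hb'])

/-- **… and ACROSS the two levels**: x in fine block a and L·y for y in coarse block b are at two-scale graph distance
≤ d(M − 1) + (‖a − L·b₀‖₁ + 1 + ‖b₀ − b‖₁)·(d(M − 1) + 1) — every hypothesis of §7 (widths, nerve reachability, nerve
distance) instantiated on a genuinely two-level atlas. [folklore] -/
theorem twoScale_dist_le_inl_inr (hL : 0 < L) (hM : 0 < M) {a b x y : Site d} (ha : a μ ≤ 0) (hb : 0 ≤ b μ)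
    (hx : x ∈ (blockAtlas d M).box a) (hy : y ∈ (blockAtlas d M).box b) :
    (twoScaleGraph d L M μ).dist x (scalePt L y) ≤ d * (M - 1) +
      (latL1Dist a (scalePt L (Function.update b μ 0)) + 1 + latL1Dist (Function.update b μ 0) b) * (d * (M - 1) + 1) :=
  dist_le_of_nerve_dist_le (𝔄 := twoScaleAtlas d M hL μ) (latWidth_twoScaleBox hL)
    (twoScale_nerve_reachable_inl_inr hL hM ha hb) (twoScale_nerve_dist_inl_inr_le hL hM ha hb)
    (a := Sum.inl a) (a' := Sum.inr b) (by rwa [twoScale_box_inl hL ha]) (by rwa [twoScale_box_inr hL hb])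

/-- The index (⌊v_μ / M⌋)_μ of the block of side M containing the lattice point v. [folklore] -/
def blockIdx (M : ℕ) (v : Site d) : Site d := fun i => v i / (M : ℤ)

/-- Coordinates of the block index. [folklore] -/
theorem blockIdx_apply (M : ℕ) (v : Site d) (i : Fin d) : blockIdx M v i = v i / (M : ℤ) := rfl

/-- Every lattice point lies in the block indexed by (⌊v_μ / M⌋)_μ (M ≥ 1). [folklore] -/
theorem mem_blockBox_blockIdx (hM : 0 < M) (v : Site d) : v ∈ (blockAtlas d M).box (blockIdx M v) := by
  rw [mem_blockBox_iff]
  intro i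
  rw [blockIdx_apply]
  have hM' : (0 : ℤ) < M := by exact_mod_cast hM
  have h1 := Int.mul_ediv_add_emod (v i) (M : ℤ)
  have h2 := Int.emod_nonneg (v i) hM'.ne'
  have h3 := Int.emod_lt_of_pos (v i) hM'
  constructor <;> omega

/-- A fine point lies in an admissible fine block: ⌊x_μ / M⌋ ≤ 0 for x_μ < M (M ≥ 1). [folklore] -/
theorem blockIdx_apply_nonpos_of_lt (hM : 0 < M) {x : Site d} (hx : x μ < M) : blockIdx M x μ ≤ 0 := by
  rw [blockIdx_apply]
  have hM' : (0 : ℤ) < M := by exact_mod_cast hM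
  have := (Int.ediv_lt_iff_lt_mul hM').2 (by simpa using hx : x μ < 1 * (M : ℤ))
  omega

/-- A coarse point lies in an admissible coarse block: 0 ≤ ⌊y_μ / M⌋ for 0 ≤ y_μ. [folklore] -/
theorem blockIdx_apply_nonneg {y : Site d} (hy : 0 ≤ y μ) : 0 ≤ blockIdx M y μ :=
  Int.ediv_nonneg hy (Int.natCast_nonneg M)

/-- **The block containing a point is unique**: x ∈ block a forces a = (⌊x_μ / M⌋)_μ (M ≥ 1). [folklore] -/
theorem blockIdx_eq_of_mem (hM : 0 < M) {a x : Site d} (hx : x ∈ (blockAtlas d M).box a) : blockIdx M x = a := by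
  funext i
  rw [blockIdx_apply]
  obtain ⟨hlo, hhi⟩ := (mem_blockBox_iff).1 hx i
  have hM' : (0 : ℤ) < M := by exact_mod_cast hM
  have h1 := Int.mul_ediv_add_emod (x i) (M : ℤ)
  have h2 := Int.emod_nonneg (x i) hM'.ne'
  have h3 := Int.emod_lt_of_pos (x i) hM'
  have h4 : (M : ℤ) * a i < (M : ℤ) * (x i / (M : ℤ) + 1) := by rw [mul_add, mul_one]; omega
  have h5 : (M : ℤ) * (x i / (M : ℤ)) < (M : ℤ) * (a i + 1) := by rw [mul_add, mul_one]; omega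
  have h6 := Int.lt_of_mul_lt_mul_left h4 hM'.le
  have h7 := Int.lt_of_mul_lt_mul_left h5 hM'.le
  omega

/-- **The blocks of side M ≥ 1 PARTITION ℤ^d**: distinct blocks are disjoint (cross-read C-pv22g16, INFO I-2). [folklore] -/
theorem blockAtlas_disjoint (hM : 0 < M) {a b : Site d} (h : a ≠ b) :
    Disjoint ((blockAtlas d M).box a) ((blockAtlas d M).box b) :=
  Set.disjoint_left.2 fun _ hxa hxb => h ((blockIdx_eq_of_mem hM hxa).symm.trans (blockIdx_eq_of_mem hM hxb))

/-- **(α) in the two-scale model**: any two points of T are joined by a path of the two-scale graph, obtained through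
the two-scale block atlas (cover by admissible blocks + nerve reachability across the interface; M, L ≥ 1). [folklore] -/
theorem twoScale_reachable (hL : 0 < L) (hM : 0 < M) {u v : Site d} (hu : u ∈ twoScalePts d L M μ) (hv : v ∈ twoScalePts d L M μ) :
    (twoScaleGraph d L M μ).Reachable u v := by
  have key : ∀ {x y : Site d}, x μ < M → 0 ≤ y μ → (twoScaleGraph d L M μ).Reachable x (scalePt L y) := by
    intro x y hx hy
    have ha := blockIdx_apply_nonpos_of_lt hM hx
    have hb := blockIdx_apply_nonneg (M := M) hy
    exact reachable_of_atlas (𝔄 := twoScaleAtlas d M hL μ) (twoScale_nerve_reachable_inl_inr hL hM ha hb)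
      (x := x) (by rw [twoScale_box_inl hL ha]; exact mem_blockBox_blockIdx hM x)
      (y := y) (by rw [twoScale_box_inr hL hb]; exact mem_blockBox_blockIdx hM y)
  rcases hu with hu | ⟨y, hy, rfl⟩ <;> rcases hv with hv | ⟨y', hy', rfl⟩
  · exact reachable_of_chart (isBoxChart_fineRegion (L := L)) hu hv
  · exact key hu hy'
  · exact (key hv hy).symm
  · exact reachable_of_chart (isBoxChart_coarseRegion (M := M) hL) hy hy'

/-! ### 8d. (len) in the two-scale model -/

/-- The η-positions of the coarse point L·y are the Lη-positions of y: η·(L·y) = (Lη)·y. [folklore] -/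
theorem affinePos_scalePt (η : ℝ) (L : ℕ) (y : Site d) :
    affinePos (fun _ => 0) η (scalePt L y) = affinePos (fun _ => 0) (L * η) y := by
  funext i; simp only [affinePos, scalePt]; push_cast; ring

/-- **(len) in the two-scale model**, directly: with zone u = 1 on the coarse side {0 ≤ u_μ} and 0 elsewhere,
positions η·u and ℓ j = L^j η, every bond of the two-scale graph has length ≤ ℓ(min of the zones of its ends) — η-bonds
have length η ≤ L^{0 or 1}η, Lη-bonds (both ends of zone 1) length Lη (η ≥ 0, L ≥ 1) — model of (2.1) p. 224 + p. 231,
nothing printed asserted. [folklore] -/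
theorem bondScale_twoScale {η : ℝ} (hη : 0 ≤ η) (hL : 1 ≤ L) :
    BondScale (twoScaleGraph d L M μ) (fun u => if 0 ≤ u μ then 1 else 0)
      (fun u => affinePos (fun _ => (0 : ℝ)) η u) (fun j => (L : ℝ) ^ j * η) := by
  have key : ∀ u v : Site d, twoScaleRel d L M μ u v →
      dist (affinePos (fun _ => (0 : ℝ)) η u) (affinePos (fun _ => (0 : ℝ)) η v) ≤
        (L : ℝ) ^ (min (if 0 ≤ u μ then 1 else 0) (if 0 ≤ v μ then 1 else 0)) * η := by
    intro u v h
    rcases h with ⟨h, -, -⟩ | ⟨y, y', h, hy, hy', rfl, rfl⟩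
    · calc dist (affinePos (fun _ => (0 : ℝ)) η u) (affinePos (fun _ => (0 : ℝ)) η v)
            ≤ η * (supDist u v : ℝ) := dist_affinePos_le _ hη u v
        _ ≤ η * 1 := by gcongr; exact_mod_cast supDist_le_one_of_adj h
        _ ≤ (L : ℝ) ^ (min (if 0 ≤ u μ then 1 else 0) (if 0 ≤ v μ then 1 else 0)) * η := by
          rw [mul_one]; exact le_mul_of_one_le_left hη (one_le_pow₀ (by exact_mod_cast hL))
    · have hz : 0 ≤ scalePt L y μ := by rw [scalePt_apply]; positivity
      have hz' : 0 ≤ scalePt L y' μ := by rw [scalePt_apply]; positivity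
      rw [if_pos hz, if_pos hz', min_self, pow_one, affinePos_scalePt, affinePos_scalePt]
      calc dist (affinePos (fun _ => (0 : ℝ)) (L * η) y) (affinePos (fun _ => (0 : ℝ)) (L * η) y')
            ≤ (L * η) * (supDist y y' : ℝ) := dist_affinePos_le _ (by positivity) y y'
        _ ≤ (L * η) * 1 := by gcongr; exact_mod_cast supDist_le_one_of_adj h
        _ = L * η := mul_one _
  intro u v huv
  rw [twoScaleGraph, SimpleGraph.fromRel_adj] at huv
  obtain ⟨-, h | h⟩ := huv
  · exact key u v h
  · rw [dist_comm, min_comm]; exact key v u h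

end TwoScale

/-! ### 8e. The LINEAR, M-uniform comparison of the two-scale distance with the η-lattice ℓ¹ distance

Cell GAPS.md G-pv08-1 records as unprinted in [B6] the comparison *"d(y, y″) ≤ O(1)·(L^jη)^{−1}|y − y″|"* used
silently in (2.66) for two points within one partition-of-unity block, possibly on ADJACENT scales.  In the flat
two-scale model of §8a this comparison holds in the following sharp form, UNIFORMLY IN M: for any two points u, v of
T, `(twoScaleGraph d L M μ).dist u v ≤ ‖u − v‖₁ + (L − 1)` (ℓ¹ distance in η-units), and without the additive L − 1
when u lies on the fine side of Σ (u_μ ≤ 0) or when both points are on one scale.  The additive constant is attained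
(d = 1, M = L: the fine point L − 1 and the coarse point L·1 are at ℓ¹ distance 1 and graph distance L: L − 1 fine
bonds down to the shared point 0, one coarse bond up).  Relative to the COARSE scale, ‖u − v‖₁ = L·(Lη)^{−1}|u − v|₁:
the constant is L — an "adjacent-scale constant" in the words of G-pv08-1.  [folklore] model computation; nothing
printed is asserted. -/

section TwoScaleLinear

variable {d L M : ℕ} {μ : Fin d}

/-- ‖L·y − L·y′‖₁ = L·‖y − y′‖₁. [folklore] -/
theorem latL1Dist_scalePt (L : ℕ) (y y' : Site d) : latL1Dist (scalePt L y) (scalePt L y') = L * latL1Dist y y' := by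
  unfold latL1Dist
  rw [Finset.mul_sum]
  refine Finset.sum_congr rfl fun i _ => ?_
  rw [scalePt_apply, scalePt_apply, ← mul_sub, Int.natAbs_mul, Int.natAbs_natCast]

/-- Through the foot y₀ of y on Σ (y₀ := y with y_μ := 0): for u on the fine side of Σ (u_μ ≤ 0) and y on the coarse
side (0 ≤ y_μ), ‖u − L·y₀‖₁ + ‖y₀ − y‖₁ ≤ ‖u − L·y‖₁ (coordinatewise: equality off μ; in the coordinate μ,
(−u_μ) + y_μ ≤ L·y_μ − u_μ as L ≥ 1). [folklore] -/
theorem latL1Dist_foot_le (hL : 1 ≤ L) {u y : Site d} (hu : u μ ≤ 0) (hy : 0 ≤ y μ) :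
    latL1Dist u (scalePt L (Function.update y μ 0)) + latL1Dist (Function.update y μ 0) y ≤
      latL1Dist u (scalePt L y) := by
  unfold latL1Dist
  rw [← Finset.sum_add_distrib]
  refine Finset.sum_le_sum fun i _ => ?_
  rw [scalePt_apply, scalePt_apply]
  by_cases hi : i = μ
  · subst hi
    rw [Function.update_self]
    have hL' : (1 : ℤ) ≤ L := by exact_mod_cast hL
    have h1 : y i ≤ (L : ℤ) * y i := by nlinarith
    omega
  · rw [Function.update_of_ne hi]
    omega

/-- **Across the interface, from the fine side: constant 1.** A fine point u on the fine side of Σ (u_μ ≤ 0) and a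
coarse point L·y (0 ≤ y_μ) are at two-scale graph distance ≤ ‖u − L·y‖₁ (η-units); M-free. [folklore] -/
theorem twoScale_dist_le_latL1Dist_across (hM : 0 < M) (hL : 1 ≤ L) {u y : Site d} (hu : u μ ≤ 0) (hy : 0 ≤ y μ) :
    (twoScaleGraph d L M μ).dist u (scalePt L y) ≤ latL1Dist u (scalePt L y) :=
  (twoScale_dist_le_of_fine_coarse hM (by omega) (hu.trans_lt (by exact_mod_cast hM)) hy).trans
    (latL1Dist_foot_le hL hu hy)

/-- Rounding a coordinate down to the coarse lattice moves it by less than its distance to any coarse coordinate: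
|⌊a/L⌋ − b| ≤ |a − L·b| (L ≥ 1). [folklore] -/
theorem natAbs_ediv_sub_le {L : ℤ} (hL : 0 < L) (a b : ℤ) : (a / L - b).natAbs ≤ (a - L * b).natAbs := by
  have hdiv := Int.mul_ediv_add_emod a L
  have hr0 := Int.emod_nonneg a hL.ne'
  have hrL := Int.emod_lt_of_pos a hL
  generalize a / L = q at hdiv ⊢
  generalize a % L = r at hdiv hr0 hrL ⊢
  subst hdiv
  have key : |q - b| ≤ |L * q + r - L * b| := by
    rcases lt_trichotomy q b with h | h | h
    · rw [abs_of_neg (by omega)]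
      refine le_abs.2 (Or.inr ?_)
      nlinarith
    · subst h; simp
    · rw [abs_of_pos (by omega)]
      refine le_abs.2 (Or.inl ?_)
      nlinarith
  have := Int.natCast_natAbs (q - b) ▸ Int.natCast_natAbs (L * q + r - L * b) ▸ key
  exact_mod_cast this

/-- **Across the interface, from the overlap slab: constant 1 plus L − 1.** A fine point u in the slab 0 ≤ u_μ < M and
a coarse point L·y (0 ≤ y_μ): d(u, L·y) ≤ ‖u − L·y‖₁ + (L − 1) — route: fine bonds from u to the coarse point L·z,
z := y with z_μ := ⌊u_μ/L⌋ (a fine point, (L·z)_μ ≤ u_μ < M, at ℓ¹ distance Σ_{i ≠ μ}|u_i − L y_i| + (u_μ mod L) from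
u), then coarse bonds from L·z to L·y (‖z − y‖₁ = |⌊u_μ/L⌋ − y_μ| ≤ |u_μ − L y_μ|, `natAbs_ediv_sub_le`); M-free.
[folklore] -/
theorem twoScale_dist_le_latL1Dist_slab (hL : 1 ≤ L) {u y : Site d} (hu0 : 0 ≤ u μ) (huM : u μ < M) (hy : 0 ≤ y μ) :
    (twoScaleGraph d L M μ).dist u (scalePt L y) ≤ latL1Dist u (scalePt L y) + (L - 1) := by
  have hL0 : (0 : ℤ) < L := by exact_mod_cast hL
  set z : Site d := Function.update y μ (u μ / L) with hz
  have hzμ : z μ = u μ / L := by rw [hz, Function.update_self]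
  have hz0 : 0 ≤ z μ := hzμ ▸ Int.ediv_nonneg hu0 hL0.le
  have hLz : scalePt L z μ ≤ u μ := by rw [scalePt_apply, hzμ]; exact Int.mul_ediv_self_le hL0.ne'
  have h1 := twoScale_dist_le_of_fine (L := L) huM (hLz.trans_lt huM)
  have h2 := twoScale_dist_le_of_coarse (L := L) (M := M) (by omega) hz0 hy
  have h3 := (reachable_of_chart (isBoxChart_fineRegion (L := L)) huM (hLz.trans_lt huM)).dist_triangle_left
    (G := twoScaleGraph d L M μ) (scalePt L y)
  -- the arithmetic: ‖u − L·z‖₁ + ‖z − y‖₁ ≤ ‖u − L·y‖₁ + (L − 1)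
  have h4 : latL1Dist u (scalePt L z) + latL1Dist z y ≤ latL1Dist u (scalePt L y) + (L - 1) := by
    have hsplit : latL1Dist u (scalePt L y) + (L - 1) =
        ∑ i : Fin d, ((u i - scalePt L y i).natAbs + if i = μ then L - 1 else 0) := by
      rw [Finset.sum_add_distrib, Finset.sum_ite_eq' Finset.univ μ, if_pos (Finset.mem_univ μ)]; rfl
    rw [hsplit]
    unfold latL1Dist
    rw [← Finset.sum_add_distrib]
    refine Finset.sum_le_sum fun i _ => ?_
    rw [scalePt_apply, scalePt_apply]
    by_cases hi : i = μ
    · subst hi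
      rw [if_pos rfl, hzμ]
      have hq := natAbs_ediv_sub_le hL0 (u i) (y i)
      have hdiv := Int.mul_ediv_add_emod (u i) L
      have hr0 := Int.emod_nonneg (u i) hL0.ne'
      have hrL := Int.emod_lt_of_pos (u i) hL0
      have hrem : (u i - (L : ℤ) * (u i / L)).natAbs ≤ L - 1 := by
        have : u i - (L : ℤ) * (u i / L) = u i % L := by omega
        rw [this]; omega
      omega
    · rw [if_neg hi, hz, Function.update_of_ne hi]
      simp
  omega

/-- **The M-uniform linear comparison on all of T** (the two-scale form of G-pv08-1's unprinted comparison, in the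
flat model of §8a): for any two points u, v of the two-scale point set, `dist u v ≤ ‖u − v‖₁ + (L − 1)` in η-units —
fine–fine and coarse–coarse pairs with constant 1 and no additive term (`twoScale_dist_le_of_fine`, `_of_coarse` with
‖y − y′‖₁ ≤ ‖L·y − L·y′‖₁), fine–coarse pairs by `twoScale_dist_le_latL1Dist_across` (u_μ ≤ 0) or `_slab`
(0 ≤ u_μ < M).  Relative to the coarse scale the multiplicative constant is L ("adjacent-scale constant"); the bound
does not involve M. [folklore] -/
theorem twoScale_dist_le_latL1Dist_add (hM : 0 < M) (hL : 1 ≤ L) {u v : Site d} (hu : u ∈ twoScalePts d L M μ)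
    (hv : v ∈ twoScalePts d L M μ) : (twoScaleGraph d L M μ).dist u v ≤ latL1Dist u v + (L - 1) := by
  -- fine–coarse, in either order of the arguments
  have hfc : ∀ {u y : Site d}, u μ < M → 0 ≤ y μ →
      (twoScaleGraph d L M μ).dist u (scalePt L y) ≤ latL1Dist u (scalePt L y) + (L - 1) := by
    intro u y hu hy
    rcases le_or_gt (u μ) 0 with h0 | h0
    · exact (twoScale_dist_le_latL1Dist_across hM hL h0 hy).trans (Nat.le_add_right _ _)
    · exact twoScale_dist_le_latL1Dist_slab hL h0.le hu hy
  rcases hu with hu | ⟨y, hy, rfl⟩ <;> rcases hv with hv | ⟨y', hy', rfl⟩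
  · exact (twoScale_dist_le_of_fine (L := L) hu hv).trans (Nat.le_add_right _ _)
  · exact hfc hu hy'
  · rw [SimpleGraph.dist_comm, latL1Dist_comm]; exact hfc hv hy
  · refine (twoScale_dist_le_of_coarse (L := L) (M := M) (by omega) hy hy').trans ?_
    rw [latL1Dist_scalePt]
    have : latL1Dist y y' ≤ L * latL1Dist y y' := Nat.le_mul_of_pos_left _ (by omega)
    omega

/-- The exponential form in which such comparisons are consumed ((2.66): a kernel decaying in a distance E is
re-expressed as decaying in a distance D with D ≤ C·E + C′, at the price of the rate δ ↦ δ/C and the constant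
e^{(δ/C)·C′}). [folklore] -/
theorem exp_decay_transfer {δ C C' E D : ℝ} (hδ : 0 ≤ δ) (hC : 0 < C) (h : D ≤ C * E + C') :
    Real.exp (-(δ * E)) ≤ Real.exp (δ / C * C') * Real.exp (-(δ / C * D)) := by
  rw [← Real.exp_add]
  apply Real.exp_le_exp.2
  have h1 : δ / C * D ≤ δ / C * (C * E + C') := mul_le_mul_of_nonneg_left h (div_nonneg hδ hC.le)
  have h2 : δ / C * (C * E + C') = δ * E + δ / C * C' := by field_simp
  linarith

/-- **The (2.66)-shaped consequence in the two-scale model:** a kernel decaying like e^{−δ‖u − v‖₁} in the η-lattice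
ℓ¹ distance decays like e^{−δ·dist(u, v)} in the two-scale distance, up to the M-FREE constant e^{δ(L − 1)}:
for u, v ∈ T, e^{−δ‖u − v‖₁} ≤ e^{δ(L−1)}·e^{−δ·dist(u,v)} (δ ≥ 0). [folklore] -/
theorem twoScale_exp_decay_le (hM : 0 < M) (hL : 1 ≤ L) {δ : ℝ} (hδ : 0 ≤ δ) {u v : Site d}
    (hu : u ∈ twoScalePts d L M μ) (hv : v ∈ twoScalePts d L M μ) :
    Real.exp (-(δ * latL1Dist u v)) ≤
      Real.exp (δ * ((L : ℝ) - 1)) * Real.exp (-(δ * (twoScaleGraph d L M μ).dist u v)) := by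
  have h := twoScale_dist_le_latL1Dist_add hM hL hu hv
  have h' : ((twoScaleGraph d L M μ).dist u v : ℝ) ≤ 1 * (latL1Dist u v : ℝ) + ((L : ℝ) - 1) := by
    have hL1 : ((L - 1 : ℕ) : ℝ) = (L : ℝ) - 1 := by rw [Nat.cast_sub hL, Nat.cast_one]
    rw [one_mul, ← hL1]
    exact_mod_cast h
  simpa using exp_decay_transfer hδ one_pos h'

end TwoScaleLinear

/-! ## 9. [v1.4, append-only] THE WINDOW SUM OF (2.66): ℤ^d exponential sums, the depth below Σ, and the last «≤» of
(2.66) in the two-scale model — M-UNIFORM under the decay (2.43)/(2.44) on the scale of the cube, NOT M-uniform for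
the display read literally [folklore model computations bearing on (2.44) p. 230, (2.66) and Prop. 2.2 p. 234, Prop.
2.6 p. 247; nothing printed is asserted]

THE PRINTED INPUTS (verbatim; renders pp. 229, 230, 234, 247 [PDF 7, 8, 12, 25]).  p. 229: *"Each set Λ_j is a sum of
big blocks of the size ML^jη(Λ_j ⊂ T^{(j)}_{L^jη}), or of the size M if Λ_j is scaled to unit lattice. We cover
B^j(Λ_j) by a sum of cubes □ of the size 2ML^jη, each cube being a sum of 2^d big blocks with a center y ∈ Λ_j (more
exactly it belongs to the boundary of this set also). Taking these covers for all j from 0 to k we get a family 𝒟 of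
cubes □ of different sizes and such that T_η = ⋃_{□∈𝒟} □."*; (2.37) *"G′₀ = Σ_□ h_□G′(□)h_□,"*.  pp. 229–230: *"Let us
estimate one term in the sum over □ in (2.38). Let us assume that □ is a cube connected with a L^jη-scale (i.e. a cube
of the size 2ML^jη) and intersecting maybe the domain B^{j+1}(Λ_{j+1})."*; p. 230: *"If □ ⊂ B^j(Λ_j), then the
necessary properties of G′(□) are described in Lemma 2.2 [3]. If □ intersects both domains B^j(Λ_j) and
B^{j+1}(Λ_{j+1}), then we express G′(□) in terms of operators introduced in the paper."*; (2.43) *"|(G′(□)λ)(x)|,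
|(∂^{L^{−j}}_μ G′(□)λ)(x)| ≤ O(1)e^{−δ₀dist(x, supp λ)}|λ|."*; *"This inequality and (2.40) imply
|(K(h_□)G′(□)h_□λ)(x)| ≤ O(M^{−1})e^{−δ₀|x−y|}|λ| (2.44) if either supp λ ⊂ B^j(y) for y ∈ Λ_j, or supp λ ⊂ B^{j+1}(y)
for y ∈ Λ_{j+1}. The distance in the above inequality is measured on L^{−j}-scale."*  p. 234: (2.65) *"|(Rⁿλ)(x)| ≤
(O(M^{−1})c₁)ⁿe^{−½δ₀d(y,y′)}|λ|,"*; (2.66) as quoted in full in the file header (window y″ : (L^jη)^{−1}|y − y″| ≤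
2dM, weight e^{−δ₀(L^jη)^{−1}|y−y″|}, j = the level of y, x ∈ B^j(y)); *"Proposition 2.2. If we have (2.1), (2.2) and
M is sufficiently large, then the operator G′ = Δ′_a^{−1}(a = 1) satisfies the inequalities |(G′λ)(x)|, … ≤
O(1)[(L^jη)², …]·e^{−½δ₀d(y,y′)}|λ|, x ∈ B^j(y) …, y ∈ Λ_j, supp λ ⊂ B^{j′}(y′), y′ ∈ Λ_{j′}. (2.67)"* (the lists
elided here are the six quantities and their six prefactors).  p. 247: *"Reasoning in the same way as in the proof of
Proposition 2.2 we obtain Proposition 2.6. There exists a positive constant δ₃ depending on d and L only, such that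
|(GJ)(x)|, |(∇GJ)(x)|, |(G∇*J)(x)|, |(ΔGJ)(x)| ≤ O(1)[(L^jη)², L^jη, L^jη, 1]e^{−δ₃d(y,y′)}|J| (2.136) for x ∈ Δ(y), y
∈ Λ_j, supp J ⊂ Δ(y′), with the constant O(1) depending on d and L only;"*.  c₀ is the constant of Lemma 2.1, in the
tree `B6.c0 δ₀ α` = Σ_{n∈ℤ} e^{−αδ₀|n|} (p. 233; `…Balaban1983to89.B6`).

WHAT THE LAST «≤» OF (2.66) CONSUMES (ours).  By (2.54), e^{−½δ₀d(y″,y′)} ≤ e^{½δ₀d(y,y″)}·e^{−½δ₀d(y,y′)} for every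
y″ (§7 `exp_shift_of_dist_le`), so the last «≤» holds with the constant C(y) = Σ_{y″} w(y, y″)·e^{½δ₀d(y,y″)}, where
w(y, y″) is the decay factor carried by G′₀ between B^j(y) and B^{j″}(y″).  By (2.37) and (2.43)/(2.44) that factor is
e^{−δ₀·(ℓ¹ distance ON THE SCALE OF THE CUBE □ through which y″ contributes)}; the DISPLAY of (2.66) writes the single
exponent (L^jη)^{−1}|y − y″| on the scale of the level j OF y.  The two coincide for cubes of level j; for a cube of a
finer level j − 1 reaching up to B^j(y) (y near Σ_j) the displayed exponent is the weaker one (a valid but lossy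
step); a cube of the coarser level j + 1 reaching down to B^j(y) is not in the case list of p. 230 — whether the cover
𝒟 of p. 229 (*"center y ∈ Λ_j (more exactly it belongs to the boundary of this set also)"*) contains cubes protruding
into a FINER region is not decided by the print and stays LOCATED (cell GAPS.md G-pv08-1); for such a cube (2.44) as
printed gives over the finer points only the decay on the coarser scale, i.e. exactly the displayed (literal) weight.

WHAT IS PROVED HERE (kernel; the flat two-scale model of §8: fine points = the finer of two adjacent levels, in
η-lattice coordinates; coarse points L·b; Σ = {x_μ = 0}; all sums over arbitrary FINITE sets of points of T — no
window is needed for the upper bounds, and the lower bounds use points inside the window of (2.66)).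
(9a) [folklore] ℤ^d exponential sums BY NAME from the tree's counting lemma (`B6Lemma21TwoScale.sum_exp_le_c0_pow`,
  the only counting principle behind (2.58)/(2.61)): `sum_exp_neg_latL1Dist_le_c0_pow` — Σ_{z∈S} e^{−αδ₀‖u − z‖₁} ≤
  c₀(δ₀, α)^d for every finite S ⊂ ℤ^d and αδ₀ > 0 (`sum_exp_neg_latL1Dist_le`: α = 1).
(9b) [folklore] the DEPTH (−x_μ)⁺ below Σ is 1-Lipschitz along two-scale bonds (`depth_le_of_twoScale_adj`: an η-bond
  moves one coordinate by 1, an Lη-bond has both ends at depth 0), hence `depth_le_add_twoScale_dist` (depth u ≤ depth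
  v + dist(u, v) on T, through the general `le_add_length_of_adj_le` / `le_add_dist_of_adj_le`) and the EXACT vertical
  distances `twoScale_dist_vertical` (dist(−D·e_μ, −N·e_μ) = N − D for D ≤ N; ≤ by the fine chart of §8b) and
  `twoScale_dist_zero_vertical` (dist(0, −N·e_μ) = N: no coarse shortcut shortens a descent below Σ).
(9c) [model, the SCALE-CORRECT weights — decay in the units of the finer level for every pair, as (2.44) gives for the
  cubes of p. 230's case list] `twoScale_windowTerm_le` / `twoScale_windowSum_le`: for u ∈ T and finite S ⊆ T, Σ_{v∈S}
  e^{−δ₀‖u − v‖₁}·e^{½δ₀·dist(u,v)} ≤ e^{½δ₀(L−1)}·c₀(δ₀, ½)^d (from §8e: dist ≤ ‖u − v‖₁ + (L − 1));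
  `twoScale_windowSum_coarse_le`: for coarse pairs in Lη-units (cubes □ ⊂ B^{j+1}(Λ_{j+1})) Σ_{b″∈S} e^{−δ₀‖b − b″‖₁}·
  e^{½δ₀·dist(L·b, L·b″)} ≤ c₀(δ₀, ½)^d; and the last «≤» of (2.66) in the model, `twoScale_sum266_le`: Σ_{y″∈S}
  e^{−δ₀‖y − y″‖₁}·e^{−½δ₀d(y″,y′)} ≤ e^{½δ₀(L−1)}·c₀(δ₀, ½)^d·e^{−½δ₀d(y,y′)} for y ∈ T, any y′, finite S ⊆ T — the
  constant depends on d, L, δ₀ only: UNIFORM IN M at the printed rate ½δ₀ ((2.54) on the model is Mathlib's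
  `SimpleGraph.Reachable.dist_triangle_left` with §8c `twoScale_reachable`).
(9d) [model, the LITERAL weights of the display: exponent on the scale of the level of y, for y = 0 = L·0 a point of
  the coarse lattice on Σ and fine y″ below it the weight e^{−(δ₀/L)‖y − y″‖₁} in η-units — equally the weight (2.44)
  as printed assigns to a coarser cube protruding into the finer region] `twoScale_literal266_lower`: with y′ = −M·e_μ
  and the vertical window y″ = −D·e_μ, 0 ≤ D ≤ M (fine points inside the window of (2.66): ‖y″‖₁ = D ≤ M ≤ 2dM·L,
  `vertWindow_sub`), (M + 1)·e^{−½δ₀d(y,y′)} ≤ Σ_{y″} e^{−(δ₀/L)‖y − y″‖₁}·e^{−½δ₀d(y″,y′)} (L ≥ 2, M ≥ 1, δ₀ ≥ 0: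
  every term is ≥ e^{−½δ₀M} since d(y″, y′) = M − D and D/L ≤ D/2, while d(y, y′) = M), hence
  `twoScale_literal266_not_uniform`: for every K there are M ≥ 1 and such y, y′, y″ with K·e^{−½δ₀d(y,y′)} < the
  window sum — at the printed rate ½δ₀ the literal display admits NO M-uniform constant (the defect is linear in M for
  L = 2 and exponential, e^{δ₀M(½ − 1/L)}, for L ≥ 3).
(9e) [model, literal weights, RATE LOSS] `twoScale_literal266_rateLoss_le`: at any output rate δ′ with 0 ≤ δ′ < δ₀/L,
  δ′ ≤ ½δ₀, Σ_{y″∈S} e^{−(δ₀/L)‖y − y″‖₁}·e^{−½δ₀d(y″,y′)} ≤ e^{δ′(L−1)}·c₀(δ₀/L − δ′, 1)^d·e^{−δ′d(y,y′)} — UNIFORM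
  IN M; and the threshold is sharp, `twoScale_literal266_threshold`: for every δ′ > δ₀/L and every K some M ≥ 1 has
  K·e^{−δ′d(y,y′)} < the single term y″ = y′ = −(LM)·e_μ of the window sum at y = 0 (e^{−(δ₀/L)·LM} = e^{−δ₀M} against
  K·e^{−δ′LM}).

READING (ours; located, nothing printed asserted).  In the flat model the conclusion of (2.66) — Prop. 2.2's
e^{−½δ₀d(y,y′)} with a constant independent of M, the uniformity that p. 247 states for the parallel Prop. 2.6 (*"with
the constant O(1) depending on d and L only"*, proved *"in the same way as in the proof of Proposition 2.2"*) —
FOLLOWS from the per-cube decay (2.43)/(2.44) whenever every cube of 𝒟 meeting two levels is of the finer one (p.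
230's case list), by (9c) applied at each of the two interfaces adjacent to the level of y; it does NOT follow from
the displayed middle expression of (2.66) itself, which for y near Σ_j discards the finer-scale decay that the last
«≤» needs ((9d): ratio ≥ M + 1); and if 𝒟 contains cubes protruding into a finer region with (2.44) as printed for
them, then in the model Prop. 2.2's constant at the printed rate ½δ₀ is NOT uniform in M ((9d)), while an M-uniform
constant is recovered at every rate δ′ < δ₀/L and at none above ((9e)) — a rate loss by the factor 2/L per interface,
compatible with the unspecified rate δ₃(d, L) of Prop. 2.6 but not with the printed ½δ₀ of (2.67) for L ≥ 3.  Which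
alternative is Bałaban's (the cover sentence of p. 229 against the case list of p. 230; whether G′(□) of a protruding
coarser cube in fact decays at the finer rate inside the finer region, where Δ′_a carries the finer averaging term —
plausible, not printed), and whether the consumers of Prop. 2.2 (this paper's Sect. C–E, [B7]) need its O(1) uniformly
in M, remain LOCATED (GAPS.md G-pv08-1, updated by this version).  The lower bounds (9d), (9e) use only that two-scale
bonds change the depth below Σ by at most 1 and that coarse bonds stay at depth 0 ((9b)); they are statements about
the displayed expressions evaluated in the model, not about G′. -/

section LatticeSums

variable {d : ℕ}

/-- **ℤ^d exponential lattice sums** [folklore; the count of (2.58)/(2.61) p. 233–234 in the tree's form]: for every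
finite S ⊂ ℤ^d, centre u and rate αδ₀ > 0, Σ_{z∈S} e^{−αδ₀‖u − z‖₁} ≤ c₀(δ₀, α)^d, where c₀(δ₀, α) = Σ_{n∈ℤ} e^{−αδ₀|n|}
is the constant `B6.c0` of Lemma 2.1 — the tree's counting lemma `B6Lemma21TwoScale.sum_exp_le_c0_pow` (injective code
z ↦ z − u into ℤ^d), used BY NAME. [folklore] -/
theorem sum_exp_neg_latL1Dist_le_c0_pow {δ₀ α : ℝ} (h : 0 < α * δ₀) (u : Site d) (S : Finset (Site d)) :
    ∑ z ∈ S, Real.exp (-(α * δ₀ * (latL1Dist u z : ℝ))) ≤ B6.c0 δ₀ α ^ d := by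
  classical
  have hinj : Set.InjOn (fun z : Site d => fun i => z i - u i) ↑S := by
    intro z _ z' _ hzz'
    funext i
    have := congrFun hzz' i
    simp only at this
    linarith
  have hw : ∀ z ∈ S, (B6Lemma21TwoScale.l1 (fun i => z i - u i) : ℝ) ≤ (latL1Dist u z : ℝ) := by
    intro z _
    rw [latL1Dist_comm]
    exact_mod_cast le_of_eq rfl
  simpa [Fintype.card_fin] using
    B6Lemma21TwoScale.sum_exp_le_c0_pow h S (fun z : Site d => fun i => z i - u i) hinj
      (fun z => (latL1Dist u z : ℝ)) hw

/-- The case α = 1: Σ_{z∈S} e^{−b‖u − z‖₁} ≤ c₀(b, 1)^d for b > 0. [folklore] -/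
theorem sum_exp_neg_latL1Dist_le (u : Site d) (S : Finset (Site d)) {b : ℝ} (hb : 0 < b) :
    ∑ z ∈ S, Real.exp (-(b * (latL1Dist u z : ℝ))) ≤ B6.c0 b 1 ^ d := by
  have := sum_exp_neg_latL1Dist_le_c0_pow (δ₀ := b) (α := 1) (by simpa using hb) u S
  simpa [one_mul] using this

end LatticeSums

/-! ### 9b. One-Lipschitz potentials and the DEPTH below Σ: exact vertical distances in the two-scale model -/

section Potential

variable {V : Type*} {G : SimpleGraph V}

/-- A function that increases by at most 1 along every bond increases by at most the length along a walk.
[folklore] -/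
theorem le_add_length_of_adj_le (f : V → ℕ) (hf : ∀ ⦃a b : V⦄, G.Adj a b → f a ≤ f b + 1) :
    ∀ {u v : V} (p : G.Walk u v), f u ≤ f v + p.length := by
  intro u v p
  induction p with
  | nil => simp
  | cons h p ih =>
    have := hf h
    simp only [SimpleGraph.Walk.length_cons]
    omega

/-- … hence by at most the graph distance between two joined points. [folklore] -/
theorem le_add_dist_of_adj_le (f : V → ℕ) (hf : ∀ ⦃a b : V⦄, G.Adj a b → f a ≤ f b + 1) {u v : V}
    (h : G.Reachable u v) : f u ≤ f v + G.dist u v := by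
  obtain ⟨p, hp⟩ := h.exists_walk_length_eq_dist
  rw [← hp]
  exact le_add_length_of_adj_le f hf p

variable {d L M : ℕ} {μ : Fin d}

/-- The DEPTH of an η-lattice point below the hyperplane Σ = {x_μ = 0}: (−x_μ)⁺. [folklore] -/
def depth (μ : Fin d) (x : Site d) : ℕ := (-x μ).toNat

/-- One coordinate difference is at most the ℓ¹ distance. [folklore] -/
theorem natAbs_apply_sub_le_latL1Dist (u v : Site d) (i : Fin d) : (u i - v i).natAbs ≤ latL1Dist u v :=
  Finset.single_le_sum (f := fun i => (u i - v i).natAbs) (fun _ _ => Nat.zero_le _) (Finset.mem_univ i)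

/-- Along an η-bond the depth changes by at most 1. [folklore] -/
theorem depth_le_of_zd_adj {u v : Site d} (h : (zdGraph d).Adj u v) (μ : Fin d) : depth μ u ≤ depth μ v + 1 := by
  have h1 := natAbs_apply_sub_le_latL1Dist u v μ
  rw [latL1Dist_eq_one_of_adj h] at h1
  unfold depth
  omega

/-- Coarse points have depth 0. [folklore] -/
theorem depth_scalePt_eq_zero {y : Site d} (hy : 0 ≤ y μ) : depth μ (scalePt L y) = 0 := by
  unfold depth
  rw [scalePt_apply]
  have : 0 ≤ (L : ℤ) * y μ := mul_nonneg (by positivity) hy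
  omega

/-- Along a two-scale bond the depth changes by at most 1 (fine bonds: one coordinate step; coarse bonds: both ends
at depth 0). [folklore] -/
theorem depth_le_of_twoScaleRel {u v : Site d} (h : twoScaleRel d L M μ u v) :
    depth μ u ≤ depth μ v + 1 ∧ depth μ v ≤ depth μ u + 1 := by
  rcases h with ⟨h, -, -⟩ | ⟨y, y', -, hy, hy', rfl, rfl⟩
  · exact ⟨depth_le_of_zd_adj h μ, depth_le_of_zd_adj h.symm μ⟩
  · rw [depth_scalePt_eq_zero hy, depth_scalePt_eq_zero hy']
    omega

/-- The depth is 1-Lipschitz for the two-scale bond graph. [folklore] -/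
theorem depth_le_of_twoScale_adj {u v : Site d} (h : (twoScaleGraph d L M μ).Adj u v) :
    depth μ u ≤ depth μ v + 1 := by
  rw [twoScaleGraph, SimpleGraph.fromRel_adj] at h
  rcases h.2 with h' | h'
  · exact (depth_le_of_twoScaleRel h').1
  · exact (depth_le_of_twoScaleRel h').2

/-- **Lower bound for the two-scale distance by the depth difference**: for u, v ∈ T,
depth u ≤ depth v + dist(u, v) (M, L ≥ 1). [folklore] -/
theorem depth_le_add_twoScale_dist (hL : 0 < L) (hM : 0 < M) {u v : Site d} (hu : u ∈ twoScalePts d L M μ)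
    (hv : v ∈ twoScalePts d L M μ) : depth μ u ≤ depth μ v + (twoScaleGraph d L M μ).dist u v :=
  le_add_dist_of_adj_le (depth μ) (fun _ _ h => depth_le_of_twoScale_adj h) (twoScale_reachable hL hM hu hv)

/-- ℓ¹ distance of two points on the μ-axis. [folklore] -/
theorem latL1Dist_single_single (μ : Fin d) (a b : ℤ) :
    latL1Dist (Pi.single μ a : Site d) (Pi.single μ b) = (a - b).natAbs := by
  unfold latL1Dist
  rw [Finset.sum_eq_single μ]
  · simp
  · intro i _ hi
    simp [Pi.single_eq_of_ne hi]
  · intro h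
    exact absurd (Finset.mem_univ μ) h

/-- ℓ¹ distance from the origin to a point on the μ-axis. [folklore] -/
theorem latL1Dist_zero_single (μ : Fin d) (b : ℤ) : latL1Dist (0 : Site d) (Pi.single μ b) = b.natAbs := by
  have h := latL1Dist_single_single (d := d) μ 0 b
  rw [Pi.single_zero] at h
  rw [h]
  simp

/-- The point at depth D on the μ-axis has depth D. [folklore] -/
theorem depth_single_neg (μ : Fin d) (D : ℕ) : depth μ (Pi.single μ (-(D : ℤ)) : Site d) = D := by
  unfold depth
  simp

/-- Points of the negative μ-axis are fine points (M ≥ 1). [folklore] -/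
theorem single_neg_apply_lt (hM : 0 < M) (μ : Fin d) (D : ℕ) : (Pi.single μ (-(D : ℤ)) : Site d) μ < M := by
  simp only [Pi.single_eq_same]
  omega

/-- Points of the negative μ-axis belong to T. [folklore] -/
theorem single_neg_mem_twoScalePts (hM : 0 < M) (μ : Fin d) (D : ℕ) :
    (Pi.single μ (-(D : ℤ)) : Site d) ∈ twoScalePts d L M μ :=
  Or.inl (single_neg_apply_lt hM μ D)

/-- **Exact vertical distances**: the points at depths D ≤ N on the μ-axis below Σ are at two-scale distance exactly
N − D (≤: the fine chart; ≥: the depth potential). [folklore] -/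
theorem twoScale_dist_vertical (hL : 0 < L) (hM : 0 < M) (μ : Fin d) {D N : ℕ} (hDN : D ≤ N) :
    (twoScaleGraph d L M μ).dist (Pi.single μ (-(D : ℤ))) (Pi.single μ (-(N : ℤ))) = N - D := by
  apply le_antisymm
  · have h := twoScale_dist_le_of_fine (L := L) (single_neg_apply_lt hM μ D) (single_neg_apply_lt hM μ N)
    rw [latL1Dist_single_single] at h
    omega
  · have h := depth_le_add_twoScale_dist hL hM (single_neg_mem_twoScalePts hM μ N)
      (single_neg_mem_twoScalePts (L := L) hM μ D)
    rw [depth_single_neg, depth_single_neg, SimpleGraph.dist_comm] at h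
    omega

/-- In particular dist(0, −N·e_μ) = N: the origin (a shared point of Σ) and the point at depth N. [folklore] -/
theorem twoScale_dist_zero_vertical (hL : 0 < L) (hM : 0 < M) (μ : Fin d) (N : ℕ) :
    (twoScaleGraph d L M μ).dist (0 : Site d) (Pi.single μ (-(N : ℤ))) = N := by
  have h := twoScale_dist_vertical (d := d) hL hM μ (Nat.zero_le N)
  simpa using h

end Potential

/-! ### 9c. The window sum of (2.66) under the decay of (2.44) on the scale of the cube: M-UNIFORM -/

section WindowSum

variable {d L M : ℕ} {μ : Fin d}

/-- One term: e^{−δ₀‖u − v‖₁}·e^{½δ₀·dist(u,v)} ≤ e^{½δ₀(L−1)}·e^{−½δ₀‖u − v‖₁} for u, v ∈ T (δ₀ ≥ 0; from the linear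
comparison dist ≤ ‖u − v‖₁ + (L − 1) of §8e). [folklore] -/
theorem twoScale_windowTerm_le (hM : 0 < M) (hL : 1 ≤ L) {δ₀ : ℝ} (hδ : 0 ≤ δ₀) {u v : Site d}
    (hu : u ∈ twoScalePts d L M μ) (hv : v ∈ twoScalePts d L M μ) :
    Real.exp (-(δ₀ * (latL1Dist u v : ℝ))) * Real.exp (δ₀ / 2 * ((twoScaleGraph d L M μ).dist u v : ℝ)) ≤
      Real.exp (δ₀ / 2 * ((L : ℝ) - 1)) * Real.exp (-(1 / 2 * δ₀ * (latL1Dist u v : ℝ))) := by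
  have h := twoScale_dist_le_latL1Dist_add hM hL hu hv
  have h' : ((twoScaleGraph d L M μ).dist u v : ℝ) ≤ (latL1Dist u v : ℝ) + ((L : ℝ) - 1) := by
    have hL1 : ((L - 1 : ℕ) : ℝ) = (L : ℝ) - 1 := by rw [Nat.cast_sub hL, Nat.cast_one]
    rw [← hL1]
    exact_mod_cast h
  rw [← Real.exp_add, ← Real.exp_add]
  apply Real.exp_le_exp.2
  have := mul_le_mul_of_nonneg_left h' (by positivity : (0 : ℝ) ≤ δ₀ / 2)
  linarith

/-- **The window sum, scale-correct reading, η-units: M-UNIFORM.**  For u ∈ T and any finite S ⊆ T,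
Σ_{v∈S} e^{−δ₀‖u − v‖₁}·e^{½δ₀·dist(u,v)} ≤ e^{½δ₀(L−1)}·c₀(δ₀, ½)^d (δ₀ > 0; M, L ≥ 1) — no window and no M.
[folklore] -/
theorem twoScale_windowSum_le (hM : 0 < M) (hL : 1 ≤ L) {δ₀ : ℝ} (hδ : 0 < δ₀) {u : Site d}
    (hu : u ∈ twoScalePts d L M μ) (S : Finset (Site d)) (hS : ∀ v ∈ S, v ∈ twoScalePts d L M μ) :
    ∑ v ∈ S, Real.exp (-(δ₀ * (latL1Dist u v : ℝ))) * Real.exp (δ₀ / 2 * ((twoScaleGraph d L M μ).dist u v : ℝ)) ≤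
      Real.exp (δ₀ / 2 * ((L : ℝ) - 1)) * B6.c0 δ₀ (1 / 2) ^ d := by
  calc ∑ v ∈ S, Real.exp (-(δ₀ * (latL1Dist u v : ℝ))) * Real.exp (δ₀ / 2 * ((twoScaleGraph d L M μ).dist u v : ℝ))
      ≤ ∑ v ∈ S, Real.exp (δ₀ / 2 * ((L : ℝ) - 1)) * Real.exp (-(1 / 2 * δ₀ * (latL1Dist u v : ℝ))) :=
        Finset.sum_le_sum fun v hv => twoScale_windowTerm_le hM hL hδ.le hu (hS v hv)
    _ = Real.exp (δ₀ / 2 * ((L : ℝ) - 1)) * ∑ v ∈ S, Real.exp (-(1 / 2 * δ₀ * (latL1Dist u v : ℝ))) := by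
        rw [Finset.mul_sum]
    _ ≤ Real.exp (δ₀ / 2 * ((L : ℝ) - 1)) * B6.c0 δ₀ (1 / 2) ^ d :=
        mul_le_mul_of_nonneg_left (sum_exp_neg_latL1Dist_le_c0_pow (by positivity) u S) (Real.exp_pos _).le

/-- **The window sum for COARSE pairs in Lη-units (cubes □ ⊂ B^{j+1}(Λ_{j+1})): M- and L-free.**  For coarse points
L·b, L·b″ (b_μ, b″_μ ≥ 0): Σ_{b″∈S} e^{−δ₀‖b − b″‖₁}·e^{½δ₀·dist(L·b, L·b″)} ≤ c₀(δ₀, ½)^d (δ₀ > 0, L ≥ 1). [folklore] -/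
theorem twoScale_windowSum_coarse_le (hL : 0 < L) {δ₀ : ℝ} (hδ : 0 < δ₀) {b : Site d} (hb : 0 ≤ b μ)
    (S : Finset (Site d)) (hS : ∀ b'' ∈ S, 0 ≤ b'' μ) :
    ∑ b'' ∈ S, Real.exp (-(δ₀ * (latL1Dist b b'' : ℝ))) *
        Real.exp (δ₀ / 2 * ((twoScaleGraph d L M μ).dist (scalePt L b) (scalePt L b'') : ℝ)) ≤
      B6.c0 δ₀ (1 / 2) ^ d := by
  have hterm : ∀ b'' ∈ S, Real.exp (-(δ₀ * (latL1Dist b b'' : ℝ))) *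
      Real.exp (δ₀ / 2 * ((twoScaleGraph d L M μ).dist (scalePt L b) (scalePt L b'') : ℝ)) ≤
      Real.exp (-(1 / 2 * δ₀ * (latL1Dist b b'' : ℝ))) := by
    intro b'' hb''
    have h : ((twoScaleGraph d L M μ).dist (scalePt L b) (scalePt L b'') : ℝ) ≤ (latL1Dist b b'' : ℝ) := by
      exact_mod_cast twoScale_dist_le_of_coarse (M := M) hL hb (hS b'' hb'')
    rw [← Real.exp_add]
    apply Real.exp_le_exp.2
    have := mul_le_mul_of_nonneg_left h (by positivity : (0 : ℝ) ≤ δ₀ / 2)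
    linarith
  exact (Finset.sum_le_sum hterm).trans (sum_exp_neg_latL1Dist_le_c0_pow (by positivity) b S)

/-- **The last «≤» of (2.66) in the two-scale model, scale-correct reading: M-UNIFORM.**  For y, y′ ∈ T and any
finite S ⊆ T: Σ_{y″∈S} e^{−δ₀‖y − y″‖₁}·e^{−½δ₀·d(y″,y′)} ≤ e^{½δ₀(L−1)}·c₀(δ₀, ½)^d·e^{−½δ₀·d(y,y′)} — by (2.54) on
the model (`SimpleGraph.Reachable.dist_triangle_left` with `twoScale_reachable`) and `twoScale_windowSum_le`; the
constant depends on d, L, δ₀ only. [folklore] -/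
theorem twoScale_sum266_le (hM : 0 < M) (hL : 1 ≤ L) {δ₀ : ℝ} (hδ : 0 < δ₀) {y : Site d}
    (hy : y ∈ twoScalePts d L M μ) (y' : Site d) (S : Finset (Site d))
    (hS : ∀ y'' ∈ S, y'' ∈ twoScalePts d L M μ) :
    ∑ y'' ∈ S, Real.exp (-(δ₀ * (latL1Dist y y'' : ℝ))) *
        Real.exp (-(δ₀ / 2 * ((twoScaleGraph d L M μ).dist y'' y' : ℝ))) ≤
      Real.exp (δ₀ / 2 * ((L : ℝ) - 1)) * B6.c0 δ₀ (1 / 2) ^ d *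
        Real.exp (-(δ₀ / 2 * ((twoScaleGraph d L M μ).dist y y' : ℝ))) := by
  have hterm : ∀ y'' ∈ S, Real.exp (-(δ₀ * (latL1Dist y y'' : ℝ))) *
      Real.exp (-(δ₀ / 2 * ((twoScaleGraph d L M μ).dist y'' y' : ℝ))) ≤
      (Real.exp (-(δ₀ * (latL1Dist y y'' : ℝ))) * Real.exp (δ₀ / 2 * ((twoScaleGraph d L M μ).dist y y'' : ℝ))) *
        Real.exp (-(δ₀ / 2 * ((twoScaleGraph d L M μ).dist y y' : ℝ))) := by
    intro y'' hy''
    have htri : (twoScaleGraph d L M μ).dist y y' ≤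
        (twoScaleGraph d L M μ).dist y y'' + (twoScaleGraph d L M μ).dist y'' y' :=
      (twoScale_reachable (by omega) hM hy (hS y'' hy'')).dist_triangle_left y'
    have htri' : ((twoScaleGraph d L M μ).dist y y' : ℝ) ≤
        ((twoScaleGraph d L M μ).dist y y'' : ℝ) + ((twoScaleGraph d L M μ).dist y'' y' : ℝ) := by
      exact_mod_cast htri
    rw [mul_assoc]
    refine mul_le_mul_of_nonneg_left ?_ (Real.exp_pos _).le
    rw [← Real.exp_add]
    apply Real.exp_le_exp.2
    have := mul_le_mul_of_nonneg_left htri' (by positivity : (0 : ℝ) ≤ δ₀ / 2)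
    linarith
  calc ∑ y'' ∈ S, Real.exp (-(δ₀ * (latL1Dist y y'' : ℝ))) *
        Real.exp (-(δ₀ / 2 * ((twoScaleGraph d L M μ).dist y'' y' : ℝ)))
      ≤ ∑ y'' ∈ S, (Real.exp (-(δ₀ * (latL1Dist y y'' : ℝ))) *
          Real.exp (δ₀ / 2 * ((twoScaleGraph d L M μ).dist y y'' : ℝ))) *
          Real.exp (-(δ₀ / 2 * ((twoScaleGraph d L M μ).dist y y' : ℝ))) := Finset.sum_le_sum hterm
    _ = (∑ y'' ∈ S, Real.exp (-(δ₀ * (latL1Dist y y'' : ℝ))) *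
          Real.exp (δ₀ / 2 * ((twoScaleGraph d L M μ).dist y y'' : ℝ))) *
          Real.exp (-(δ₀ / 2 * ((twoScaleGraph d L M μ).dist y y' : ℝ))) := by rw [Finset.sum_mul]
    _ ≤ _ := mul_le_mul_of_nonneg_right (twoScale_windowSum_le hM hL hδ hy S hS) (Real.exp_pos _).le

end WindowSum

/-! ### 9d. The display of (2.66) read LITERALLY (one exponent, on the scale of the level of y): NO M-uniform
constant at the printed rate ½δ₀; an M-uniform constant after the rate loss ½δ₀ ↦ δ′ < δ₀/L; none for δ′ > δ₀/L -/

section Literal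

variable {d L M : ℕ}

/-- The vertical window below the shared point 0 ∈ Σ: the fine points −D·e_μ, D = 0, …, M. [folklore] -/
def vertWindow (d M : ℕ) (μ : Fin d) : Finset (Site d) :=
  (Finset.range (M + 1)).image fun D : ℕ => (Pi.single μ (-(D : ℤ)) : Site d)

/-- D ↦ −D·e_μ is injective. [folklore] -/
theorem single_neg_injective (μ : Fin d) : Function.Injective fun D : ℕ => (Pi.single μ (-(D : ℤ)) : Site d) := by
  intro D D' h
  have := congrFun h μ
  simp only [Pi.single_eq_same, neg_inj, Nat.cast_inj] at this
  exact this

/-- The vertical window lies in T and inside the window (Lη)^{−1}|y − y″| ≤ 2dM of (2.66) around y = 0 (in η-units: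
‖y″‖₁ ≤ 2dM·L; here ‖−D·e_μ‖₁ = D ≤ M). [folklore] -/
theorem vertWindow_sub (hM : 0 < M) (hL : 1 ≤ L) (μ : Fin d) :
    ∀ y'' ∈ vertWindow d M μ, y'' ∈ twoScalePts d L M μ ∧ latL1Dist (0 : Site d) y'' ≤ 2 * d * M * L := by
  intro y'' hy''
  simp only [vertWindow, Finset.mem_image, Finset.mem_range] at hy''
  obtain ⟨D, hD, rfl⟩ := hy''
  refine ⟨single_neg_mem_twoScalePts hM μ D, ?_⟩
  rw [latL1Dist_zero_single]
  have hd : 0 < d := Fin.pos μ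
  have h1 : D ≤ M := by omega
  have h2 : M ≤ 2 * d * M * L := by
    have : 1 ≤ 2 * d * L := by nlinarith
    nlinarith
  simp only [Int.natAbs_neg, Int.natAbs_natCast]
  omega

/-- **The literal display at the printed rate ½δ₀: the window sum exceeds (M + 1)·e^{−½δ₀d(y,y′)}.**  At the shared
point y = 0 = L·0 of Σ (a point of Λ₁), y′ = −M·e_μ (depth M) and the vertical window y″ = −D·e_μ (0 ≤ D ≤ M), with
the weight e^{−δ₀(Lη)^{−1}|y − y″|} = e^{−(δ₀/L)·D} of the display (j = 1 = the level of y):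
(M + 1)·e^{−½δ₀·d(y,y′)} ≤ Σ_{y″} e^{−(δ₀/L)‖y − y″‖₁}·e^{−½δ₀·d(y″,y′)} (L ≥ 2, M ≥ 1, δ₀ ≥ 0; each term is
≥ e^{−½δ₀M} because d(y″, y′) = M − D and D/L ≤ D/2, and d(y, y′) = M). [folklore] -/
theorem twoScale_literal266_lower (hL : 2 ≤ L) (hM : 0 < M) {δ₀ : ℝ} (hδ : 0 ≤ δ₀) (μ : Fin d) :
    ((M : ℝ) + 1) * Real.exp (-(δ₀ / 2 * ((twoScaleGraph d L M μ).dist (0 : Site d) (Pi.single μ (-(M : ℤ))) : ℝ))) ≤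
      ∑ y'' ∈ vertWindow d M μ, Real.exp (-(δ₀ / L * (latL1Dist (0 : Site d) y'' : ℝ))) *
        Real.exp (-(δ₀ / 2 * ((twoScaleGraph d L M μ).dist y'' (Pi.single μ (-(M : ℤ))) : ℝ))) := by
  have hL0 : 0 < L := by omega
  rw [twoScale_dist_zero_vertical hL0 hM μ M, vertWindow,
    Finset.sum_image fun D _ D' _ h => single_neg_injective μ h]
  have hterm : ∀ D ∈ Finset.range (M + 1), Real.exp (-(δ₀ / 2 * (M : ℝ))) ≤
      Real.exp (-(δ₀ / L * (latL1Dist (0 : Site d) (Pi.single μ (-(D : ℤ))) : ℝ))) *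
        Real.exp (-(δ₀ / 2 * ((twoScaleGraph d L M μ).dist (Pi.single μ (-(D : ℤ))) (Pi.single μ (-(M : ℤ))) : ℝ))) := by
    intro D hD
    rw [Finset.mem_range] at hD
    have hDM : D ≤ M := by omega
    rw [twoScale_dist_vertical hL0 hM μ hDM, latL1Dist_zero_single, Int.natAbs_neg, Int.natAbs_natCast,
      Nat.cast_sub hDM, ← Real.exp_add]
    apply Real.exp_le_exp.2
    have hL2 : (2 : ℝ) ≤ L := by exact_mod_cast hL
    have h1 : δ₀ / L ≤ δ₀ / 2 := div_le_div_of_nonneg_left hδ (by norm_num) hL2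
    have h2 : δ₀ / L * (D : ℝ) ≤ δ₀ / 2 * (D : ℝ) := mul_le_mul_of_nonneg_right h1 (by positivity)
    linarith
  have hsum := Finset.card_nsmul_le_sum (Finset.range (M + 1)) _ _ hterm
  rw [Finset.card_range, nsmul_eq_mul] at hsum
  have hc : (((M + 1 : ℕ) : ℝ)) = (M : ℝ) + 1 := by push_cast; ring
  rw [hc] at hsum
  exact hsum

/-- **No M-uniform O(1) for the literal display at the printed rate** (L ≥ 2, δ₀ ≥ 0): for every K there are M ≥ 1,
points y, y′ ∈ T and a finite set of points y″ ∈ T inside the window of (2.66) such that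
K·e^{−½δ₀d(y,y′)} < Σ_{y″} e^{−δ₀(Lη)^{−1}|y − y″|}·e^{−½δ₀d(y″,y′)} with the exponent on the scale of the level of y.
[folklore] -/
theorem twoScale_literal266_not_uniform (hL : 2 ≤ L) {δ₀ : ℝ} (hδ : 0 ≤ δ₀) (μ : Fin d) (K : ℝ) :
    ∃ M : ℕ, 0 < M ∧ ∃ y ∈ twoScalePts d L M μ, ∃ y' ∈ twoScalePts d L M μ, ∃ S : Finset (Site d),
      (∀ y'' ∈ S, y'' ∈ twoScalePts d L M μ ∧ latL1Dist y y'' ≤ 2 * d * M * L) ∧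
      K * Real.exp (-(δ₀ / 2 * ((twoScaleGraph d L M μ).dist y y' : ℝ))) <
        ∑ y'' ∈ S, Real.exp (-(δ₀ / L * (latL1Dist y y'' : ℝ))) *
          Real.exp (-(δ₀ / 2 * ((twoScaleGraph d L M μ).dist y'' y' : ℝ))) := by
  set M : ℕ := ⌈K⌉₊ + 1 with hMdef
  have hM : 0 < M := by omega
  have hKM : K < (M : ℝ) + 1 := by
    have h1 : K ≤ (⌈K⌉₊ : ℝ) := Nat.le_ceil K
    have h2 : (M : ℝ) = (⌈K⌉₊ : ℝ) + 1 := by rw [hMdef]; push_cast; ring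
    linarith
  have h0 : (0 : Site d) ∈ twoScalePts d L M μ :=
    Or.inl (by change (0 : Site d) μ < (M : ℤ); rw [Pi.zero_apply]; exact_mod_cast hM)
  refine ⟨M, hM, 0, h0, Pi.single μ (-(M : ℤ)), single_neg_mem_twoScalePts hM μ M, vertWindow d M μ,
    vertWindow_sub hM (by omega) μ, ?_⟩
  exact lt_of_lt_of_le (mul_lt_mul_of_pos_right hKM (Real.exp_pos _)) (twoScale_literal266_lower hL hM hδ μ)

variable {μ : Fin d}

/-- **Rate loss restores M-uniformity for the literal display**: with the coarse-scale weight e^{−(δ₀/L)‖y − y″‖₁}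
(η-units) and ANY output rate δ′ < δ₀/L, δ′ ≤ ½δ₀: for y, y′ ∈ T and finite S ⊆ T,
Σ_{y″∈S} e^{−(δ₀/L)‖y − y″‖₁}·e^{−½δ₀d(y″,y′)} ≤ e^{δ′(L−1)}·c₀(δ₀/L − δ′, 1)^d·e^{−δ′d(y,y′)} (M, L ≥ 1). [folklore] -/
theorem twoScale_literal266_rateLoss_le (hM : 0 < M) (hL : 1 ≤ L) {δ₀ δ' : ℝ} (hδ' : 0 ≤ δ')
    (hrate : δ' < δ₀ / L) (hhalf : δ' ≤ δ₀ / 2) {y : Site d} (hy : y ∈ twoScalePts d L M μ) (y' : Site d)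
    (S : Finset (Site d)) (hS : ∀ y'' ∈ S, y'' ∈ twoScalePts d L M μ) :
    ∑ y'' ∈ S, Real.exp (-(δ₀ / L * (latL1Dist y y'' : ℝ))) *
        Real.exp (-(δ₀ / 2 * ((twoScaleGraph d L M μ).dist y'' y' : ℝ))) ≤
      Real.exp (δ' * ((L : ℝ) - 1)) * B6.c0 (δ₀ / L - δ') 1 ^ d *
        Real.exp (-(δ' * ((twoScaleGraph d L M μ).dist y y' : ℝ))) := by
  have hterm : ∀ y'' ∈ S, Real.exp (-(δ₀ / L * (latL1Dist y y'' : ℝ))) *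
      Real.exp (-(δ₀ / 2 * ((twoScaleGraph d L M μ).dist y'' y' : ℝ))) ≤
      (Real.exp (δ' * ((L : ℝ) - 1)) * Real.exp (-((δ₀ / L - δ') * (latL1Dist y y'' : ℝ)))) *
        Real.exp (-(δ' * ((twoScaleGraph d L M μ).dist y y' : ℝ))) := by
    intro y'' hy''
    have htri : (twoScaleGraph d L M μ).dist y y' ≤
        (twoScaleGraph d L M μ).dist y y'' + (twoScaleGraph d L M μ).dist y'' y' :=
      (twoScale_reachable (by omega) hM hy (hS y'' hy'')).dist_triangle_left y'
    have htri' : ((twoScaleGraph d L M μ).dist y y' : ℝ) ≤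
        ((twoScaleGraph d L M μ).dist y y'' : ℝ) + ((twoScaleGraph d L M μ).dist y'' y' : ℝ) := by
      exact_mod_cast htri
    have hlin := twoScale_dist_le_latL1Dist_add hM hL hy (hS y'' hy'')
    have hlin' : ((twoScaleGraph d L M μ).dist y y'' : ℝ) ≤ (latL1Dist y y'' : ℝ) + ((L : ℝ) - 1) := by
      have hL1 : ((L - 1 : ℕ) : ℝ) = (L : ℝ) - 1 := by rw [Nat.cast_sub hL, Nat.cast_one]
      rw [← hL1]
      exact_mod_cast hlin
    rw [← Real.exp_add, ← Real.exp_add, ← Real.exp_add]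
    apply Real.exp_le_exp.2
    have hd0 : (0 : ℝ) ≤ ((twoScaleGraph d L M μ).dist y'' y' : ℝ) := by positivity
    have e1 := mul_le_mul_of_nonneg_left htri' hδ'
    have e2 := mul_le_mul_of_nonneg_left hlin' hδ'
    have e3 : δ' * ((twoScaleGraph d L M μ).dist y'' y' : ℝ) ≤ δ₀ / 2 * ((twoScaleGraph d L M μ).dist y'' y' : ℝ) :=
      mul_le_mul_of_nonneg_right hhalf hd0
    nlinarith
  have hsum : ∑ y'' ∈ S, Real.exp (-((δ₀ / L - δ') * (latL1Dist y y'' : ℝ))) ≤ B6.c0 (δ₀ / L - δ') 1 ^ d :=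
    sum_exp_neg_latL1Dist_le y S (by linarith)
  calc ∑ y'' ∈ S, Real.exp (-(δ₀ / L * (latL1Dist y y'' : ℝ))) *
        Real.exp (-(δ₀ / 2 * ((twoScaleGraph d L M μ).dist y'' y' : ℝ)))
      ≤ ∑ y'' ∈ S, (Real.exp (δ' * ((L : ℝ) - 1)) * Real.exp (-((δ₀ / L - δ') * (latL1Dist y y'' : ℝ)))) *
          Real.exp (-(δ' * ((twoScaleGraph d L M μ).dist y y' : ℝ))) := Finset.sum_le_sum hterm
    _ = Real.exp (δ' * ((L : ℝ) - 1)) * (∑ y'' ∈ S, Real.exp (-((δ₀ / L - δ') * (latL1Dist y y'' : ℝ)))) *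
          Real.exp (-(δ' * ((twoScaleGraph d L M μ).dist y y' : ℝ))) := by
        rw [← Finset.sum_mul, ← Finset.mul_sum]
    _ ≤ _ := by
        refine mul_le_mul_of_nonneg_right ?_ (Real.exp_pos _).le
        exact mul_le_mul_of_nonneg_left hsum (Real.exp_pos _).le

/-- **The threshold δ₀/L is sharp for the literal display**: for any output rate δ′ > δ₀/L there is no M-uniform
constant — at y = 0, y′ = y″ = −(LM)·e_μ (inside the window: (Lη)^{−1}|y − y″| = M ≤ 2dM) the single term
e^{−(δ₀/L)·LM} = e^{−δ₀M} exceeds K·e^{−δ′·d(y,y′)} = K·e^{−δ′LM} once M(δ′L − δ₀) > log K (L ≥ 1, δ₀ ≥ 0). [folklore] -/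
theorem twoScale_literal266_threshold (hL : 1 ≤ L) {δ₀ δ' : ℝ} (hrate : δ₀ / L < δ') (μ : Fin d) (K : ℝ) :
    ∃ M : ℕ, 0 < M ∧ ∃ y ∈ twoScalePts d L M μ, ∃ y' ∈ twoScalePts d L M μ, ∃ S : Finset (Site d),
      (∀ y'' ∈ S, y'' ∈ twoScalePts d L M μ ∧ latL1Dist y y'' ≤ 2 * d * M * L) ∧
      K * Real.exp (-(δ' * ((twoScaleGraph d L M μ).dist y y' : ℝ))) <
        ∑ y'' ∈ S, Real.exp (-(δ₀ / L * (latL1Dist y y'' : ℝ))) *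
          Real.exp (-(δ₀ / 2 * ((twoScaleGraph d L M μ).dist y'' y' : ℝ))) := by
  have hL0 : (0 : ℝ) < L := by exact_mod_cast (show 0 < L by omega)
  have hgap : 0 < δ' * L - δ₀ := by
    have := (div_lt_iff₀ hL0).1 hrate
    linarith
  -- choose M with M·(δ′L − δ₀) > log K, M ≥ 1
  obtain ⟨M₀, hM₀⟩ := exists_nat_gt (Real.log (max K 1) / (δ' * L - δ₀))
  set M : ℕ := M₀ + 1 with hMdef
  have hM : 0 < M := by omega
  have hMreal : Real.log (max K 1) / (δ' * L - δ₀) < (M : ℝ) := by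
    have : (M₀ : ℝ) < (M : ℝ) := by rw [hMdef]; push_cast; linarith
    linarith
  have hd : 0 < d := Fin.pos μ
  have h0 : (0 : Site d) ∈ twoScalePts d L M μ :=
    Or.inl (by change (0 : Site d) μ < (M : ℤ); rw [Pi.zero_apply]; exact_mod_cast hM)
  set N : ℕ := L * M with hNdef
  have hyN : (Pi.single μ (-(N : ℤ)) : Site d) ∈ twoScalePts d L M μ := single_neg_mem_twoScalePts hM μ N
  refine ⟨M, hM, 0, h0, Pi.single μ (-(N : ℤ)), hyN, {Pi.single μ (-(N : ℤ))}, ?_, ?_⟩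
  · intro y'' hy''
    rw [Finset.mem_singleton] at hy''
    subst hy''
    refine ⟨hyN, ?_⟩
    rw [latL1Dist_zero_single, Int.natAbs_neg, Int.natAbs_natCast, hNdef]
    have : L * M ≤ 2 * d * M * L := by nlinarith
    exact this
  · rw [Finset.sum_singleton, SimpleGraph.dist_self, twoScale_dist_zero_vertical (by omega) hM μ N,
      latL1Dist_zero_single, Int.natAbs_neg, Int.natAbs_natCast]
    simp only [Nat.cast_zero, mul_zero, neg_zero, Real.exp_zero, mul_one]
    -- K·e^{−δ′N} < e^{−(δ₀/L)·N},  N = L·M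
    have hN : (N : ℝ) = (L : ℝ) * M := by rw [hNdef]; push_cast; ring
    rw [hN]
    have hexp : (δ₀ / L) * ((L : ℝ) * M) = δ₀ * M := by field_simp
    rw [hexp]
    by_cases hK : K ≤ 0
    · exact lt_of_le_of_lt (mul_nonpos_of_nonpos_of_nonneg hK (Real.exp_pos _).le) (Real.exp_pos _)
    · rw [not_le] at hK
      -- log K ≤ log (max K 1) < M (δ′L − δ₀)
      have hlogK : Real.log K ≤ Real.log (max K 1) := Real.log_le_log hK (le_max_left _ _)
      have hMM : Real.log (max K 1) < (M : ℝ) * (δ' * L - δ₀) := by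
        have := (div_lt_iff₀ hgap).1 hMreal
        linarith
      have hlt : Real.log K + -(δ' * ((L : ℝ) * M)) < -(δ₀ * M) := by nlinarith
      calc K * Real.exp (-(δ' * ((L : ℝ) * M)))
          = Real.exp (Real.log K + -(δ' * ((L : ℝ) * M))) := by rw [Real.exp_add, Real.exp_log hK]
        _ < Real.exp (-(δ₀ * M)) := Real.exp_lt_exp.2 hlt

end Literal

end Literature.MathematicalPhysics.QuantumFieldTheory.Balaban1983to89.B6BoxCharts
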